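import Literature.MathematicalPhysics.QuantumFieldTheory.Balaban1983to89.B12Eq213Body268
import Literature.MathematicalPhysics.QuantumFieldTheory.Balaban1983to89.B1Eq221Coordinates
import Literature.MathematicalPhysics.QuantumFieldTheory.Balaban1983to89.B12B0Restriction267
import Literature.MathematicalPhysics.QuantumFieldTheory.Balaban1983to89.B13PkLocalTerms

/-!
# `Balaban1983to89.B12Eq216GaussianCarrier` — T. Bałaban, *Renormalization group approach to lattice gauge field theories. I*,
Commun. Math. Phys. **109** (1987) 249–301 [Balaban1987RG1], p. 268 / (2.16) p. 269: **print's Gaussian measure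
`dμ_{C^{(k)}(U_{k+1})}` AS A MEASURE ON THE FLUCTUATION FIELDS `B′ : T^{(k)}-bonds → 𝔤`, and (2.16) *«therefore the
expression (2.13) is gauge invariant»* for it with BOTH the `χ_k` clause and the measure clause discharged** — the coordinate
chart joining §8 of `B12Eq213Body268` (print's carrier `VecField P k 𝔤`, abstract measures, `χ_k` discharged) with its
§§4–7 (real coordinates `κ → ℝ`, the concrete normalised Gaussian `B2Eq228Conditioning.gaussProb`, measure clause discharged).

HONEST FRAMING (cell `lit-balaban`, verbatim): statement-level skeleton of published theorems with citation tags; proofs where landed; nothing here is a claim about the Yang–Mills mass gap.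

CITATION HEADER (lean-in-tree rule 2026-08-18).  PDF page = journal page − 248 (PDF held: `paper:balaban1987-cmp109-rg-i-small-field`;
text layer pp. 268–269 = `p0020.txt`/`p0021.txt` and the render `1987-cmp109-rg-I-small-field-p021-x2.png` read first-hand by the
writing seat, unit `lit-balaban-r20` gen 47 (v1.0/v1.1), gen 48 (v1.2/v1.3; p. 267 = `p0019.txt` re-read) and gen 51 (v1.4; pp. 266–269 = `p0018.txt`–`p0021.txt` re-read; v1.5 = DOCFIX-only: summit-lit1 g98 P98-006, the (2.11) locators corrected, and referee-5 g92 D-g92-1, §10's «pre-elimination» pointer; declarations byte-identical), fold owner of block B12; display rows B12.Eq2.11 / B12.Eq2.16 of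
`HOME/lit-balaban-r09/ROWS-B12.md` (owner r09), coarse row B12.Eq2.13 «§2 (2.12)–(2.15)» of `HOME/lit-balaban-r20/ROWS-B12.md`).

THE PRINT (verbatim).  p. 268 [PDF 20]: *«Denoting the remaining variables by B we have B′ = CB, C is the operator determined
by the configuration V^{(k)}, and the measure becomes a Gaussian measure in variables B, with the covariance
C^{(k)} = C^{(k)}(U_{k+1}) = (C*Δ^{(k)}C)⁻¹.»*  p. 269 [PDF 21]: *«… let us recall only that all the expressions in (2.12), together
with the measure, are invariant with respect to the gauge transformations*
`U_{k+1} → U^u_{k+1},   B′ → R(u)B′,   (R(u)B′)(b) = R(u(b₋))B′(b).   (2.16)`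
*The characteristic function is invariant with respect to the transformations of the fluctuation field B′, because they are
local, orthogonal transformations; therefore the expression (2.13) is gauge invariant.»*

WHY THIS FILE.  `B12Eq213Body268` v1.5 closes with the located HONEST NOTE: *«§8 lives on the bond-field carrier with an abstract
measure, §§4–7 on real coordinates `κ → ℝ` with the concrete Gaussian `gaussProb`; the coordinate chart identifying the two
(`VecField P k 𝔤 ≃ (ι → ℝ)`, `rot f ↦` a block-diagonal orthogonal matrix) is bookkeeping owed nowhere and not written here.»*
It is written here, WITHOUT a second chart: the chart is the cell's existing `B1Eq221Coordinates.fieldCoord 𝔤 (PBond P k)`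
(unit `lit-balaban-p34`: orthonormal site coordinates, `ι = PBond P k × Fin (dim 𝔤)`, Lebesgue-measure preserving), the
bondwise isometries are r07's `B10Eq26MeasureInv.rot f`, their matrix is p34's coordinate matrix `avgMatrix` of the same
linear map, the coordinate Gaussian is `B2Eq228Conditioning.gaussProb`, its transport under orthogonal matrices is r09's
`B12Eq216MeasureCovariance.map_rotEquiv_gaussProb`, and print's `χ_k` with its invariance is r09's `B12SmallFieldDomain259.chiFluct` /
`B12ChiInvariance269.chiFluct_comp_local_isometry` — all USED BY NAME.

WHAT IS TYPED AND PROVED (the cell's reading; ours, not print's words).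
 §1 *«local, orthogonal transformations»* IN COORDINATES.  `rotLin f` = r07's `rot f` as a LINEAR equivalence (same function,
    `coe_rotLin` `rfl`); **`rotMatrix f := avgMatrix (rotLin f)`**, the matrix of `B′ ↦ R(u)B′` in the chart:
    `fieldCoord (rot f B′) = rotMatrix f *ᵥ fieldCoord B′` (`fieldCoord_rot`), entries `rotMatrix f (b,i) (b′,j) = δ_{bb′}⟪e_i, f b e_j⟫`
    (`rotMatrix_apply` — *«local»* = block-diagonal, `rotMatrix_apply_of_ne`), `⟨R z, R w⟩ = ⟨z, w⟩` and **`RᵀR = 1`**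
    (`dotProduct_rotMatrix_mulVec`, `rotMatrix_transpose_mul_self` — *«orthogonal»*); for a family of LINEAR operators `Δ(U)` on
    the fields, the function-level intertwining `Δ(τU) ∘ R = R ∘ Δ(U)` of r07's B10 lineage (`hΔ` of
    `B10Eq26MeasureInv.quadForm_jointInvariant`) IS, in the chart, the conjugation law `M(τU) = R·M(U)·Rᵀ` that §§5–7 of
    `B12Eq213Body268` take as the binder `hprec`/`hΔ` (`avgMatrix_conj_of_intertwine`); r07's quadratic form `Σ_b ⟪B′(b), (ΔB′)(b)⟫`
    is the coordinate form `⟨z, Mz⟩` (`quadForm_eq_dotProduct`), and a symmetric positive `Δ` has a positive definite matrix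
    (`posDef_avgMatrix`).
 §2 **PRINT'S GAUSSIAN ON THE FIELDS.**  `gaussField M := (gaussProb M).map fieldCoordM.symm` — *«a Gaussian measure»* on
    `B′`-space with precision matrix `M` in the chart; it IS the normalised density `e^{−½⟨B′, M B′⟩} dB′` for *«the natural
    Lebesgue measure»* on the fields (`gaussField_eq_withDensity`, by p34's `measurePreserving_fieldCoordM`; at `M = avgMatrix Δ`
    the density is r07's (22)-shaped `exp(−½ Σ_b⟪B′(b),(ΔB′)(b)⟫)`, `gaussField_avgMatrix_eq`), a probability measure for `M`
    positive definite, with the change of variables `∫ Φ dμ = ∫ Φ(fieldCoord⁻¹ z) d(gaussProb M)(z)` (`integral_gaussField`);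
    **`gaussField_map_rot`**: `(gaussField M).map (rot f) = gaussField (R M Rᵀ)`, `R = rotMatrix f` — hence covariant precisions
    (`gaussField_map_rot_of_conj`) or intertwined operators (`gaussField_map_rot_of_intertwine`) give COVARIANT MEASURES, the
    hypothesis `hcov` of `B12Eq213Body268.FluctData.newTerm_onBonds_eq_of_covariant`.  WITH THE ELIMINATION `B′ = CB`:
    `gaussFieldPush C M := (gaussProb M).map (B ↦ fieldCoord⁻¹(C B))` — the Gaussian in the REMAINING variables `B` read as a
    measure on the fields (supported on the constraint surface); `gaussFieldPush_map_rot`: the intertwining `C′R₂ = R₁C`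
    (`B12Eq213Body268` §6/§6b) and `M′ = R₂MR₂ᵀ` give `(gaussFieldPush C M).map (rot f) = gaussFieldPush C′ M′`; for injective `C`
    the push-forward is along a measurable embedding and `∫ Φ dμ = ∫ Φ(fieldCoord⁻¹(C B)) d(gaussProb M)(B)` (`integral_gaussFieldPush`).
 §3 **THE JOIN — (2.16) ON PRINT'S CARRIER FOR PRINT'S GAUSSIAN, `χ_k` AND MEASURE CLAUSES BOTH THEOREMS.**  The data
    `onBondsGauss prec hpd ε₁ 𝐏 {…}` := `FluctData.onBonds` at `μ U := gaussField (prec U)` and `onBondsGaussPush C prec …` (with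
    elimination); **`newTerm_onBondsGauss_eq_of_covariant`** / `…_gauge_invariant`: `𝐄^{(k+1)}(g, τU) = 𝐄^{(k+1)}(g, U)` from the
    conjugation law of the precision and the invariance of `𝐏^{(k)}`, `{…}` ALONE; **`newTerm_onBondsGauss_eq_of_intertwine`** /
    `…_gauge_invariant_of_intertwine`: the same from the OPERATOR statement `Δ^{(k)}(U^u) ∘ R(u) = R(u) ∘ Δ^{(k)}(U)` — print's
    sentence *«all the expressions in (2.12), together with the measure, are invariant … therefore (2.13) is gauge invariant»* with
    the measure clause and the `χ_k` clause DERIVED, the `Δ^{(k)}`-covariance and the `𝐏^{(k)}`/`{…}` invariance the remaining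
    binders (rows B9 (3.156) ff. and print's *«discussed already several times in the previous papers»*);
    `newTerm_onBondsGaussPush_eq_of_covariant` / `…_prec212U_eq_of_covariant` / `…_eq_of_intertwine` (with elimination, precision
    `C(U)ᵀ M(U) C(U)` = print's `C*Δ^{(k)}C`, intertwining `C(τU)R₂ = R₁C(U)` as in `B12Eq213Body268` §6); and THE LITERAL
    UNIFICATION **`newTerm_onBondsGauss_eq_gaussian`** / **`newTerm_onBondsGaussPush_eq_gaussian`**: the (2.13) of the carrier datum
    EQUALS the (2.13) of `B12Eq213Body268.FluctData.gaussian` (§4/§6 there) whose `χ_k`, `𝐏^{(k)}`, `{…}` are print's functions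
    of `B′` read through the chart at `B′ = C(U)B` — exactly the datum shape of `FluctData.newTerm_gaussian_prec212U_eq_of_covariant`.
 §4 (v1.1) the intertwining `C(τU)·R_rem = R·C(U)` FROM PRINT'S CHARACTERISATION OF `C` (`intertwine_of_elimination`) and the
    fully reduced (2.16) `newTerm_onBondsGaussPush_eq_of_elimination[_of_intertwine]` — see the v1.1 paragraph below.
 §5 (v1.2) PRINT'S `C` CONSTRUCTED: `elimLin p b₀ LQ̃ h` = `B ↦ B⁰ − h(LQ̃B⁰)` from the linear constraint `LQ̃` and print's
    operator `h` of p. 267 (*«LQ̃h = I»*), with `LQ̃C = 0`, `C↾retained = id`, uniqueness, and the (2.16) theorems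
    `newTerm_onBondsGaussElim_eq_of_covariant ∕ _eq_of_intertwine ∕ _gauge_invariant ∕ _b0_eq_of_intertwine` in which EVERY elimination
    datum of §4 is a theorem — see the v1.2 paragraph below.
 §6 (v1.3) PRINT'S `h` CONSTRUCTED: `invCoeff b₀ LQ̃ hinj c` = the inverse of r09's corridor coefficient, and *«LQ̃h = I»* PROVED
    from the locality of `LQ̃` on the dependence sets + the separation of the distinguished bonds (`apply_hOp_invCoeff[_of_bound]`);
    `newTerm_onBondsGaussElim_b0_eq_of_local` = the fully reduced (2.16) on the cell's tori whose constraint binders are r09's (L)(H)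
    of `B12B0Restriction267` — see the v1.3 paragraph below.
 §7 (v1.4) THE LETTER `h` IS (2.16)-COVARIANT WITH NO HYPOTHESIS ON IT: from the covariance of `LQ̃` alone, the corridor coefficients
    conjugate (`coeff_conj`), r09's (L)(H) and «LQ̃h = I» are transported along the orbit with the same constants, and print's
    `h = invCoeff` — *«uniquely defined by these conditions»* — satisfies `h(τU)(c) ∘ R_C(u)_c = R(u)_{b₀(c)} ∘ h(U)(c)` (`invCoeff_conj`,
    `hOp_invCoeff_conj`, on the cell's tori `hOp_invCoeff_b0_covariant`); the constructed `C` is covariant as a map (`elimLin_invCoeff_conj`).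
 §8 (v1.4) THE `Δ^{(k)}` INTERTWINING DERIVED: `Δ^{(k)}(U)` read as in (2.11) — the operator representing, in the bond inner product,
    the second-order term of a `C²` generating function `Q_U` with the joint invariance `Q_{τU}(R(u)B′) = Q_U(B′)` — is symmetric
    (`symmetric_of_hessian`) and satisfies `Δ^{(k)}(τU) ∘ R(u) = R(u) ∘ Δ^{(k)}(U)` (`intertwine_of_hessian` ∕ `intertwine_rot_of_hessian`;
    for ANY orthogonal `L` of the field space — (2.18) *«for the same reasons»* — `intertwine_of_hessian_of_orthogonal`);
    hence `newTerm_onBondsGaussElim_b0_eq_of_hessian` (the binder `hΔ` of §6 replaced by print's invariance sentence) and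
    `posDef_prec212U_elimLin_of_hessian` (its `hpd` from the positivity of (2.11) alone) — see the v1.4 paragraph below.
 §9 (v1.4) THE CONSTRAINT'S COVARIANCE DERIVED: `LQ̃(U)` read as the linearisation `DQ̃_U(0)` of the covariant averaging map (2.4)
    (`Q̃_{τU}(R(u)B′) = R_C(u)Q̃_U(B′)`) satisfies the binder `hΛ` (`constraint_conj_of_covariant` ∕ `constraint_rot_conj_of_covariant`);
    hence `newTerm_onBondsGaussElim_b0_eq_of_functions`: the fully reduced (2.16) with EVERY operator binder replaced by a function-level
    covariance ∕ invariance statement of print's kind.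
 §10 (v1.4) (2.17)–(2.18) FOR PRINT'S GAUSSIAN ON THE FIELDS: ANY linear automorphism `L` of the field space preserving the bond inner
    product (*«an orthogonal transformation of the fluctuation field B′»*) has an orthogonal chart matrix `A` and transports
    `gaussField M` to `gaussField (A M Aᵀ)` (`gaussField_map_of_orthogonal`; r09's `map_rotEquiv_gaussProb` through the chart), hence
    covariant precisions ∕ intertwined operators ∕ a jointly invariant generating function give COVARIANT MEASURES
    (`gaussField_map_of_orthogonal_of_conj` ∕ `_of_intertwine` ∕ `_of_hessian`) — *«for the same reasons as for the gauge invariance»*.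
HONEST SCOPE.  (i) The chart uses Mathlib's `stdOrthonormalBasis` of `𝔤` (p34's choice); `rotMatrix`, `avgMatrix` depend on it,
the measures `gaussField (avgMatrix Δ)` and all invariance statements do not.  (ii) Which operator `Δ^{(k)}(U)` and which linear
constraint `LQ̃(U)` realise print's ([13] (3.156)–(3.158); [I] (0.11)/(0.12) linearised, r09's `B12AverageCorridor267.LQ` on `ℤᵈ`) is
rows B12.Eq2.11 / B12.Def@267 / B9, not this file: from v1.2 on they enter as the binders `Δ`, `Λ` (with print's `h`, *«LQ̃h = I»*),
and `C(U)` is CONSTRUCTED from them (§5); positive definiteness is a hypothesis (`hpd`), or `posDef_avgMatrix`, or — for the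
constructed `C` — the theorem `posDef_prec212U_elimLin`.  (iii) The junction with `B12Eq213Body268` §6b's `elim` is made through
print's CHARACTERISATION of the elimination map (§4, v1.1), not by reindexing the chart to `σ ⊕ κ`: `elim` is the case
`emb = Sum.inl` (`elim_mulVec_inl`, `eq_zero_of_constraint_of_inl`), and §5's `elimLin` is THE map with that characterisation on
the carrier (`eq_elimLin_of_elimination`); a literal `Matrix.reindex` dictionary is not written.
(iv) No named `Prop` facts; no `sorry`; nothing about convergence or the bounds (1.18).

v1.1 (gen 47, APPEND-ONLY; §§1–3 byte-identical): §4 = p. 268 *«By the δ-function δ(Q̃B′) we eliminate the variables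
B′(b₀(c)), c ∈ T^{(k+1)}. Denoting the remaining variables by B we have B′ = CB»* READ AS THE CHARACTERISATION OF `C` on the
carrier: the remaining variables are the coordinates of the retained bonds (`remCoord p`, `p` = «not a b₀(c)»); an elimination
map reproduces them and solves the constraint, and the constraint determines the eliminated ones.  `rotMatrix_mulVec_remCoord`:
print's `R(u)`, block-diagonal over bonds, acts on the remaining variables by `R_rem = rotMatrix (f↾retained)` (again orthogonal);
**`intertwine_of_elimination`**: this characterisation at `U` and `τU` plus the covariance of the constraint `Q̃(τU)·R = S·Q̃(U)`
GIVE the intertwining `C(τU)·R_rem = R·C(U)` — the binder `hC` of `B12Eq213Body268` §6 and of §§2–3 here — in index-free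
form (`B12Eq213Body268.elim_intertwine` is its instance at `emb = Sum.inl`); hence **`newTerm_onBondsGaussPush_eq_of_elimination`**
and the fully reduced **`newTerm_onBondsGaussPush_eq_of_elimination_of_intertwine`** (verbatim gauge form
`newTerm_onBondsGaussPush_gauge_invariant_of_elimination`): (2.16) for print's Gaussian
`dμ_{C^{(k)}}`, `C^{(k)} = (C*Δ^{(k)}C)⁻¹`, on print's carrier, with binders = the elimination data of `C(U)` for `Q̃(U)`, the
covariance of `Q̃`, the operator intertwining `Δ^{(k)}(τU) ∘ R = R ∘ Δ^{(k)}(U)` and the invariance of `𝐏^{(k)}`, `{…}` — the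
orthogonality of `R`, `R_rem`, the intertwining of `C`, the covariance of the precision and of the measures, and the invariance
of `χ_k` all DERIVED.

v1.2 (gen 48, APPEND-ONLY; §§1–4 byte-identical, two imports added: `B12B0Restriction267` for r09's corridor coefficient `coeff`,
`B13PkLocalTerms` for the tree's function `hOp` = print's operator `h`): §5 = p. 267 *«At first we introduce an operator h. … The
function hB is equal to 0 everywhere, except the set {b₀(c) : c ∈ T^{(k+1)}}. … the operator h satisfies the identity LQ̃h = I on
T^{(k+1)}. Of course h is uniquely defined by these conditions, in fact it is a very simple operator given by the equality
(hB)(b₀(c)) = h(c)B(c), where h(c) is a linear operator on the Lie algebra 𝐠, equal to an inverse of a coefficient at the variable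
B′(b₀(c)) in (Q̃B′)(c)»* + p. 268 *«using the δ-functions δ(Q̃B′) we eliminate the variables B′(b₀(c)), c ∈ T^{(k+1)}. Denoting the
remaining variables by B we have B′ = CB, C is the operator determined by the configuration V^{(k)}»* READ AS A CONSTRUCTION on the
carrier (fine bonds `β`, coarse bonds `C`, distinguished bonds `b₀ : C → β` injective, retained bonds `{b // p b}` = the complement of
the range of `b₀`; `𝐠 = F`): for a LINEAR constraint `Λ = LQ̃ : (β → F) →ₗ (C → F)` and print's `h : C → (F →ₗ F)` with `LQ̃h = I`
(`hI`; `h` acts through the tree's `B13PkLocalTerms.hOp b₀ h`, additive `hOp_add`/`hOp_smul`/`hOp_single`), **`elimLin p b₀ Λ h`**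
`:= B ↦ B⁰ − h(ΛB⁰)` (`B⁰ = extendLin p B`, the remaining variables extended by zero) — the linear instance of print's own device
`B′ = B − hD̃(B)` —; THEN: `C↾retained = id` (`elimLin_apply_val`), **`ΛC = 0`** (`constraint_elimLin`, from `LQ̃h = I` in one line),
`h(c)` is a right inverse of r09's corridor coefficient (`coeff_h_apply` — *«an inverse of a coefficient at the variable B′(b₀(c))»*)
and the coupling is diagonal on its range (`apply_single_h_of_ne`), `h(c)` bijective (`bijective_h`, finite dimension), **the
constraint determines the eliminated variables** (`eq_zero_of_constraint_of_apply_val`: `Λw = 0 ∧ w↾retained = 0 ⇒ w = 0`), **`C` is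
UNIQUE** among linear maps reproducing the remaining variables and solving the constraint (`eq_elimLin_of_elimination` — *«C is the
operator determined by the configuration»*), injective (`injective_elimLin`); IN THE CHART (`avgMatrix`, rectangular): `avgMatrix_comp`,
`avgMatrix_mul_rotMatrix_of_intertwine` (the function-level covariance `Λ(τU) ∘ R(u) = R_C(u) ∘ Λ(U)` of [13] (3.32) IS the matrix
identity `Q̃(τU)·R = S·Q̃(U)`, `S = rotMatrix f_C` — the binder `hcov` of §4), `avgMatrix_elimLin_mulVec_remCoord` ∕
`avgMatrix_mul_avgMatrix_elimLin` ∕ `eq_zero_of_avgMatrix_mulVec_of_remCoord` (= §4's `hCid` ∕ `hCQ` ∕ `huniq` as theorems),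
**`elimLin_intertwine`** (`C(τU)·R_rem = R·C(U)` for the constructed `C`, by `intertwine_of_elimination`); ON PRINT'S CARRIER: the datum
**`onBondsGaussElim`** (= `onBondsGaussPush` at `C(U) = avgMatrix (elimLin p b₀ (Λ U) (h U))`) and **`newTerm_onBondsGaussElim_eq_of_covariant`**
∕ **`_eq_of_intertwine`** (precision `C(U)*M(U)C(U)`, `M = avgMatrix Δ^{(k)}`) ∕ `_gauge_invariant` ((2.16) verbatim, `R(u)` at `b₋` on
`T^{(k)}`-bond fields and at `c₋` — read in `T^{(k)}` by `Setup.emb` — on `T^{(k+1)}`-bond fields) ∕ **`_b0_eq_of_intertwine`** (the cell's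
`b₀(c)` = `B12SmallFieldDomain259.b0`, injective in the standing range, retained bonds = *«T^{(k)} ∖ {b₀(c)}»* of (2.9)): (2.16) for
print's Gaussian with binders = the constraint family `LQ̃(U)` with its `h(U)`, its covariance, the `Δ^{(k)}` intertwining, the
invariance of `𝐏^{(k)}`, `{…}` (and `hpd`, itself discharged for symmetric positive `Δ^{(k)}` by `posDef_prec212U_elimLin`) — the
elimination data `hCQ`/`hCid`/`huniq` and `hcov` of v1.1 are THEOREMS.  HONEST SCOPE of §5: `LQ̃` is linear by hypothesis (print's
linear part of `Q̃`, p. 267 «LQ̃B′ + C̃(B′)»; which `LQ̃` — r09's `B12AverageCorridor267.LQ` on `ℤᵈ`, [13] (3.19) — is not identified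
here); `LQ̃h = I` is the hypothesis, its two halves (invertible coefficient, diagonal coupling = locality + the separation
`B12SmallFieldDomain259.eq_of_b0_mem_nbhd`) are derived from it — and, conversely, ASSEMBLED from them in §6 (v1.3); nothing nonlinear
(`D̃`, p. 267) is used or claimed.

v1.3 (gen 48, APPEND-ONLY; §§1–5 byte-identical): §6 = p. 267 *«Of course h is uniquely defined by these conditions, in fact it is a
very simple operator given by the equality (hB)(b₀(c)) = h(c)B(c), where h(c) is a linear operator on the Lie algebra 𝐠, equal to an
inverse of a coefficient at the variable B′(b₀(c)) in (Q̃B′)(c)»* READ AS A CONSTRUCTION: **`invCoeff b₀ Λ hinj c`** := the inverse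
of r09's corridor coefficient `B12B0Restriction267.coeff b₀ Λ c` (injective — e.g. bounded below, r09's (H) `‖X‖ ≤ H·‖coeff_c X‖`,
`injective_coeff_of_bound` — hence invertible on the finite-dimensional `𝐠`, Mathlib's `LinearEquiv.ofInjectiveEndo`;
`coeff_invCoeff` ∕ `invCoeff_coeff`); `hOp_eq_sum_single` (`hw = Σ_c δ_{b₀(c)} h(c)w(c)`); **`apply_single_b0_eq_zero_of_local`**
(LOCALITY of `LQ̃` on the dependence sets `N(c)` + SEPARATION «no foreign `b₀(c′)` in `N(c)`» ⇒ the variable at `b₀(c′)` does not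
enter `(LQ̃B)(c)`); **`apply_hOp_invCoeff`** ∕ **`apply_hOp_invCoeff_of_bound`**: *«the operator h satisfies the identity LQ̃h = I on
T^{(k+1)}»* PROVED for the constructed `h` (the `_of_bound` form takes exactly r09's (L) `‖(LQ̃B)(c)‖ ≤ K·M` and (H) of
`B12B0Restriction267.norm_apply_b0_le`); **`h_eq_invCoeff`**: *«uniquely defined by these conditions»* — any `h` with `LQ̃h = I` IS
`invCoeff`; ON THE CELL'S TORI **`newTerm_onBondsGaussElim_b0_eq_of_local`**: the fully reduced (2.16) with `b₀ =
B12SmallFieldDomain259.b0`, `h(U) := invCoeff`, separation = the tree's `eq_of_b0_mem_nbhd`, binders on the constraint family =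
(L)(H) per background + its covariance; the `Δ^{(k)}` intertwining and the invariance of `𝐏^{(k)}`, `{…}` as before.  HONEST SCOPE
of §6: (L)(H) are hypotheses on the abstract `LQ̃(U)` (r09 discharges them on `ℤᵈ` for [I]'s genuine average:
`B12LQLocalityBound267.norm_LQ_le`, `B12B0RestrictionAverage267.hGen_bcoef`); the torus-carrier `LQ̃` of [I] (0.11)/(0.12) is not
constructed here.

v1.4 (gen 51, APPEND-ONLY; §§1–6 byte-identical, no import added): §7 = p. 269 *«all the expressions in (2.12), together with the
measure, are invariant with respect to the gauge transformations (2.16)»* FOR THE LETTER `h` OF p. 267 (it enters (2.12) in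
«hD̃(g_kCB)», «Tr log(I − h((δ/δB)D̃)(g_kCB))», «H₁hD̃₃»).  From the covariance of the constraint ALONE, `LQ̃(τU)(R(u)B′) = R_C(u)(LQ̃(U)B′)`
(the binder `hΛ` of §§5–6): `rotLin_single`; **`coeff_conj`** (r09's corridor coefficient conjugates, `coeff(τU)_c ∘ R(u(b₀(c)₋)) =
R_C(u)_c ∘ coeff(U)_c`), `injective_coeff_conj`, **`bound_coeff_conj`** ∕ `isLocal_conj` ∕ **`local_bound_conj`** (r09's (H), locality
and (L) hold at `τU` with the constants of `U`), `hOp_conj` ∕ `apply_hOp_conj` (a covariant family `h(c)` gives a covariant field operator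
and transports «LQ̃h = I»), `extendLin_rot`, `elimLin_conj`; and for PRINT'S `h` — *«Of course h is uniquely defined by these conditions»*
— **`invCoeff_conj`** ∕ `invCoeff_conj_eq` (`h(τU)(c) = R(u)_{b₀(c)} ∘ h(U)(c) ∘ R_C(u)_c⁻¹`: the inverse of a covariant coefficient is
covariant — NO hypothesis on `h`), **`hOp_invCoeff_conj`** (`h(τU)(R_C(u)w) = R(u)(h(U)w)`), `apply_hOp_invCoeff_conj`,
**`elimLin_invCoeff_conj`** (the constructed `C` is covariant as a map — the function-level companion of §5's chart identity
`elimLin_intertwine`, there via the uniqueness of `C`, here via the covariance of `h`); along a background family `invCoeff_covariant` ∕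
`hOp_invCoeff_covariant`; ON THE CELL'S TORI in the letters of §6: **`hOp_invCoeff_b0_covariant`**, `bound_coeff_b0_covariant`,
`local_bound_b0_covariant`.  §8 = THE `Δ^{(k)}` CLAUSE READ AS IN PRINT.  (2.11) defines `Δ^{(k)}(U)` as the operator of the
second-order term `½⟨B′, Δ^{(k)}B′⟩` of the expansion in `B′` at `B′ = 0`; for a `C²` generating function `Q_U` represented in the bond
inner product (`Σ_b ⟪A(b), (Δ^{(k)}(U)A′)(b)⟫ = D²Q_U(0)(A, A′)`), `Δ^{(k)}(U)` is SYMMETRIC (**`symmetric_of_hessian`**, Schwarz —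
Mathlib's `ContDiffAt.isSymmSndFDerivAt`; the `hsymm` of `posDef_avgMatrix` ∕ `posDef_prec212U_elimLin`), and the JOINT INVARIANCE
`Q_{τU}(R(u)B′) = Q_U(B′)` — print's sentence, which for (2.11) is the gauge invariance of the action read through (2.2)–(2.4) p. 266 —
GIVES the operator intertwining **`intertwine_of_hessian`** ∕ **`intertwine_rot_of_hessian`** (`Δ^{(k)}(τU)(R(u)A) = R(u)(Δ^{(k)}(U)A)`:
intertwined functions have intertwined second derivatives — two-function form of the cell's `B12Covariance54.hessian_invariant`, private
here —, `R(u)` is a bondwise isometry, the pairing is nondegenerate) = EXACTLY the binder `hΔ` of every (2.16) theorem of §§3–6 (and, for ANY linear automorphism `L` preserving the bond inner product,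
**`intertwine_of_hessian_of_orthogonal`** — print's (2.17)–(2.18) sentence *«generates an orthogonal transformation of the fluctuation
field B′, hence all the remaining operations preserve the invariance for the same reasons»*; `sum_inner_rotLin`); hence
**`newTerm_onBondsGaussElim_b0_eq_of_hessian`** = §6's `newTerm_onBondsGaussElim_b0_eq_of_local` with `hΔ` REPLACED by (`Q`, `C²`,
joint invariance, (2.11)-representation), and **`posDef_prec212U_elimLin_of_hessian`** (its `hpd` from the positivity of the basic
quadratic form alone).  §9 = THE SAME FOR THE CONSTRAINT: (2.4) p. 266 *«M(V′V^{(k)})M(V^{(k)})⁻¹ = exp iQ̃(B′)»* defines print's map `Q̃_U`,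
p. 267 *«LQ̃B′ + C̃(B′)»* splits off its linear part; reading `LQ̃(U) = DQ̃_U(0)` (Fréchet derivative of a map differentiable at `0`), the
COVARIANCE `Q̃_{τU}(R(u)B′) = R_C(u)Q̃_U(B′)` ([13] (3.32); r09's `B12Average012QtildeCovariance` for the genuine average) GIVES the binder
`hΛ` — **`constraint_conj_of_covariant`** ∕ `constraint_rot_conj_of_covariant` (chain rule, `fderiv_conj` private) — and
**`newTerm_onBondsGaussElim_b0_eq_of_functions`** = the fully reduced (2.16) whose binders are now: r09's (L)(H) per background, `hpd`
(or `posDef_prec212U_elimLin_of_hessian`), and FUNCTION-LEVEL statements only — `Q̃_U` differentiable and covariant, `Q_U` `C²` and jointly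
invariant, `𝐏^{(k)}`, `{…}` invariant — print's sentence taken literally as the list of hypotheses.  §10 = (2.17)–(2.18) p. 269 *«The
transformation (2.18) generates an orthogonal transformation of the fluctuation field B′, hence all the remaining operations preserve
the invariance for the same reasons as for the gauge invariance»* FOR PRINT'S GAUSSIAN ON THE FIELDS (§2 did the gauge case `R(u)`):
for ANY linear automorphism `L` of the fields preserving the bond inner product, the chart matrix `A = avgMatrix L` is orthogonal
(`dotProduct_avgMatrix_mulVec_of_orthogonal`, **`avgMatrix_transpose_mul_self_of_orthogonal`** ∕ `avgMatrix_mul_transpose_self_of_orthogonal`,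
`apply_fieldCoord_symm`), intertwined operators have conjugated matrices (`avgMatrix_conj_of_intertwine_of_orthogonal`), and
**`gaussField_map_of_orthogonal`**: `(gaussField M).map L = gaussField (A M Aᵀ)` (r09's `map_rotEquiv_gaussProb` — any orthogonal matrix —
through p34's chart); hence **`gaussField_map_of_orthogonal_of_conj`** ∕ **`_of_intertwine`** ∕ **`_of_hessian`**: covariant precisions,
intertwined `Δ^{(k)}`, or merely a jointly invariant `C²` generating function (§8) give `(dμ_U).map L = dμ_{τU}` — the measure hypothesis
`hμ`∕`hcov` of `B12Eq213Body268` §3 for the pair `(τ, e) = (U ↦ rU, B′ ↦` the orthogonal map generated by `r)`.  Which `L` (2.18)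
generates (bond permutation with orientation data) is row B12.Eq2.17-2.18, r09's `B12EuclTransf218`, not this file.  HONEST SCOPE of v1.4: which `Q_U` realises print's (the expansion (2.5)–(2.11) of `−(1/g_k²)A(U_k(exp(i·)V^{(k)}))`
with the measure terms, rows B12.Eq2.5–2.11; [13] (3.156)–(3.158)) and that IT is `C²` and jointly invariant is not decided here — these
are the remaining binders, now function-level statements of print's kind (invariance of scalar expressions) instead of operator
identities; the (L)(H) transport of §7 does not produce (L)(H) at a background outside the orbit; r09's `B12Def267Covariance` ∕
`B12ActionExpansion26Lattice.hessForm_gaugeTr` are the `ℤᵈ` ∕ [13]-lattice instances for [I]'s genuine objects (cited, not imported).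
LOCATOR ERRATUM (own, v1.2–v1.3 docstrings wrote «(2.11) p. 268»; CORRECTED in v1.5, DOCFIX-only, summit-lit1 g98 P98-006: «(2.11) p.267», «(2.11)–(2.12) ∕ (2.11)–(2.13) pp.267–268»): the display (2.11) and the sentence «The quadratic form in B′ above is equal to −½⟨B′, Δ^{(k)}B′⟩, see the definition (3.156) [13]» are printed on p. 267 [PDF 19] (text layer `p0019.txt` l.39–41), (2.12)–(2.14) on p. 268; the new declarations cite p. 267.  43 theorems (4 private), 0 definitions, 0 named `Prop` facts, no `sorry`.
-/

namespace Literature.MathematicalPhysics.QuantumFieldTheory.Balaban1983to89.B12Eq216GaussianCarrier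

open Literature.MathematicalPhysics.QuantumFieldTheory.Balaban1983to89
open _root_.MeasureTheory
open scoped Matrix InnerProductSpace ENNReal
open B1Eq221Coordinates B10Eq26MeasureInv B2Eq228Conditioning B12Eq216MeasureCovariance B12Eq213Body268

noncomputable section

/-! ## §1. *«local, orthogonal transformations»* in coordinates: the matrix of `B′ ↦ R(u)B′` in p34's chart `fieldCoord` -/

section Lin

variable {B : Type} {F : Type*} [NormedAddCommGroup F] [InnerProductSpace ℝ F]

/-- `B′ ↦ R(u)B′`, `(R(u)B′)(b) = R(u(b₋))B′(b)` — a bondwise family of linear isometries `f b : F ≃ₗᵢ F` acting on fields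
`B′ : B → F` — as a LINEAR equivalence of the space of fields (r07's measurable equivalence `B10Eq26MeasureInv.rot f` is the same
function, `coe_rotLin`). [cite: Balaban1987RG1, (2.16) p.269] -/
def rotLin (f : B → (F ≃ₗᵢ[ℝ] F)) : (B → F) ≃ₗ[ℝ] (B → F) :=
  LinearEquiv.piCongrRight fun b => (f b).toLinearEquiv

/-- `(R(u)B′)(b) = R(u(b₋))B′(b)` (unfolding). [cite: Balaban1987RG1, (2.16) p.269] -/
@[simp] theorem rotLin_apply (f : B → (F ≃ₗᵢ[ℝ] F)) (A : B → F) (b : B) : rotLin f A b = f b (A b) := rfl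

/-- The inverse transformation is bondwise `(f b)⁻¹` (unfolding). [cite: Balaban1987RG1, (2.16) p.269] -/
@[simp] theorem rotLin_symm_apply (f : B → (F ≃ₗᵢ[ℝ] F)) (A : B → F) (b : B) :
    (rotLin f).symm A b = (f b).symm (A b) := rfl

/-- `rotLin f` and r07's `B10Eq26MeasureInv.rot f` are the same map of fields. [cite: Balaban1987RG1, (2.16) p.269] -/
theorem coe_rotLin [MeasurableSpace F] [BorelSpace F] (f : B → (F ≃ₗᵢ[ℝ] F)) : ⇑(rotLin f) = ⇑(rot f) := rfl

end Lin

section Chart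

variable {B : Type} [Fintype B] [DecidableEq B] {F : Type*} [NormedAddCommGroup F] [InnerProductSpace ℝ F]
  [FiniteDimensional ℝ F]

/-- **THE MATRIX OF `B′ ↦ R(u)B′` IN THE CHART** `fieldCoord F B : (B → F) ≃ₗ (B × Fin (dim F) → ℝ)` (orthonormal site
coordinates, `B1Eq221Coordinates`): p34's coordinate matrix `avgMatrix` of the linear map `rotLin f`.
[cite: Balaban1987RG1, (2.16) p.269] -/
def rotMatrix (f : B → (F ≃ₗᵢ[ℝ] F)) : Matrix (B × Idx F) (B × Idx F) ℝ :=
  avgMatrix (rotLin f).toLinearMap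

/-- Unfolding of `rotMatrix`. [cite: Balaban1987RG1, (2.16) p.269] -/
theorem rotMatrix_def (f : B → (F ≃ₗᵢ[ℝ] F)) : rotMatrix f = avgMatrix (rotLin f).toLinearMap := rfl

/-- `rotMatrix f` REPRESENTS the transformation: `R · fieldCoord(B′) = fieldCoord(R(u)B′)`. [cite: Balaban1987RG1, (2.16) p.269] -/
theorem rotMatrix_mulVec_fieldCoord (f : B → (F ≃ₗᵢ[ℝ] F)) (A : B → F) :
    rotMatrix f *ᵥ fieldCoord F B A = fieldCoord F B (rotLin f A) := by
  rw [rotMatrix, avgMatrix_mulVec]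
  rfl

/-- The coordinates of the transformed field: `fieldCoord(R(u)B′) = R · fieldCoord(B′)`. [cite: Balaban1987RG1, (2.16) p.269] -/
theorem fieldCoord_rotLin (f : B → (F ≃ₗᵢ[ℝ] F)) (A : B → F) :
    fieldCoord F B (rotLin f A) = rotMatrix f *ᵥ fieldCoord F B A :=
  (rotMatrix_mulVec_fieldCoord f A).symm

/-- The transformation read through the inverse chart: `R(u)(fieldCoord⁻¹ z) = fieldCoord⁻¹(R z)`. [cite: Balaban1987RG1, (2.16) p.269] -/
theorem rotLin_fieldCoord_symm (f : B → (F ≃ₗᵢ[ℝ] F)) (z : B × Idx F → ℝ) :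
    rotLin f ((fieldCoord F B).symm z) = (fieldCoord F B).symm (rotMatrix f *ᵥ z) := by
  apply (fieldCoord F B).injective
  rw [fieldCoord_rotLin, LinearEquiv.apply_symm_apply, LinearEquiv.apply_symm_apply]

omit [Fintype B] [DecidableEq B] in
/-- The inverse chart explicitly: `(fieldCoord⁻¹ z)(b) = Σ_i z(b,i) e_i` for the standard orthonormal basis `e` of `F`.
[cite: Balaban1982Higgs1, p.605] -/
theorem fieldCoord_symm_apply (z : B × Idx F → ℝ) (p : B) :
    (fieldCoord F B).symm z p = ∑ i, z (p, i) • stdOrthonormalBasis ℝ F i := by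
  have h : fieldCoord F B (fun q => ∑ i, z (q, i) • stdOrthonormalBasis ℝ F i) = z := by
    funext q
    rw [fieldCoord_apply, siteCoord_apply, OrthonormalBasis.repr_apply_apply]
    exact (stdOrthonormalBasis ℝ F).orthonormal.inner_right_fintype (fun i => z (q.1, i)) q.2
  conv_lhs => rw [← h, LinearEquiv.symm_apply_apply]

omit [Fintype B] in
/-- A coordinate unit vector read through the inverse chart is the field with one basis vector at one bond. [folklore] -/
private theorem sum_single_smul (q p : B) (j : Idx F) :
    ∑ l, (Pi.single (q, j) (1 : ℝ) : B × Idx F → ℝ) (p, l) • stdOrthonormalBasis ℝ F l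
      = if p = q then stdOrthonormalBasis ℝ F j else 0 := by
  by_cases hpq : p = q
  · subst hpq
    rw [if_pos rfl, Finset.sum_eq_single j]
    · rw [Pi.single_eq_same, one_smul]
    · intro l _ hl
      rw [Pi.single_eq_of_ne (fun h => hl (Prod.mk.inj h).2), zero_smul]
    · intro h
      exact absurd (Finset.mem_univ j) h
  · rw [if_neg hpq]
    refine Finset.sum_eq_zero fun l _ => ?_
    rw [Pi.single_eq_of_ne (fun h => hpq (Prod.mk.inj h).1), zero_smul]

/-- **«local»: the matrix is BLOCK-DIAGONAL over the bonds**, with the orthogonal block of `f b` at bond `b`: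
`rotMatrix f (b,i) (b′,j) = δ_{bb′} ⟪e_i, f b e_j⟫`. [cite: Balaban1987RG1, (2.16) p.269] -/
theorem rotMatrix_apply (f : B → (F ≃ₗᵢ[ℝ] F)) (p q : B) (i j : Idx F) :
    rotMatrix f (p, i) (q, j)
      = if p = q then ⟪stdOrthonormalBasis ℝ F i, f p (stdOrthonormalBasis ℝ F j)⟫_ℝ else 0 := by
  have h : rotMatrix f (p, i) (q, j) = (rotMatrix f *ᵥ Pi.single (q, j) 1) (p, i) := by
    rw [Matrix.mulVec_single_one]
    rfl
  rw [h, ← (fieldCoord F B).apply_symm_apply (Pi.single (q, j) 1), rotMatrix_mulVec_fieldCoord, fieldCoord_apply,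
    siteCoord_apply, OrthonormalBasis.repr_apply_apply, rotLin_apply, fieldCoord_symm_apply]
  show ⟪stdOrthonormalBasis ℝ F i,
    f p (∑ l, (Pi.single (q, j) (1 : ℝ) : B × Idx F → ℝ) (p, l) • stdOrthonormalBasis ℝ F l)⟫_ℝ = _
  rw [sum_single_smul]
  split_ifs with hpq
  · rfl
  · rw [map_zero, inner_zero_right]

/-- Off the diagonal blocks the matrix vanishes (different bonds do not mix). [cite: Balaban1987RG1, (2.16) p.269] -/
theorem rotMatrix_apply_of_ne (f : B → (F ≃ₗᵢ[ℝ] F)) {p q : B} (hpq : p ≠ q) (i j : Idx F) :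
    rotMatrix f (p, i) (q, j) = 0 := by
  rw [rotMatrix_apply, if_neg hpq]

/-- **«orthogonal»**: the transformation preserves the Euclidean structure of the coordinates, `⟨R z, R w⟩ = ⟨z, w⟩` (bondwise
isometries and the block-isometry `Σ_b⟪B′(b), B″(b)⟫ = ⟨fieldCoord B′, fieldCoord B″⟩` of the chart). [cite: Balaban1987RG1, (2.16) p.269] -/
theorem dotProduct_rotMatrix_mulVec (f : B → (F ≃ₗᵢ[ℝ] F)) (z w : B × Idx F → ℝ) :
    (rotMatrix f *ᵥ z) ⬝ᵥ (rotMatrix f *ᵥ w) = z ⬝ᵥ w := by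
  obtain ⟨A, rfl⟩ := (fieldCoord F B).surjective z
  obtain ⟨A', rfl⟩ := (fieldCoord F B).surjective w
  rw [rotMatrix_mulVec_fieldCoord, rotMatrix_mulVec_fieldCoord, ← sum_inner_eq_dotProduct F (rotLin f A) (rotLin f A'),
    ← sum_inner_eq_dotProduct F A A']
  simp only [rotLin_apply, LinearIsometryEquiv.inner_map_map]

/-- **`RᵀR = 1`** — the matrix of *«local, orthogonal transformations»* is orthogonal; this is the hypothesis `hR` of r09's
`B12Eq216MeasureCovariance.rotEquiv` / `map_rotEquiv_gaussProb` and of `B12Eq213Body268` §§5–6. [cite: Balaban1987RG1, (2.16) p.269] -/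
theorem rotMatrix_transpose_mul_self (f : B → (F ≃ₗᵢ[ℝ] F)) : (rotMatrix f)ᵀ * rotMatrix f = 1 := by
  ext i j
  have h := dotProduct_rotMatrix_mulVec f (Pi.single i 1) (Pi.single j 1)
  rw [Matrix.mulVec_single_one, Matrix.mulVec_single_one, single_one_dotProduct, Pi.single_apply] at h
  rw [Matrix.mul_apply, Matrix.one_apply, ← h]
  rfl

/-- … and `RRᵀ = 1`. [cite: Balaban1987RG1, (2.16) p.269] -/
theorem rotMatrix_mul_transpose_self (f : B → (F ≃ₗᵢ[ℝ] F)) : rotMatrix f * (rotMatrix f)ᵀ = 1 :=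
  B13GaugeDevices.mul_transpose_self_of_transpose_mul_self _ (rotMatrix_transpose_mul_self f)

/-- The transpose acts as the inverse transformation: `Rᵀ · fieldCoord(B′) = fieldCoord(R(u)⁻¹B′)`. [cite: Balaban1987RG1, (2.16) p.269] -/
theorem transpose_rotMatrix_mulVec_fieldCoord (f : B → (F ≃ₗᵢ[ℝ] F)) (A : B → F) :
    (rotMatrix f)ᵀ *ᵥ fieldCoord F B A = fieldCoord F B ((rotLin f).symm A) := by
  conv_lhs => rw [← (rotLin f).apply_symm_apply A, fieldCoord_rotLin, Matrix.mulVec_mulVec,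
    rotMatrix_transpose_mul_self, Matrix.one_mulVec]

/-- The coordinate matrix represents an operator on the fields also through the chart's Euclidean structure:
`⟨fieldCoord B′, M · fieldCoord B″⟩ = Σ_b ⟪B′(b), (Δ B″)(b)⟫` for `M = avgMatrix Δ`. [cite: Balaban1987RG1, (2.11) p.267] -/
theorem dotProduct_avgMatrix_mulVec (Δ : (B → F) →ₗ[ℝ] (B → F)) (A A' : B → F) :
    fieldCoord F B A ⬝ᵥ (avgMatrix Δ *ᵥ fieldCoord F B A') = ∑ b, ⟪A b, Δ A' b⟫_ℝ := by
  rw [avgMatrix_mulVec, ← sum_inner_eq_dotProduct]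

/-- r07's quadratic form `⟨A, Δ(U)A⟩ = Σ_b ⟪A(b), (Δ(U)A)(b)⟫` (`B10Eq26MeasureInv.quadForm`, the (22)/(2.11) Gaussian exponent on
the fields) IS the coordinate form `⟨z, M(U) z⟩` at `z = fieldCoord A`, `M(U) = avgMatrix (Δ U)`.
[cite: Balaban1987RG1, (2.11) p.267; Balaban1985UV3, (22) p.261] -/
theorem quadForm_eq_dotProduct {X : Type*} (Δ : X → ((B → F) →ₗ[ℝ] (B → F))) (U : X) (A : B → F) :
    B10Eq26MeasureInv.quadForm (fun U => ⇑(Δ U)) U A = fieldCoord F B A ⬝ᵥ (avgMatrix (Δ U) *ᵥ fieldCoord F B A) := by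
  rw [dotProduct_avgMatrix_mulVec]
  rfl

/-- **OPERATOR INTERTWINING ⇒ MATRIX CONJUGATION.**  If a family of linear operators on the fields intertwines the
transformations, `Δ(τU) ∘ R(u) = R(u) ∘ Δ(U)` (the function-level covariance `hΔ` of r07's B10 lineage, [13] (3.30)), then its
coordinate matrices are conjugated: `M(τU) = R · M(U) · Rᵀ` — the binder `hprec`/`hΔ` of `B12Eq213Body268` §§5–7.
[cite: Balaban1987RG1, (2.16) p.269; Balaban1985BackgroundPropagators, (3.30) p.395] -/
theorem avgMatrix_conj_of_intertwineLin {X : Type*} {τ : X → X} (f : B → (F ≃ₗᵢ[ℝ] F))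
    (Δ : X → ((B → F) →ₗ[ℝ] (B → F))) (hΔ : ∀ U A, Δ (τ U) (rotLin f A) = rotLin f (Δ U A)) (U : X) :
    avgMatrix (Δ (τ U)) = rotMatrix f * avgMatrix (Δ U) * (rotMatrix f)ᵀ := by
  refine Matrix.ext_iff_mulVec.mpr fun z => ?_
  obtain ⟨A, rfl⟩ := (fieldCoord F B).surjective z
  rw [avgMatrix_mulVec, ← Matrix.mulVec_mulVec, ← Matrix.mulVec_mulVec, transpose_rotMatrix_mulVec_fieldCoord,
    avgMatrix_mulVec, rotMatrix_mulVec_fieldCoord, ← hΔ, LinearEquiv.apply_symm_apply]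

/-- A symmetric operator (`Σ⟪A, ΔA′⟫ = Σ⟪ΔA, A′⟫`) has a symmetric coordinate matrix. [cite: Balaban1987RG1, (2.11) p.267] -/
theorem avgMatrix_transpose_of_symmetric (Δ : (B → F) →ₗ[ℝ] (B → F))
    (hsymm : ∀ A A' : B → F, ∑ b, ⟪A b, Δ A' b⟫_ℝ = ∑ b, ⟪Δ A b, A' b⟫_ℝ) :
    (avgMatrix Δ)ᵀ = avgMatrix Δ := by
  have key : ∀ i j, avgMatrix Δ i j = Pi.single i 1 ⬝ᵥ (avgMatrix Δ *ᵥ Pi.single j 1) := fun i j => by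
    rw [Matrix.mulVec_single_one, single_one_dotProduct]
    rfl
  ext i j
  rw [Matrix.transpose_apply, key, key]
  obtain ⟨A, hA⟩ := (fieldCoord F B).surjective (Pi.single i (1 : ℝ))
  obtain ⟨A', hA'⟩ := (fieldCoord F B).surjective (Pi.single j (1 : ℝ))
  rw [← hA, ← hA', dotProduct_avgMatrix_mulVec, dotProduct_avgMatrix_mulVec, hsymm A' A]
  exact Finset.sum_congr rfl fun b _ => real_inner_comm _ _

/-- **A symmetric, positive operator `Δ^{(k)}(U)` on the fields has a positive definite coordinate matrix** — the
hypothesis under which the Gaussian of §2 is a probability measure ((2.11): the basic quadratic form is positive, [13]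
(3.156)). [cite: Balaban1987RG1, (2.11) p.267] -/
theorem posDef_avgMatrix (Δ : (B → F) →ₗ[ℝ] (B → F))
    (hsymm : ∀ A A' : B → F, ∑ b, ⟪A b, Δ A' b⟫_ℝ = ∑ b, ⟪Δ A b, A' b⟫_ℝ)
    (hpos : ∀ A : B → F, A ≠ 0 → 0 < ∑ b, ⟪A b, Δ A b⟫_ℝ) : (avgMatrix Δ).PosDef := by
  refine Matrix.posDef_iff_dotProduct_mulVec.mpr ⟨?_, fun z hz => ?_⟩
  · rw [Matrix.IsHermitian, Matrix.conjTranspose_eq_transpose_of_trivial, avgMatrix_transpose_of_symmetric Δ hsymm]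
  · obtain ⟨A, rfl⟩ := (fieldCoord F B).surjective z
    have hA : A ≠ 0 := fun h0 => hz (by rw [h0, map_zero])
    simpa only [star_trivial, dotProduct_avgMatrix_mulVec] using hpos A hA

variable [MeasurableSpace F] [BorelSpace F]

/-- `fieldCoord(R(u)B′) = R · fieldCoord(B′)` for r07's measurable equivalence `rot f`. [cite: Balaban1987RG1, (2.16) p.269] -/
theorem fieldCoord_rot (f : B → (F ≃ₗᵢ[ℝ] F)) (A : B → F) :
    fieldCoord F B (rot f A) = rotMatrix f *ᵥ fieldCoord F B A :=
  fieldCoord_rotLin f A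

/-- `R(u)(fieldCoord⁻¹ z) = fieldCoord⁻¹(R z)` for r07's measurable equivalence `rot f`. [cite: Balaban1987RG1, (2.16) p.269] -/
theorem rot_fieldCoord_symm (f : B → (F ≃ₗᵢ[ℝ] F)) (z : B × Idx F → ℝ) :
    rot f ((fieldCoord F B).symm z) = (fieldCoord F B).symm (rotMatrix f *ᵥ z) :=
  rotLin_fieldCoord_symm f z

/-- `avgMatrix_conj_of_intertwineLin` with the intertwining stated for r07's `rot f` (the literal `hΔ` of
`B10Eq26MeasureInv.quadForm_jointInvariant`). [cite: Balaban1987RG1, (2.16) p.269; Balaban1985BackgroundPropagators, (3.30) p.395] -/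
theorem avgMatrix_conj_of_intertwine {X : Type*} {τ : X → X} (f : B → (F ≃ₗᵢ[ℝ] F))
    (Δ : X → ((B → F) →ₗ[ℝ] (B → F))) (hΔ : ∀ U A, Δ (τ U) (rot f A) = rot f (Δ U A)) (U : X) :
    avgMatrix (Δ (τ U)) = rotMatrix f * avgMatrix (Δ U) * (rotMatrix f)ᵀ :=
  avgMatrix_conj_of_intertwineLin f Δ hΔ U

end Chart

/-! ## §2. Print's Gaussian `dμ_{C^{(k)}(U)}` AS A MEASURE ON THE FIELDS `B′`, and its covariance under `B′ ↦ R(u)B′` -/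

section GaussField

variable {B : Type} [Fintype B] [DecidableEq B] {F : Type*} [NormedAddCommGroup F] [InnerProductSpace ℝ F]
  [FiniteDimensional ℝ F] [MeasurableSpace F] [BorelSpace F]

/-- **«the measure becomes a Gaussian measure»** ON THE FIELDS: the normalised Gaussian with precision matrix `M` in the
chart, transported to `B′`-space along `fieldCoord⁻¹` — `gaussField M := (gaussProb M).map fieldCoordM.symm`.
[cite: Balaban1987RG1, (2.11)–(2.12) pp.267–268] -/
def gaussField (M : Matrix (B × Idx F) (B × Idx F) ℝ) : Measure (B → F) :=
  (gaussProb M).map ⇑(fieldCoordM F B).symm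

omit [DecidableEq B] in
/-- Unfolding of `gaussField`. [cite: Balaban1987RG1, (2.11)–(2.12) pp.267–268] -/
theorem gaussField_def (M : Matrix (B × Idx F) (B × Idx F) ℝ) :
    gaussField M = (gaussProb M).map ⇑(fieldCoordM F B).symm := rfl

/-- For a positive definite precision the Gaussian on the fields is a probability measure (the normalised reading of
`dμ_{C^{(k)}}`, as in `B12Eq213Body268.FluctData`). [cite: Balaban1987RG1, (2.11)–(2.12) pp.267–268] -/
theorem isProbabilityMeasure_gaussField {M : Matrix (B × Idx F) (B × Idx F) ℝ} (hM : M.PosDef) :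
    IsProbabilityMeasure (gaussField M) := by
  haveI := isProbabilityMeasure_gaussProb hM
  exact Measure.isProbabilityMeasure_map (fieldCoordM F B).symm.measurable.aemeasurable

omit [DecidableEq B] in
/-- **Change of variables to the chart**: `∫ Φ(B′) dμ(B′) = ∫ Φ(fieldCoord⁻¹ z) d(gaussProb M)(z)` for every `Φ` (no integrability
needed). [cite: Balaban1987RG1, (2.12)–(2.13) p.268] -/
theorem integral_gaussField {E : Type*} [NormedAddCommGroup E] [NormedSpace ℝ E] (M : Matrix (B × Idx F) (B × Idx F) ℝ)
    (Φ : (B → F) → E) :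
    ∫ A, Φ A ∂(gaussField M) = ∫ z, Φ ((fieldCoord F B).symm z) ∂(gaussProb M) := by
  rw [gaussField, integral_map_equiv]
  simp_rw [fieldCoordM_symm_apply]

omit [DecidableEq B] in
/-- **The Gaussian on the fields IS the normalised density `e^{−½⟨B′, MB′⟩} dB′`** for *«the natural Lebesgue measure»* `dB′` on
the fields (p34's `measurePreserving_fieldCoordM`): `gaussField M = (∫e^{−½⟨z,Mz⟩}dz)⁻¹ · e^{−½⟨fieldCoord B′, M fieldCoord B′⟩} dB′`.
[cite: Balaban1987RG1, (2.11)–(2.12) pp.267–268; Balaban1982Higgs1, p.605] -/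
theorem gaussField_eq_withDensity (M : Matrix (B × Idx F) (B × Idx F) ℝ) :
    gaussField M = ENNReal.ofReal (B13GaugeDevices.gaussNorm M)⁻¹ •
      (volume : Measure (B → F)).withDensity
        (fun A => ENNReal.ofReal (B13GaugeDevices.gaussWeight M (fieldCoord F B A))) := by
  rw [gaussField, gaussProb, Measure.map_smul, B10Eq26MeasureInv.map_withDensity_equiv,
    ((measurePreserving_fieldCoordM F B).symm _).map_eq, MeasurableEquiv.symm_symm]
  rfl

omit [MeasurableSpace F] [BorelSpace F] in
/-- At the matrix of an operator the density is r07's (22)-shaped Gaussian weight on the fields: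
`e^{−½⟨fieldCoord B′, (avgMatrix Δ) fieldCoord B′⟩} = exp(−½ Σ_b⟪B′(b), (ΔB′)(b)⟫)`. [cite: Balaban1987RG1, (2.11) p.267; Balaban1985UV3, (22) p.261] -/
theorem gaussWeight_avgMatrix_fieldCoord {X : Type*} (Δ : X → ((B → F) →ₗ[ℝ] (B → F))) (U : X) (A : B → F) :
    B13GaugeDevices.gaussWeight (avgMatrix (Δ U)) (fieldCoord F B A)
      = Real.exp (-(B10Eq26MeasureInv.quadForm (fun U => ⇑(Δ U)) U A) / 2) := by
  rw [B13GaugeDevices.gaussWeight, ← quadForm_eq_dotProduct]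
  congr 1
  ring

/-- **The B10/B12 JOIN at the level of measures**: the Gaussian on the fields at the matrix of `Δ(U)` is r07's covariant density
family `exp(−½⟨A, Δ(U)A⟩) dA` (`B10Eq26MeasureInv.cov_gaussDensity`), normalised. [cite: Balaban1987RG1, (2.11)–(2.12) pp.267–268; Balaban1985UV3, (22) p.261] -/
theorem gaussField_avgMatrix_eq {X : Type*} (Δ : X → ((B → F) →ₗ[ℝ] (B → F))) (U : X) :
    gaussField (avgMatrix (Δ U)) = ENNReal.ofReal (B13GaugeDevices.gaussNorm (avgMatrix (Δ U)))⁻¹ •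
      (volume : Measure (B → F)).withDensity
        (fun A => ENNReal.ofReal (Real.exp (-(B10Eq26MeasureInv.quadForm (fun U => ⇑(Δ U)) U A) / 2))) := by
  rw [gaussField_eq_withDensity]
  simp_rw [gaussWeight_avgMatrix_fieldCoord]

/-- **«together with the measure, are invariant» ON THE FIELDS**: `(gaussField M).map (B′ ↦ R(u)B′) = gaussField (R M Rᵀ)`,
`R = rotMatrix f` — r09's `map_rotEquiv_gaussProb` transported through the chart. [cite: Balaban1987RG1, (2.16) p.269] -/
theorem gaussField_map_rot (f : B → (F ≃ₗᵢ[ℝ] F)) (M : Matrix (B × Idx F) (B × Idx F) ℝ) :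
    (gaussField M).map ⇑(rot f) = gaussField (rotMatrix f * M * (rotMatrix f)ᵀ) := by
  rw [gaussField, gaussField, Measure.map_map (rot f).measurable (fieldCoordM F B).symm.measurable]
  have hfun : ⇑(rot f) ∘ ⇑(fieldCoordM F B).symm
      = ⇑(fieldCoordM F B).symm ∘ ⇑(rotEquiv (rotMatrix f) (rotMatrix_transpose_mul_self f)) := by
    funext z
    simp only [Function.comp_apply, fieldCoordM_symm_apply, rotEquiv_apply, rot_fieldCoord_symm]
  rw [hfun, ← Measure.map_map (fieldCoordM F B).symm.measurable (MeasurableEquiv.measurable _), map_rotEquiv_gaussProb]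

/-- **COVARIANT PRECISIONS ⇒ COVARIANT MEASURES ON THE FIELDS**: `M(τU) = R M(U) Rᵀ` gives `(dμ_U).map (rot f) = dμ_{τU}` —
the hypothesis `hcov` of `B12Eq213Body268.FluctData.newTerm_onBonds_eq_of_covariant`. [cite: Balaban1987RG1, (2.16) p.269] -/
theorem gaussField_map_rot_of_conj {X : Type*} {τ : X → X} (f : B → (F ≃ₗᵢ[ℝ] F))
    {prec : X → Matrix (B × Idx F) (B × Idx F) ℝ} (hprec : ∀ U, prec (τ U) = rotMatrix f * prec U * (rotMatrix f)ᵀ) (U : X) :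
    (gaussField (prec U)).map ⇑(rot f) = gaussField (prec (τ U)) := by
  rw [gaussField_map_rot, hprec]

/-- **INTERTWINED OPERATORS ⇒ COVARIANT MEASURES ON THE FIELDS**: `Δ(τU) ∘ R(u) = R(u) ∘ Δ(U)` gives
`(dμ_U).map (rot f) = dμ_{τU}` for `dμ_U = gaussField (avgMatrix (Δ U))` — print's sentence with the covariance of `Δ^{(k)}` as
the only input. [cite: Balaban1987RG1, (2.16) p.269; Balaban1985BackgroundPropagators, (3.30) p.395] -/
theorem gaussField_map_rot_of_intertwine {X : Type*} {τ : X → X} (f : B → (F ≃ₗᵢ[ℝ] F))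
    (Δ : X → ((B → F) →ₗ[ℝ] (B → F))) (hΔ : ∀ U A, Δ (τ U) (rot f A) = rot f (Δ U A)) (U : X) :
    (gaussField (avgMatrix (Δ U))).map ⇑(rot f) = gaussField (avgMatrix (Δ (τ U))) :=
  gaussField_map_rot_of_conj (τ := τ) (prec := fun U => avgMatrix (Δ U)) f
    (fun U => avgMatrix_conj_of_intertwine f Δ hΔ U) U

/-! ### With the elimination `B′ = CB`: the Gaussian in the remaining variables read on the fields -/

variable {κ : Type} [Fintype κ] [DecidableEq κ]

omit [DecidableEq B] [DecidableEq κ] in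
/-- The map `B ↦ B′ = fieldCoord⁻¹(C B)` from the remaining variables to the fields is measurable. [cite: Balaban1987RG1, (2.11)–(2.12) pp.267–268] -/
theorem measurable_symm_mulVec (Cop : Matrix (B × Idx F) κ ℝ) :
    Measurable fun z : κ → ℝ => (fieldCoord F B).symm (Cop *ᵥ z) := by
  have h : (fun z : κ → ℝ => (fieldCoord F B).symm (Cop *ᵥ z)) = ⇑(fieldCoordM F B).symm ∘ fun z => Cop *ᵥ z :=
    funext fun z => (fieldCoordM_symm_apply F B _).symm
  rw [h]
  exact (fieldCoordM F B).symm.measurable.comp (continuous_const.matrix_mulVec continuous_id).measurable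

/-- **«Denoting the remaining variables by B we have B′ = CB … the measure becomes a Gaussian measure in variables B»** READ
ON THE FIELDS: the normalised Gaussian with precision `M` in the remaining variables `B : κ → ℝ`, pushed forward to `B′`-space by
`B ↦ fieldCoord⁻¹(C B)` (a measure on the fields carried by the constraint surface `{B′ = CB}`). [cite: Balaban1987RG1, (2.11)–(2.12) pp.267–268] -/
def gaussFieldPush (Cop : Matrix (B × Idx F) κ ℝ) (M : Matrix κ κ ℝ) : Measure (B → F) :=
  (gaussProb M).map fun z => (fieldCoord F B).symm (Cop *ᵥ z)

omit [Fintype B] [DecidableEq B] [BorelSpace F] [DecidableEq κ] in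
/-- Unfolding of `gaussFieldPush`. [cite: Balaban1987RG1, (2.11)–(2.12) pp.267–268] -/
theorem gaussFieldPush_def (Cop : Matrix (B × Idx F) κ ℝ) (M : Matrix κ κ ℝ) :
    gaussFieldPush Cop M = (gaussProb M).map fun z => (fieldCoord F B).symm (Cop *ᵥ z) := rfl

omit [DecidableEq B] in
/-- For a positive definite precision the pushed Gaussian is a probability measure. [cite: Balaban1987RG1, (2.11)–(2.12) pp.267–268] -/
theorem isProbabilityMeasure_gaussFieldPush (Cop : Matrix (B × Idx F) κ ℝ) {M : Matrix κ κ ℝ} (hM : M.PosDef) :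
    IsProbabilityMeasure (gaussFieldPush Cop M) := by
  haveI := isProbabilityMeasure_gaussProb hM
  exact Measure.isProbabilityMeasure_map (measurable_symm_mulVec Cop).aemeasurable

/-- No elimination (`C = 1`) is the Gaussian on the fields of §2. [cite: Balaban1987RG1, (2.11)–(2.12) pp.267–268] -/
theorem gaussFieldPush_one (M : Matrix (B × Idx F) (B × Idx F) ℝ) : gaussFieldPush 1 M = gaussField M := by
  rw [gaussFieldPush, gaussField]
  congr 1
  funext z
  rw [Matrix.one_mulVec, fieldCoordM_symm_apply]

/-- **Covariance WITH THE ELIMINATION**: if the remaining variables transform by the orthogonal `R₂` and the elimination maps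
intertwine, `C′ R₂ = R₁ C` with `R₁ = rotMatrix f` (`B12Eq213Body268` §6/§6b), then
`(gaussFieldPush C M).map (B′ ↦ R(u)B′) = gaussFieldPush C′ (R₂ M R₂ᵀ)`. [cite: Balaban1987RG1, (2.16) p.269 with (2.11)–(2.12) pp.267–268] -/
theorem gaussFieldPush_map_rot (f : B → (F ≃ₗᵢ[ℝ] F)) {Cop Cop' : Matrix (B × Idx F) κ ℝ} {R₂ : Matrix κ κ ℝ}
    (hR₂ : R₂ᵀ * R₂ = 1) (hC : Cop' * R₂ = rotMatrix f * Cop) (M : Matrix κ κ ℝ) :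
    (gaussFieldPush Cop M).map ⇑(rot f) = gaussFieldPush Cop' (R₂ * M * R₂ᵀ) := by
  rw [gaussFieldPush, gaussFieldPush, Measure.map_map (rot f).measurable (measurable_symm_mulVec Cop)]
  have hfun : ⇑(rot f) ∘ (fun z : κ → ℝ => (fieldCoord F B).symm (Cop *ᵥ z))
      = (fun z : κ → ℝ => (fieldCoord F B).symm (Cop' *ᵥ z)) ∘ ⇑(rotEquiv R₂ hR₂) := by
    funext z
    simp only [Function.comp_apply, rotEquiv_apply, rot_fieldCoord_symm, Matrix.mulVec_mulVec, hC]
  rw [hfun, ← Measure.map_map (measurable_symm_mulVec Cop') (MeasurableEquiv.measurable _), map_rotEquiv_gaussProb]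

/-- Along a family of backgrounds: `C(τU) R₂ = R₁ C(U)` and `M(τU) = R₂ M(U) R₂ᵀ` give `(dμ_U).map (rot f) = dμ_{τU}` for
`dμ_U = gaussFieldPush (C U) (M U)` — the hypothesis `hcov` of `FluctData.newTerm_onBonds_eq_of_covariant`, with elimination.
[cite: Balaban1987RG1, (2.16) p.269 with (2.11)–(2.12) pp.267–268] -/
theorem gaussFieldPush_map_rot_of_conj {X : Type*} {τ : X → X} (f : B → (F ≃ₗᵢ[ℝ] F)) {Cop : X → Matrix (B × Idx F) κ ℝ}
    {prec : X → Matrix κ κ ℝ} {R₂ : Matrix κ κ ℝ} (hR₂ : R₂ᵀ * R₂ = 1) (hC : ∀ U, Cop (τ U) * R₂ = rotMatrix f * Cop U)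
    (hprec : ∀ U, prec (τ U) = R₂ * prec U * R₂ᵀ) (U : X) :
    (gaussFieldPush (Cop U) (prec U)).map ⇑(rot f) = gaussFieldPush (Cop (τ U)) (prec (τ U)) := by
  rw [gaussFieldPush_map_rot f hR₂ (hC U), hprec]

omit [DecidableEq B] [DecidableEq κ] in
/-- For an injective elimination map (`B′ = CB` parametrises the constraint surface) `B ↦ fieldCoord⁻¹(C B)` is a measurable
embedding (an injective linear map of finite-dimensional spaces is a closed embedding). [cite: Balaban1987RG1, (2.11)–(2.12) pp.267–268] -/
theorem measurableEmbedding_symm_mulVec (Cop : Matrix (B × Idx F) κ ℝ) (hC : Function.Injective Cop.mulVec) :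
    MeasurableEmbedding fun z : κ → ℝ => (fieldCoord F B).symm (Cop *ᵥ z) := by
  have h : (fun z : κ → ℝ => (fieldCoord F B).symm (Cop *ᵥ z))
      = ⇑((fieldCoord F B).symm.toLinearMap ∘ₗ Matrix.mulVecLin Cop) := rfl
  rw [h]
  refine (LinearMap.isClosedEmbedding_of_injective (LinearMap.ker_eq_bot.mpr ?_)).measurableEmbedding
  exact (fieldCoord F B).symm.injective.comp hC

omit [DecidableEq B] [DecidableEq κ] in
/-- **Change of variables WITH THE ELIMINATION**: `∫ Φ(B′) dμ(B′) = ∫ Φ(fieldCoord⁻¹(C B)) d(gaussProb M)(B)` for every `Φ`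
(`C` injective; no integrability needed). [cite: Balaban1987RG1, (2.12)–(2.13) p.268] -/
theorem integral_gaussFieldPush {E : Type*} [NormedAddCommGroup E] [NormedSpace ℝ E] (Cop : Matrix (B × Idx F) κ ℝ)
    (hC : Function.Injective Cop.mulVec) (M : Matrix κ κ ℝ) (Φ : (B → F) → E) :
    ∫ A, Φ A ∂(gaussFieldPush Cop M) = ∫ z, Φ ((fieldCoord F B).symm (Cop *ᵥ z)) ∂(gaussProb M) := by
  unfold gaussFieldPush
  exact (measurableEmbedding_symm_mulVec Cop hC).integral_map Φ

end GaussField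

/-! ## §3. THE JOIN: (2.16) for the datum of (2.13) ON PRINT'S CARRIER WITH PRINT'S GAUSSIAN — `χ_k` and measure clauses both
## theorems -/

section OnBonds

variable {P : Params} {k : ℕ} [DecidableEq (PBond P k)] {𝔤 : Type} [NormedAddCommGroup 𝔤] [InnerProductSpace ℝ 𝔤]
  [FiniteDimensional ℝ 𝔤] [MeasurableSpace 𝔤] [BorelSpace 𝔤] {X : Type*}

/-- **THE DATUM OF (2.12)/(2.13) ON PRINT'S CARRIER WITH PRINT'S GAUSSIAN AND PRINT'S `χ_k`**: fluctuation fields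
`B′ ∈ VecField P k 𝔤`, measures `dμ_{C^{(k)}(U)} := gaussField (prec U)` (precision matrix `prec U = (C^{(k)}(U))⁻¹` in the chart),
`χ_k := chiFluct ε₁`, exponent parts `𝐏^{(k)}`, `{…}` — `B12Eq213Body268.FluctData.onBonds` at the Gaussian measures.
[cite: Balaban1987RG1, (2.11)–(2.13) pp.267–268] -/
def onBondsGauss (prec : X → Matrix (PBond P k × Idx 𝔤) (PBond P k × Idx 𝔤) ℝ) (hpd : ∀ U, (prec U).PosDef) (ε₁ : ℝ)
    (Pk Qk : ℝ → X → VecField P k 𝔤 → ℝ) : FluctData X :=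
  FluctData.onBonds (fun U => gaussField (prec U)) (fun U => isProbabilityMeasure_gaussField (hpd U)) ε₁ Pk Qk

/-- The measures of the datum are the Gaussians on the fields (definitional). [cite: Balaban1987RG1, (2.11)–(2.12) pp.267–268] -/
theorem onBondsGauss_μ (prec : X → Matrix (PBond P k × Idx 𝔤) (PBond P k × Idx 𝔤) ℝ) (hpd : ∀ U, (prec U).PosDef)
    (ε₁ : ℝ) (Pk Qk : ℝ → X → VecField P k 𝔤 → ℝ) (U : X) :
    (onBondsGauss prec hpd ε₁ Pk Qk).μ U = gaussField (prec U) := rfl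

/-- `χ` of the datum is print's `χ_k` (definitional). [cite: Balaban1987RG1, (2.9) p.266] -/
theorem onBondsGauss_χ (prec : X → Matrix (PBond P k × Idx 𝔤) (PBond P k × Idx 𝔤) ℝ) (hpd : ∀ U, (prec U).PosDef)
    (ε₁ : ℝ) (Pk Qk : ℝ → X → VecField P k 𝔤 → ℝ) (U : X) (B : VecField P k 𝔤) :
    (onBondsGauss prec hpd ε₁ Pk Qk).χ U B = B12SmallFieldDomain259.chiFluct ε₁ B := rfl

/-- **(2.16) ON PRINT'S CARRIER FOR PRINT'S GAUSSIAN — NO `χ_k` HYPOTHESIS, NO MEASURE HYPOTHESIS.**  For bondwise isometries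
`f b` (print's `R(u(b₋))`) and a background map `τ`: the conjugation law of the precision, `prec(τU) = R·prec(U)·Rᵀ` with
`R = rotMatrix f`, and the joint invariance of `𝐏^{(k)}`, `{…}` give `𝐄^{(k+1)}(g, τU) = 𝐄^{(k+1)}(g, U)`: the measure clause is
`gaussField_map_rot_of_conj`, the `χ_k` clause r09's `chiFluct_comp_local_isometry` (inside `FluctData.newTerm_onBonds_eq_of_covariant`).
[cite: Balaban1987RG1, (2.16) p.269] -/
theorem newTerm_onBondsGauss_eq_of_covariant (prec : X → Matrix (PBond P k × Idx 𝔤) (PBond P k × Idx 𝔤) ℝ)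
    (hpd : ∀ U, (prec U).PosDef) (ε₁ : ℝ) (Pk Qk : ℝ → X → VecField P k 𝔤 → ℝ) (g : ℝ) (τ : X → X)
    (f : PBond P k → (𝔤 ≃ₗᵢ[ℝ] 𝔤)) (hprec : ∀ U, prec (τ U) = rotMatrix f * prec U * (rotMatrix f)ᵀ)
    (hP : ∀ U B, Pk g (τ U) (rot f B) = Pk g U B) (hQ : ∀ U B, Qk g (τ U) (rot f B) = Qk g U B) (U : X) :
    (onBondsGauss prec hpd ε₁ Pk Qk).newTerm g (τ U) = (onBondsGauss prec hpd ε₁ Pk Qk).newTerm g U :=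
  FluctData.newTerm_onBonds_eq_of_covariant _ _ ε₁ Pk Qk g τ f (fun U => gaussField_map_rot_of_conj f hprec U) hP hQ U

/-- **(2.16) verbatim on print's carrier for print's Gaussian**: `U_{k+1} ↦ U^u_{k+1}` (`τ`), `B′ ↦ R(u)B′` with `R` a
representation of `G` on `𝔤` by isometries; the precision conjugated by the matrix of `R(u)`, and `𝐏^{(k)}`, `{…}` invariant
⇒ (2.13) is gauge invariant. [cite: Balaban1987RG1, (2.16) p.269] -/
theorem newTerm_onBondsGauss_gauge_invariant {G : Type*} (prec : X → Matrix (PBond P k × Idx 𝔤) (PBond P k × Idx 𝔤) ℝ)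
    (hpd : ∀ U, (prec U).PosDef) (ε₁ : ℝ) (Pk Qk : ℝ → X → VecField P k 𝔤 → ℝ) (g : ℝ) (τ : X → X)
    (R : G → (𝔤 ≃ₗᵢ[ℝ] 𝔤)) (u : GaugeTransf P k G)
    (hprec : ∀ U, prec (τ U) = rotMatrix (fun b : PBond P k => R (u b.src)) * prec U
      * (rotMatrix (fun b : PBond P k => R (u b.src)))ᵀ)
    (hP : ∀ U B, Pk g (τ U) (B12ChiInvariance269.rotFluct (fun g => ⇑(R g)) u B) = Pk g U B)
    (hQ : ∀ U B, Qk g (τ U) (B12ChiInvariance269.rotFluct (fun g => ⇑(R g)) u B) = Qk g U B) (U : X) :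
    (onBondsGauss prec hpd ε₁ Pk Qk).newTerm g (τ U) = (onBondsGauss prec hpd ε₁ Pk Qk).newTerm g U :=
  newTerm_onBondsGauss_eq_of_covariant prec hpd ε₁ Pk Qk g τ (fun b => R (u b.src)) hprec hP hQ U

/-- **(2.16) FROM THE OPERATOR STATEMENT.**  For a family of symmetric positive operators `Δ^{(k)}(U)` on the fields (the basic
quadratic form of (2.11)) INTERTWINING the transformations, `Δ^{(k)}(τU) ∘ R = R ∘ Δ^{(k)}(U)`, and jointly invariant `𝐏^{(k)}`,
`{…}`: the Gaussian datum at `prec U := avgMatrix (Δ U)` satisfies `𝐄^{(k+1)}(g, τU) = 𝐄^{(k+1)}(g, U)` — print's *«all the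
expressions in (2.12), together with the measure, are invariant … therefore the expression (2.13) is gauge invariant»* with the
measure clause and the `χ_k` clause DERIVED. [cite: Balaban1987RG1, (2.16) p.269; Balaban1985BackgroundPropagators, (3.30) p.395] -/
theorem newTerm_onBondsGauss_eq_of_intertwine (Δ : X → (VecField P k 𝔤 →ₗ[ℝ] VecField P k 𝔤))
    (hpd : ∀ U, (avgMatrix (Δ U)).PosDef) (ε₁ : ℝ) (Pk Qk : ℝ → X → VecField P k 𝔤 → ℝ) (g : ℝ) (τ : X → X)
    (f : PBond P k → (𝔤 ≃ₗᵢ[ℝ] 𝔤)) (hΔ : ∀ U A, Δ (τ U) (rot f A) = rot f (Δ U A))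
    (hP : ∀ U B, Pk g (τ U) (rot f B) = Pk g U B) (hQ : ∀ U B, Qk g (τ U) (rot f B) = Qk g U B) (U : X) :
    (onBondsGauss (fun U => avgMatrix (Δ U)) hpd ε₁ Pk Qk).newTerm g (τ U)
      = (onBondsGauss (fun U => avgMatrix (Δ U)) hpd ε₁ Pk Qk).newTerm g U :=
  newTerm_onBondsGauss_eq_of_covariant (fun U => avgMatrix (Δ U)) hpd ε₁ Pk Qk g τ f
    (fun U => avgMatrix_conj_of_intertwine f Δ hΔ U) hP hQ U

/-- (2.16) verbatim from the operator statement: `Δ^{(k)}(U^u) ∘ R(u) = R(u) ∘ Δ^{(k)}(U)` for print's `R(u)` and invariant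
`𝐏^{(k)}`, `{…}` ⇒ (2.13) is gauge invariant, for the Gaussian datum on the fields. [cite: Balaban1987RG1, (2.16) p.269] -/
theorem newTerm_onBondsGauss_gauge_invariant_of_intertwine {G : Type*} (Δ : X → (VecField P k 𝔤 →ₗ[ℝ] VecField P k 𝔤))
    (hpd : ∀ U, (avgMatrix (Δ U)).PosDef) (ε₁ : ℝ) (Pk Qk : ℝ → X → VecField P k 𝔤 → ℝ) (g : ℝ) (τ : X → X)
    (R : G → (𝔤 ≃ₗᵢ[ℝ] 𝔤)) (u : GaugeTransf P k G)
    (hΔ : ∀ U A, Δ (τ U) (B12ChiInvariance269.rotFluct (fun g => ⇑(R g)) u A)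
      = B12ChiInvariance269.rotFluct (fun g => ⇑(R g)) u (Δ U A))
    (hP : ∀ U B, Pk g (τ U) (B12ChiInvariance269.rotFluct (fun g => ⇑(R g)) u B) = Pk g U B)
    (hQ : ∀ U B, Qk g (τ U) (B12ChiInvariance269.rotFluct (fun g => ⇑(R g)) u B) = Qk g U B) (U : X) :
    (onBondsGauss (fun U => avgMatrix (Δ U)) hpd ε₁ Pk Qk).newTerm g (τ U)
      = (onBondsGauss (fun U => avgMatrix (Δ U)) hpd ε₁ Pk Qk).newTerm g U :=
  newTerm_onBondsGauss_eq_of_intertwine Δ hpd ε₁ Pk Qk g τ (fun b => R (u b.src)) hΔ hP hQ U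

/-- **THE LITERAL UNIFICATION (no elimination)**: the (2.13) of the carrier datum EQUALS the (2.13) of the coordinate datum
`B12Eq213Body268.FluctData.gaussian` (§4 there) whose `χ_k`, `𝐏^{(k)}`, `{…}` are print's functions of `B′` read through the chart,
`B′ = fieldCoord⁻¹ z`. [cite: Balaban1987RG1, (2.12)–(2.13) p.268] -/
theorem newTerm_onBondsGauss_eq_gaussian (prec : X → Matrix (PBond P k × Idx 𝔤) (PBond P k × Idx 𝔤) ℝ)
    (hpd : ∀ U, (prec U).PosDef) (ε₁ : ℝ) (Pk Qk : ℝ → X → VecField P k 𝔤 → ℝ) (g : ℝ) (U : X) :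
    (onBondsGauss prec hpd ε₁ Pk Qk).newTerm g U
      = (FluctData.gaussian prec hpd
          (fun _ z => B12SmallFieldDomain259.chiFluct ε₁ ((fieldCoord 𝔤 (PBond P k)).symm z))
          (fun _ _ => (B12SmallFieldDomain259.chiFluct_nonneg_le_one ε₁ _).1)
          (fun _ _ => (B12SmallFieldDomain259.chiFluct_nonneg_le_one ε₁ _).2)
          (fun g U z => Pk g U ((fieldCoord 𝔤 (PBond P k)).symm z))
          (fun g U z => Qk g U ((fieldCoord 𝔤 (PBond P k)).symm z))).newTerm g U := by
  show Real.log (∫ B, B12SmallFieldDomain259.chiFluct ε₁ B * Real.exp (Pk g U B + Qk g U B) ∂(gaussField (prec U)))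
    = Real.log (∫ z, B12SmallFieldDomain259.chiFluct ε₁ ((fieldCoord 𝔤 (PBond P k)).symm z)
        * Real.exp (Pk g U ((fieldCoord 𝔤 (PBond P k)).symm z) + Qk g U ((fieldCoord 𝔤 (PBond P k)).symm z))
        ∂(gaussProb (prec U)))
  rw [integral_gaussField]

/-! ### With the elimination `B′ = C(U)B` -/

variable {κ : Type} [Fintype κ] [DecidableEq κ]

/-- **THE DATUM ON PRINT'S CARRIER WITH PRINT'S GAUSSIAN IN THE REMAINING VARIABLES**: measures
`dμ_U := gaussFieldPush (C U) (prec U)` — the Gaussian with precision `prec U` (print's `C*Δ^{(k)}C`) in the remaining variables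
`B`, read on the fields through `B′ = C(U)B` —, `χ_k := chiFluct ε₁`, `𝐏^{(k)}`, `{…}`. [cite: Balaban1987RG1, (2.11)–(2.13) pp.267–268] -/
def onBondsGaussPush (Cop : X → Matrix (PBond P k × Idx 𝔤) κ ℝ) (prec : X → Matrix κ κ ℝ) (hpd : ∀ U, (prec U).PosDef)
    (ε₁ : ℝ) (Pk Qk : ℝ → X → VecField P k 𝔤 → ℝ) : FluctData X :=
  FluctData.onBonds (fun U => gaussFieldPush (Cop U) (prec U))
    (fun U => isProbabilityMeasure_gaussFieldPush (Cop U) (hpd U)) ε₁ Pk Qk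

omit [DecidableEq (PBond P k)] in
/-- The measures of the datum (definitional). [cite: Balaban1987RG1, (2.11)–(2.12) pp.267–268] -/
theorem onBondsGaussPush_μ (Cop : X → Matrix (PBond P k × Idx 𝔤) κ ℝ) (prec : X → Matrix κ κ ℝ)
    (hpd : ∀ U, (prec U).PosDef) (ε₁ : ℝ) (Pk Qk : ℝ → X → VecField P k 𝔤 → ℝ) (U : X) :
    (onBondsGaussPush Cop prec hpd ε₁ Pk Qk).μ U = gaussFieldPush (Cop U) (prec U) := rfl

/-- **(2.16) ON PRINT'S CARRIER WITH THE ELIMINATION — NO `χ_k` HYPOTHESIS, NO MEASURE HYPOTHESIS**: the remaining variables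
transform by the orthogonal `R₂`, the elimination maps intertwine (`C(τU) R₂ = R₁ C(U)`, `R₁ = rotMatrix f`), the precision is
conjugated (`prec(τU) = R₂ prec(U) R₂ᵀ`), and `𝐏^{(k)}`, `{…}` are jointly invariant ⇒ `𝐄^{(k+1)}(g, τU) = 𝐄^{(k+1)}(g, U)`.
[cite: Balaban1987RG1, (2.16) p.269 with (2.11)–(2.13) pp.267–268] -/
theorem newTerm_onBondsGaussPush_eq_of_covariant (Cop : X → Matrix (PBond P k × Idx 𝔤) κ ℝ) (prec : X → Matrix κ κ ℝ)
    (hpd : ∀ U, (prec U).PosDef) (ε₁ : ℝ) (Pk Qk : ℝ → X → VecField P k 𝔤 → ℝ) (g : ℝ) (τ : X → X)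
    (f : PBond P k → (𝔤 ≃ₗᵢ[ℝ] 𝔤)) (R₂ : Matrix κ κ ℝ) (hR₂ : R₂ᵀ * R₂ = 1) (hC : ∀ U, Cop (τ U) * R₂ = rotMatrix f * Cop U)
    (hprec : ∀ U, prec (τ U) = R₂ * prec U * R₂ᵀ)
    (hP : ∀ U B, Pk g (τ U) (rot f B) = Pk g U B) (hQ : ∀ U B, Qk g (τ U) (rot f B) = Qk g U B) (U : X) :
    (onBondsGaussPush Cop prec hpd ε₁ Pk Qk).newTerm g (τ U) = (onBondsGaussPush Cop prec hpd ε₁ Pk Qk).newTerm g U :=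
  FluctData.newTerm_onBonds_eq_of_covariant _ _ ε₁ Pk Qk g τ f
    (fun U => gaussFieldPush_map_rot_of_conj f hR₂ hC hprec U) hP hQ U

/-- **(2.16) FOR PRINT'S PRECISION `C(U)*M(U)C(U)` ON THE CARRIER** (`B12Eq213Body268.prec212U`): conjugation of `M = Δ^{(k)}`'s
matrix by `R₁ = rotMatrix f` and the intertwining `C(τU) R₂ = R₁ C(U)` give the covariance of the precision
(`B12Eq213Body268.prec212U_covariant`, `R₁ᵀR₁ = 1` now a theorem) and hence the invariance of (2.13).
[cite: Balaban1987RG1, (2.16) p.269 with (2.11)–(2.13) pp.267–268] -/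
theorem newTerm_onBondsGaussPush_prec212U_eq_of_covariant (Cop : X → Matrix (PBond P k × Idx 𝔤) κ ℝ)
    (Δm : X → Matrix (PBond P k × Idx 𝔤) (PBond P k × Idx 𝔤) ℝ) (hpd : ∀ U, (prec212U Cop Δm U).PosDef) (ε₁ : ℝ)
    (Pk Qk : ℝ → X → VecField P k 𝔤 → ℝ) (g : ℝ) (τ : X → X) (f : PBond P k → (𝔤 ≃ₗᵢ[ℝ] 𝔤)) (R₂ : Matrix κ κ ℝ)
    (hR₂ : R₂ᵀ * R₂ = 1) (hC : ∀ U, Cop (τ U) * R₂ = rotMatrix f * Cop U)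
    (hΔ : ∀ U, Δm (τ U) = rotMatrix f * Δm U * (rotMatrix f)ᵀ)
    (hP : ∀ U B, Pk g (τ U) (rot f B) = Pk g U B) (hQ : ∀ U B, Qk g (τ U) (rot f B) = Qk g U B) (U : X) :
    (onBondsGaussPush Cop (prec212U Cop Δm) hpd ε₁ Pk Qk).newTerm g (τ U)
      = (onBondsGaussPush Cop (prec212U Cop Δm) hpd ε₁ Pk Qk).newTerm g U :=
  newTerm_onBondsGaussPush_eq_of_covariant Cop (prec212U Cop Δm) hpd ε₁ Pk Qk g τ f R₂ hR₂ hC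
    (fun U => prec212U_covariant Cop (rotMatrix f) R₂ (rotMatrix_transpose_mul_self f) hR₂ hC hΔ U) hP hQ U

/-- **(2.16) WITH THE ELIMINATION, FROM THE OPERATOR STATEMENT**: `Δ^{(k)}(τU) ∘ R = R ∘ Δ^{(k)}(U)` for the operators on the
fields, the intertwining of the elimination maps and invariant `𝐏^{(k)}`, `{…}` ⇒ (2.13) of the datum at print's precision
`C(U)*Δ^{(k)}(U)C(U)` is invariant. [cite: Balaban1987RG1, (2.16) p.269 with (2.11)–(2.13) pp.267–268; Balaban1985BackgroundPropagators, (3.30) p.395] -/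
theorem newTerm_onBondsGaussPush_eq_of_intertwine (Cop : X → Matrix (PBond P k × Idx 𝔤) κ ℝ)
    (Δ : X → (VecField P k 𝔤 →ₗ[ℝ] VecField P k 𝔤))
    (hpd : ∀ U, (prec212U Cop (fun U => avgMatrix (Δ U)) U).PosDef) (ε₁ : ℝ) (Pk Qk : ℝ → X → VecField P k 𝔤 → ℝ)
    (g : ℝ) (τ : X → X) (f : PBond P k → (𝔤 ≃ₗᵢ[ℝ] 𝔤)) (R₂ : Matrix κ κ ℝ) (hR₂ : R₂ᵀ * R₂ = 1)
    (hC : ∀ U, Cop (τ U) * R₂ = rotMatrix f * Cop U) (hΔ : ∀ U A, Δ (τ U) (rot f A) = rot f (Δ U A))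
    (hP : ∀ U B, Pk g (τ U) (rot f B) = Pk g U B) (hQ : ∀ U B, Qk g (τ U) (rot f B) = Qk g U B) (U : X) :
    (onBondsGaussPush Cop (prec212U Cop fun U => avgMatrix (Δ U)) hpd ε₁ Pk Qk).newTerm g (τ U)
      = (onBondsGaussPush Cop (prec212U Cop fun U => avgMatrix (Δ U)) hpd ε₁ Pk Qk).newTerm g U :=
  newTerm_onBondsGaussPush_prec212U_eq_of_covariant Cop (fun U => avgMatrix (Δ U)) hpd ε₁ Pk Qk g τ f R₂ hR₂ hC
    (fun U => avgMatrix_conj_of_intertwine f Δ hΔ U) hP hQ U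

omit [DecidableEq (PBond P k)] in
/-- **THE LITERAL UNIFICATION WITH THE ELIMINATION**: for injective `C(U)` the (2.13) of the carrier datum EQUALS the (2.13) of
`B12Eq213Body268.FluctData.gaussian` at precision `prec` whose `χ_k`, `𝐏^{(k)}`, `{…}` are print's functions of `B′` READ AT
`B′ = C(U)B` through the chart — exactly the datum shape of `FluctData.newTerm_gaussian_prec212U_eq_of_covariant` (§6 there).
[cite: Balaban1987RG1, (2.12)–(2.13) p.268] -/
theorem newTerm_onBondsGaussPush_eq_gaussian (Cop : X → Matrix (PBond P k × Idx 𝔤) κ ℝ)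
    (hCinj : ∀ U, Function.Injective (Cop U).mulVec) (prec : X → Matrix κ κ ℝ) (hpd : ∀ U, (prec U).PosDef) (ε₁ : ℝ)
    (Pk Qk : ℝ → X → VecField P k 𝔤 → ℝ) (g : ℝ) (U : X) :
    (onBondsGaussPush Cop prec hpd ε₁ Pk Qk).newTerm g U
      = (FluctData.gaussian prec hpd
          (fun U z => B12SmallFieldDomain259.chiFluct ε₁ ((fieldCoord 𝔤 (PBond P k)).symm (Cop U *ᵥ z)))
          (fun _ _ => (B12SmallFieldDomain259.chiFluct_nonneg_le_one ε₁ _).1)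
          (fun _ _ => (B12SmallFieldDomain259.chiFluct_nonneg_le_one ε₁ _).2)
          (fun g U z => Pk g U ((fieldCoord 𝔤 (PBond P k)).symm (Cop U *ᵥ z)))
          (fun g U z => Qk g U ((fieldCoord 𝔤 (PBond P k)).symm (Cop U *ᵥ z)))).newTerm g U := by
  show Real.log (∫ B, B12SmallFieldDomain259.chiFluct ε₁ B * Real.exp (Pk g U B + Qk g U B)
      ∂(gaussFieldPush (Cop U) (prec U)))
    = Real.log (∫ z, B12SmallFieldDomain259.chiFluct ε₁ ((fieldCoord 𝔤 (PBond P k)).symm (Cop U *ᵥ z))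
        * Real.exp (Pk g U ((fieldCoord 𝔤 (PBond P k)).symm (Cop U *ᵥ z))
          + Qk g U ((fieldCoord 𝔤 (PBond P k)).symm (Cop U *ᵥ z))) ∂(gaussProb (prec U)))
  rw [integral_gaussFieldPush (Cop U) (hCinj U)]

end OnBonds

/-! ## §4. The intertwining `C(τU) R₂ = R₁ C(U)` ON THE CARRIER from print's characterisation of `C` — *«By the
## δ-function δ(Q̃B′) we eliminate the variables B′(b₀(c)), c ∈ T^{(k+1)}. Denoting the remaining variables by B we have
## B′ = CB»* (v1.1) -/

section Elimination

variable {B : Type} [Fintype B] [DecidableEq B] {F : Type*} [NormedAddCommGroup F] [InnerProductSpace ℝ F]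
  [FiniteDimensional ℝ F]

omit [Fintype B] [DecidableEq B] [FiniteDimensional ℝ F] in
/-- **«the remaining variables»**: the coordinates of the RETAINED bonds `{b // p b}` (print: all bonds of `T^{(k)}` except
the `b₀(c)`, `c ∈ T^{(k+1)}`), as a sub-family of all coordinates `B × Fin (dim F)` of the chart.
[cite: Balaban1987RG1, (2.11)–(2.12) pp.267–268] -/
def remCoord (p : B → Prop) : {b // p b} × Idx F → B × Idx F := fun s => ((s.1 : B), s.2)

omit [Fintype B] [DecidableEq B] [FiniteDimensional ℝ F] in
/-- Unfolding of `remCoord`. [cite: Balaban1987RG1, (2.11)–(2.12) pp.267–268] -/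
theorem remCoord_apply (p : B → Prop) (s : {b // p b} × Idx F) : remCoord p s = ((s.1 : B), s.2) := rfl

omit [Fintype B] [DecidableEq B] [FiniteDimensional ℝ F] in
/-- Distinct remaining variables are distinct coordinates. [cite: Balaban1987RG1, (2.11)–(2.12) pp.267–268] -/
theorem remCoord_injective (p : B → Prop) : Function.Injective (remCoord (F := F) p) := by
  rintro ⟨b, i⟩ ⟨b', i'⟩ h
  simp only [remCoord_apply, Prod.mk.injEq] at h
  exact Prod.ext (Subtype.ext h.1) h.2

/-- **`R(u)` ACTS ON THE REMAINING VARIABLES BY THE SAME BONDWISE ISOMETRIES** (*«local»*): the retained coordinates of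
`R B′` are `R_rem (B′↾retained)` with `R_rem = rotMatrix (f↾retained bonds)` — the block-diagonal matrix preserves the
splitting retained ∕ eliminated bonds.  This is the hypothesis `hR` of `intertwine_of_elimination` and the reason print's
`R₂` on the remaining variables is again orthogonal. [cite: Balaban1987RG1, (2.16) p.269 with (2.11) p.267] -/
theorem rotMatrix_mulVec_remCoord (p : B → Prop) [DecidablePred p] (f : B → (F ≃ₗᵢ[ℝ] F)) (w : B × Idx F → ℝ)
    (s : {b // p b} × Idx F) :
    (rotMatrix f *ᵥ w) (remCoord p s)
      = (rotMatrix (fun b : {b // p b} => f b) *ᵥ fun t => w (remCoord p t)) s := by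
  obtain ⟨b, i⟩ := s
  simp only [Matrix.mulVec, dotProduct, remCoord, Fintype.sum_prod_type, rotMatrix_apply, ite_mul, zero_mul]
  rw [Finset.sum_eq_single_of_mem (b : B) (Finset.mem_univ _) fun q _ hq => by simp [Ne.symm hq],
    Finset.sum_eq_single_of_mem b (Finset.mem_univ _) fun t _ ht => by simp [Ne.symm ht]]
  simp

/-- **PRINT'S CHARACTERISATION OF THE ELIMINATION MAP GIVES THE INTERTWINING** (the hypothesis `hC : C(τU) R₂ = R₁ C(U)`
of `B12Eq213Body268` §6 and of §§2–3 here, in coordinate-free form over the index sets).  Let `C` (at `U`) and `C′` (at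
`τU`) be ELIMINATION MAPS for the constraints `Q`, `Q′` along the remaining coordinates `emb : σ → ι`: they reproduce the
remaining variables (`(C v)(emb s) = v s`), solve the constraint (`Q C = 0`), and the constraint DETERMINES the eliminated
variables (`Q′w = 0 ∧ w↾remaining = 0 ⇒ w = 0` — print: the `b₀(c)`-block of `Q̃` is invertible).  If `R₁` preserves the
remaining coordinates acting there by `Rσ` (`rotMatrix_mulVec_remCoord`) and the constraint is covariant, `Q′R₁ = SQ`
(print's `Q̃(U^u)R(u) = u·Q̃(U)`), then `C′ Rσ = R₁ C`: both columns reproduce `Rσ v` on the remaining coordinates and solve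
`Q′`, hence coincide.  (`B12Eq213Body268.elim_intertwine` is the case `ι = σ ⊕ κ`, `emb = Sum.inl`, `R₁ = fromBlocks Rσ 0 0 Rκ`,
`C = Beta.ConstraintElimination.elim`; see `elim_mulVec_inl`, `eq_zero_of_constraint_of_inl`.)
[cite: Balaban1987RG1, (2.16) p.269 with (2.11) p.267; Balaban1985BackgroundPropagators, (3.157) p.428] -/
theorem intertwine_of_elimination {ι σ ρ ρ' : Type*} [Fintype ι] [Fintype σ] [Fintype ρ] (emb : σ → ι)
    {C C' : Matrix ι σ ℝ} {Q : Matrix ρ ι ℝ} {Q' : Matrix ρ' ι ℝ} {R₁ : Matrix ι ι ℝ} {Rσ : Matrix σ σ ℝ}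
    {S : Matrix ρ' ρ ℝ} (hC'Q : Q' * C' = 0) (huniq : ∀ w, Q' *ᵥ w = 0 → (∀ s, w (emb s) = 0) → w = 0)
    (hC'id : ∀ v s, (C' *ᵥ v) (emb s) = v s) (hCid : ∀ v s, (C *ᵥ v) (emb s) = v s) (hCQ : Q * C = 0)
    (hR : ∀ w s, (R₁ *ᵥ w) (emb s) = (Rσ *ᵥ fun t => w (emb t)) s) (hcov : Q' * R₁ = S * Q) :
    C' * Rσ = R₁ * C := by
  refine Matrix.ext_iff_mulVec.mpr fun v => ?_
  rw [← Matrix.mulVec_mulVec, ← Matrix.mulVec_mulVec]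
  refine sub_eq_zero.mp (huniq _ ?_ ?_)
  · have h1 : Q' *ᵥ (C' *ᵥ (Rσ *ᵥ v)) = 0 := by
      rw [Matrix.mulVec_mulVec (Rσ *ᵥ v) Q' C', hC'Q, Matrix.zero_mulVec]
    have h2 : Q' *ᵥ (R₁ *ᵥ (C *ᵥ v)) = 0 := by
      rw [Matrix.mulVec_mulVec (C *ᵥ v) Q' R₁, hcov, ← Matrix.mulVec_mulVec (C *ᵥ v) S Q, Matrix.mulVec_mulVec v Q C,
        hCQ, Matrix.zero_mulVec, Matrix.mulVec_zero]
    rw [Matrix.mulVec_sub, h1, h2, sub_zero]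
  · intro s
    have hv : (fun t => (C *ᵥ v) (emb t)) = v := funext fun t => hCid v t
    rw [Pi.sub_apply, hC'id, hR, hv, sub_self]

open Beta.ConstraintElimination in
omit [Fintype B] [DecidableEq B] in
/-- The tree's elimination map reproduces the remaining variables: `(elim Q_σ Q_κ v)(inl s) = v s` — hypothesis `hCid` of
`intertwine_of_elimination` at `emb = Sum.inl`. [cite: Balaban1985BackgroundPropagators, (3.157) p.428] -/
theorem elim_mulVec_inl {σ κ : Type*} [Fintype σ] [Fintype κ] [DecidableEq σ] [DecidableEq κ] (Qσ : Matrix κ σ ℝ)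
    (Qκ : Matrix κ κ ℝ) (v : σ → ℝ) (s : σ) : (elim Qσ Qκ *ᵥ v) (Sum.inl s) = v s := by
  simp [elim, Matrix.fromRows_mulVec]

open Beta.ConstraintElimination in
omit [Fintype B] [DecidableEq B] in
/-- With the `b₀(c)`-block `Q_κ` invertible the constraint determines the eliminated variables: `[Q_σ | Q_κ]w = 0` and
`w↾σ = 0` give `w = 0` — hypothesis `huniq` of `intertwine_of_elimination` at `emb = Sum.inl` (`elim_unique` at `v = 0`).
[cite: Balaban1985BackgroundPropagators, (3.157) p.428] -/
theorem eq_zero_of_constraint_of_inl {σ κ : Type*} [Fintype σ] [Fintype κ] [DecidableEq σ] [DecidableEq κ]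
    (Qσ : Matrix κ σ ℝ) (Qκ : Matrix κ κ ℝ) (hκ : IsUnit Qκ.det) (w : σ ⊕ κ → ℝ) (hw : Matrix.fromCols Qσ Qκ *ᵥ w = 0)
    (h0 : ∀ s, w (Sum.inl s) = 0) : w = 0 := by
  rw [elim_unique Qσ Qκ hκ 0 w h0 hw, Matrix.mulVec_zero]

end Elimination

section OnBondsElimination

variable {P : Params} {k : ℕ} [DecidableEq (PBond P k)] {𝔤 : Type} [NormedAddCommGroup 𝔤] [InnerProductSpace ℝ 𝔤]
  [FiniteDimensional ℝ 𝔤] [MeasurableSpace 𝔤] [BorelSpace 𝔤] {X : Type*}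

/-- **(2.16) ON PRINT'S CARRIER WITH PRINT'S ELIMINATION — the intertwining binder DISCHARGED.**  Retained bonds `{b // p b}`
(all but the `b₀(c)`); for every background `U` an elimination map `C(U)` for the constraint `Q̃(U)` in the sense of
`intertwine_of_elimination` (*«By the δ-function δ(Q̃B′) we eliminate the variables B′(b₀(c)) … B′ = CB, C is the operator
determined by the configuration V^{(k)}»*); a COVARIANT constraint `Q̃(τU)·R = S(U)·Q̃(U)` for print's `R = rotMatrix f`; a
precision on the remaining variables conjugated by `R_rem = rotMatrix (f↾retained)`; `𝐏^{(k)}`, `{…}` jointly invariant.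
THEN `𝐄^{(k+1)}(g, τU) = 𝐄^{(k+1)}(g, U)` for the datum `onBondsGaussPush C prec …` — no `χ_k`, measure, or intertwining
hypothesis. [cite: Balaban1987RG1, (2.16) p.269 with (2.11)–(2.13) pp.267–268] -/
theorem newTerm_onBondsGaussPush_eq_of_elimination {ρ : Type*} [Fintype ρ] (p : PBond P k → Prop) [DecidablePred p]
    (Cop : X → Matrix (PBond P k × Idx 𝔤) ({b // p b} × Idx 𝔤) ℝ) (Qc : X → Matrix ρ (PBond P k × Idx 𝔤) ℝ)
    (hCQ : ∀ U, Qc U * Cop U = 0) (hCid : ∀ U v s, (Cop U *ᵥ v) (remCoord p s) = v s)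
    (huniq : ∀ U w, Qc U *ᵥ w = 0 → (∀ s, w (remCoord p s) = 0) → w = 0)
    (prec : X → Matrix ({b // p b} × Idx 𝔤) ({b // p b} × Idx 𝔤) ℝ) (hpd : ∀ U, (prec U).PosDef) (ε₁ : ℝ)
    (Pk Qk : ℝ → X → VecField P k 𝔤 → ℝ) (g : ℝ) (τ : X → X) (f : PBond P k → (𝔤 ≃ₗᵢ[ℝ] 𝔤)) (S : X → Matrix ρ ρ ℝ)
    (hcov : ∀ U, Qc (τ U) * rotMatrix f = S U * Qc U)
    (hprec : ∀ U, prec (τ U) = rotMatrix (fun b : {b // p b} => f b) * prec U * (rotMatrix (fun b : {b // p b} => f b))ᵀ)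
    (hP : ∀ U B, Pk g (τ U) (rot f B) = Pk g U B) (hQ : ∀ U B, Qk g (τ U) (rot f B) = Qk g U B) (U : X) :
    (onBondsGaussPush Cop prec hpd ε₁ Pk Qk).newTerm g (τ U) = (onBondsGaussPush Cop prec hpd ε₁ Pk Qk).newTerm g U :=
  newTerm_onBondsGaussPush_eq_of_covariant Cop prec hpd ε₁ Pk Qk g τ f (rotMatrix fun b : {b // p b} => f b)
    (rotMatrix_transpose_mul_self _)
    (fun U => intertwine_of_elimination (remCoord p) (hCQ (τ U)) (huniq (τ U)) (hCid (τ U)) (hCid U) (hCQ U)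
      (fun w s => rotMatrix_mulVec_remCoord p f w s) (hcov U))
    hprec hP hQ U

/-- **THE FULLY REDUCED FORM OF (2.16) FOR PRINT'S GAUSSIAN `dμ_{C^{(k)}}`, `C^{(k)} = (C*Δ^{(k)}C)⁻¹`, ON PRINT'S CARRIER.**
Binders: print's elimination data for `C(U)` w.r.t. `Q̃(U)`; the covariance of `Q̃` (`Q̃(τU)·R = S(U)·Q̃(U)`); the OPERATOR
intertwining `Δ^{(k)}(τU) ∘ R = R ∘ Δ^{(k)}(U)` of the basic quadratic form of (2.11); the invariance of `𝐏^{(k)}`, `{…}`.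
Conclusions DERIVED: `R`, `R_rem` orthogonal, `C(τU)R_rem = R C(U)`, the precision `C(U)*M(U)C(U)` (`M = avgMatrix Δ^{(k)}`)
conjugated by `R_rem`, the measures covariant, `χ_k` invariant — and `𝐄^{(k+1)}(g, τU) = 𝐄^{(k+1)}(g, U)`.
[cite: Balaban1987RG1, (2.16) p.269 with (2.11)–(2.13) pp.267–268; Balaban1985BackgroundPropagators, (3.30) p.395] -/
theorem newTerm_onBondsGaussPush_eq_of_elimination_of_intertwine {ρ : Type*} [Fintype ρ] (p : PBond P k → Prop)
    [DecidablePred p] (Cop : X → Matrix (PBond P k × Idx 𝔤) ({b // p b} × Idx 𝔤) ℝ)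
    (Qc : X → Matrix ρ (PBond P k × Idx 𝔤) ℝ) (hCQ : ∀ U, Qc U * Cop U = 0)
    (hCid : ∀ U v s, (Cop U *ᵥ v) (remCoord p s) = v s)
    (huniq : ∀ U w, Qc U *ᵥ w = 0 → (∀ s, w (remCoord p s) = 0) → w = 0)
    (Δ : X → (VecField P k 𝔤 →ₗ[ℝ] VecField P k 𝔤)) (hpd : ∀ U, (prec212U Cop (fun U => avgMatrix (Δ U)) U).PosDef)
    (ε₁ : ℝ) (Pk Qk : ℝ → X → VecField P k 𝔤 → ℝ) (g : ℝ) (τ : X → X) (f : PBond P k → (𝔤 ≃ₗᵢ[ℝ] 𝔤))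
    (S : X → Matrix ρ ρ ℝ) (hcov : ∀ U, Qc (τ U) * rotMatrix f = S U * Qc U)
    (hΔ : ∀ U A, Δ (τ U) (rot f A) = rot f (Δ U A))
    (hP : ∀ U B, Pk g (τ U) (rot f B) = Pk g U B) (hQ : ∀ U B, Qk g (τ U) (rot f B) = Qk g U B) (U : X) :
    (onBondsGaussPush Cop (prec212U Cop fun U => avgMatrix (Δ U)) hpd ε₁ Pk Qk).newTerm g (τ U)
      = (onBondsGaussPush Cop (prec212U Cop fun U => avgMatrix (Δ U)) hpd ε₁ Pk Qk).newTerm g U :=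
  newTerm_onBondsGaussPush_eq_of_intertwine Cop Δ hpd ε₁ Pk Qk g τ f (rotMatrix fun b : {b // p b} => f b)
    (rotMatrix_transpose_mul_self _)
    (fun U => intertwine_of_elimination (remCoord p) (hCQ (τ U)) (huniq (τ U)) (hCid (τ U)) (hCid U) (hCQ U)
      (fun w s => rotMatrix_mulVec_remCoord p f w s) (hcov U))
    hΔ hP hQ U

/-- **(2.16) verbatim — `U_{k+1} ↦ U^u_{k+1}`, `B′ ↦ R(u)B′`, `(R(u)B′)(b) = R(u(b₋))B′(b)` — in the fully reduced form** for
print's Gaussian on print's carrier: with `R` a representation of `G` on `𝔤` by isometries, the elimination data of `C(U)`,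
the covariance of `Q̃` under `u`, the operator intertwining `Δ^{(k)}(U^u) ∘ R(u) = R(u) ∘ Δ^{(k)}(U)` and the invariance of
`𝐏^{(k)}`, `{…}` give the gauge invariance of (2.13). [cite: Balaban1987RG1, (2.16) p.269 with (2.11)–(2.13) pp.267–268] -/
theorem newTerm_onBondsGaussPush_gauge_invariant_of_elimination {G : Type*} {ρ : Type*} [Fintype ρ]
    (p : PBond P k → Prop) [DecidablePred p] (Cop : X → Matrix (PBond P k × Idx 𝔤) ({b // p b} × Idx 𝔤) ℝ)
    (Qc : X → Matrix ρ (PBond P k × Idx 𝔤) ℝ) (hCQ : ∀ U, Qc U * Cop U = 0)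
    (hCid : ∀ U v s, (Cop U *ᵥ v) (remCoord p s) = v s)
    (huniq : ∀ U w, Qc U *ᵥ w = 0 → (∀ s, w (remCoord p s) = 0) → w = 0)
    (Δ : X → (VecField P k 𝔤 →ₗ[ℝ] VecField P k 𝔤)) (hpd : ∀ U, (prec212U Cop (fun U => avgMatrix (Δ U)) U).PosDef)
    (ε₁ : ℝ) (Pk Qk : ℝ → X → VecField P k 𝔤 → ℝ) (g : ℝ) (τ : X → X) (R : G → (𝔤 ≃ₗᵢ[ℝ] 𝔤)) (u : GaugeTransf P k G)
    (S : X → Matrix ρ ρ ℝ) (hcov : ∀ U, Qc (τ U) * rotMatrix (fun b : PBond P k => R (u b.src)) = S U * Qc U)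
    (hΔ : ∀ U A, Δ (τ U) (B12ChiInvariance269.rotFluct (fun g => ⇑(R g)) u A)
      = B12ChiInvariance269.rotFluct (fun g => ⇑(R g)) u (Δ U A))
    (hP : ∀ U B, Pk g (τ U) (B12ChiInvariance269.rotFluct (fun g => ⇑(R g)) u B) = Pk g U B)
    (hQ : ∀ U B, Qk g (τ U) (B12ChiInvariance269.rotFluct (fun g => ⇑(R g)) u B) = Qk g U B) (U : X) :
    (onBondsGaussPush Cop (prec212U Cop fun U => avgMatrix (Δ U)) hpd ε₁ Pk Qk).newTerm g (τ U)
      = (onBondsGaussPush Cop (prec212U Cop fun U => avgMatrix (Δ U)) hpd ε₁ Pk Qk).newTerm g U :=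
  newTerm_onBondsGaussPush_eq_of_elimination_of_intertwine p Cop Qc hCQ hCid huniq Δ hpd ε₁ Pk Qk g τ
    (fun b => R (u b.src)) S hcov hΔ hP hQ U

end OnBondsElimination

/-! ## §5. *«C is the operator determined by the configuration V^{(k)}»* — THE ELIMINATION MAP CONSTRUCTED on the carrier
## from a linear constraint `LQ̃` and print's operator `h` («LQ̃h = I»), and (2.16) with every elimination datum DERIVED (v1.2) -/

section LocalConstraintFn

open B13PkLocalTerms

variable {β C : Type*} {F : Type*} [AddCommGroup F] [Module ℝ F]

/-- Print's operator `h` — *«The function hB is equal to 0 everywhere, except the set {b₀(c) : c ∈ T^{(k+1)}} … given by the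
equality (hB)(b₀(c)) = h(c)B(c), where h(c) is a linear operator on the Lie algebra 𝐠»* — is ADDITIVE in `B` (the tree's function
`B13PkLocalTerms.hOp b₀ h`, used BY NAME; no injectivity of `b₀` needed). [cite: Balaban1987RG1, p.267] -/
theorem hOp_add (b₀ : C → β) (h : C → (F →ₗ[ℝ] F)) (w w' : C → F) :
    hOp b₀ (fun c => ⇑(h c)) (w + w') = hOp b₀ (fun c => ⇑(h c)) w + hOp b₀ (fun c => ⇑(h c)) w' := by
  classical
  funext b
  simp only [hOp, Function.extend_def, Pi.add_apply]
  split_ifs with hb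
  · exact map_add _ _ _
  · simp

/-- … and HOMOGENEOUS: `h(r·B) = r·hB`. [cite: Balaban1987RG1, p.267] -/
theorem hOp_smul (b₀ : C → β) (h : C → (F →ₗ[ℝ] F)) (r : ℝ) (w : C → F) :
    hOp b₀ (fun c => ⇑(h c)) (r • w) = r • hOp b₀ (fun c => ⇑(h c)) w := by
  classical
  funext b
  simp only [hOp, Function.extend_def, Pi.smul_apply]
  split_ifs with hb
  · exact map_smul _ _ _
  · simp

/-- `h0 = 0`. [cite: Balaban1987RG1, p.267] -/
theorem hOp_zero (b₀ : C → β) (h : C → (F →ₗ[ℝ] F)) : hOp b₀ (fun c => ⇑(h c)) (0 : C → F) = 0 := by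
  classical
  funext b
  simp only [hOp, Function.extend_def, Pi.zero_apply]
  split_ifs with hb
  · exact map_zero _
  · rfl

/-- `h` on a coarse unit vector: `h(δ_c X) = δ_{b₀(c)} (h(c)X)` (distinguished bonds distinct, `b₀` injective —
`B12SmallFieldDomain259.b0_injective` on the cell's tori). [cite: Balaban1987RG1, p.267] -/
theorem hOp_single [DecidableEq β] [DecidableEq C] {b₀ : C → β} (hb : Function.Injective b₀) (h : C → (F →ₗ[ℝ] F)) (c : C)
    (X : F) : hOp b₀ (fun c => ⇑(h c)) (Pi.single c X) = (Pi.single (b₀ c) (h c X) : β → F) := by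
  funext b
  by_cases hbb : ∃ c', b₀ c' = b
  · obtain ⟨c', rfl⟩ := hbb
    rw [hOp_apply_b₀ hb]
    by_cases hc : c' = c
    · subst hc
      rw [Pi.single_eq_same, Pi.single_eq_same]
    · rw [Pi.single_eq_of_ne hc, Pi.single_eq_of_ne (fun e => hc (hb e)), map_zero]
  · rw [hOp_eq_zero_off_range _ _ hbb, Pi.single_eq_of_ne]
    rintro rfl
    exact hbb ⟨c, rfl⟩

variable (p : β → Prop) [DecidablePred p]

/-- **«the remaining variables»** `B` (the variables at the retained bonds `{b // p b}`, print: all bonds of `T^{(k)}` but the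
`b₀(c)`) EXTENDED BY ZERO to a field on all bonds — the field `B⁰` with `B⁰↾retained = B`, `B⁰(b₀ c) = 0`; a linear map.
[cite: Balaban1987RG1, (2.11)–(2.12) pp.267–268] -/
def extendLin : ({b // p b} → F) →ₗ[ℝ] (β → F) where
  toFun v b := if hb : p b then v ⟨b, hb⟩ else 0
  map_add' v w := by
    funext b
    simp only [Pi.add_apply]
    split_ifs <;> simp
  map_smul' r v := by
    funext b
    simp only [Pi.smul_apply, RingHom.id_apply]
    split_ifs <;> simp

/-- `B⁰` at a retained bond is the remaining variable there. [cite: Balaban1987RG1, (2.11)–(2.12) pp.267–268] -/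
theorem extendLin_apply_of_pos (v : {b // p b} → F) {b : β} (hb : p b) : extendLin p v b = v ⟨b, hb⟩ := dif_pos hb

/-- `B⁰` vanishes at the non-retained bonds. [cite: Balaban1987RG1, (2.11)–(2.12) pp.267–268] -/
theorem extendLin_apply_of_neg (v : {b // p b} → F) {b : β} (hb : ¬ p b) : extendLin p v b = 0 := dif_neg hb

/-- `B⁰↾retained = B`. [cite: Balaban1987RG1, (2.11)–(2.12) pp.267–268] -/
@[simp] theorem extendLin_apply_val (v : {b // p b} → F) (s : {b // p b}) : extendLin p v s = v s := by
  rw [extendLin_apply_of_pos p v s.2]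

/-- **PRINT'S `C` — *«Denoting the remaining variables by B we have B′ = CB, C is the operator determined by the configuration
V^{(k)}»* — CONSTRUCTED**: `C B := B⁰ − h(LQ̃ B⁰)`, with `LQ̃ = Λ` the (linear) constraint whose δ-function `δ(Q̃B′)` eliminates the
variables `B′(b₀(c))` and `h` print's operator of p. 267 (`(hw)(b₀ c) = h(c)w(c)`, zero elsewhere).  It is the linear instance of
print's own device `B′ = B − hD̃(B)` (p. 267): subtracting `h` of the constraint's value kills the constraint when `LQ̃h = I`
(`constraint_elimLin`), and touches only the distinguished bonds (`elimLin_apply_val`). [cite: Balaban1987RG1, (2.11) p.267 with p.267] -/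
def elimLin (b₀ : C → β) (Λ : (β → F) →ₗ[ℝ] (C → F)) (h : C → (F →ₗ[ℝ] F)) : ({b // p b} → F) →ₗ[ℝ] (β → F) where
  toFun v := extendLin p v - hOp b₀ (fun c => ⇑(h c)) (Λ (extendLin p v))
  map_add' v w := by
    rw [map_add, map_add, hOp_add]
    abel
  map_smul' r v := by
    rw [map_smul, map_smul, hOp_smul, RingHom.id_apply, smul_sub]

/-- Unfolding of `elimLin`: `C B = B⁰ − h(Λ B⁰)`. [cite: Balaban1987RG1, (2.11) p.267 with p.267] -/
theorem elimLin_apply (b₀ : C → β) (Λ : (β → F) →ₗ[ℝ] (C → F)) (h : C → (F →ₗ[ℝ] F)) (v : {b // p b} → F) :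
    elimLin p b₀ Λ h v = extendLin p v - hOp b₀ (fun c => ⇑(h c)) (Λ (extendLin p v)) := rfl

/-- **`C` REPRODUCES THE REMAINING VARIABLES**: `(C B)↾retained = B` — provided no distinguished bond is retained (print: the
remaining variables are exactly those not of the form `B′(b₀(c))`).  This is the hypothesis `hCid` of `intertwine_of_elimination`
∕ `newTerm_onBondsGaussPush_eq_of_elimination`. [cite: Balaban1987RG1, (2.11) p.267] -/
theorem elimLin_apply_val {b₀ : C → β} (hpb : ∀ c, ¬ p (b₀ c)) (Λ : (β → F) →ₗ[ℝ] (C → F)) (h : C → (F →ₗ[ℝ] F))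
    (v : {b // p b} → F) (s : {b // p b}) : elimLin p b₀ Λ h v s = v s := by
  rw [elimLin_apply, Pi.sub_apply, extendLin_apply_val, hOp_eq_zero_off_range, sub_zero]
  rintro ⟨c, hc⟩
  exact hpb c (hc ▸ s.2)

/-- **`C` SOLVES THE CONSTRAINT**: print's identity *«the operator h satisfies the identity LQ̃h = I on T^{(k+1)}»* gives
`LQ̃(C B) = LQ̃B⁰ − LQ̃h(LQ̃B⁰) = 0` for every `B` — the hypothesis `hCQ` of `intertwine_of_elimination` ∕
`newTerm_onBondsGaussPush_eq_of_elimination`. [cite: Balaban1987RG1, p.267, (2.11) p.267] -/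
theorem constraint_elimLin (b₀ : C → β) {Λ : (β → F) →ₗ[ℝ] (C → F)} {h : C → (F →ₗ[ℝ] F)}
    (hI : ∀ w, Λ (hOp b₀ (fun c => ⇑(h c)) w) = w) (v : {b // p b} → F) : Λ (elimLin p b₀ Λ h v) = 0 := by
  rw [elimLin_apply, map_sub, hI, sub_self]

/-- … as an identity of linear maps: `LQ̃ ∘ C = 0`. [cite: Balaban1987RG1, p.267, (2.11) p.267] -/
theorem comp_elimLin (b₀ : C → β) {Λ : (β → F) →ₗ[ℝ] (C → F)} {h : C → (F →ₗ[ℝ] F)}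
    (hI : ∀ w, Λ (hOp b₀ (fun c => ⇑(h c)) w) = w) : Λ ∘ₗ elimLin p b₀ Λ h = 0 :=
  LinearMap.ext fun v => constraint_elimLin p b₀ hI v

/-- … and that the COUPLING IS DIAGONAL on the range of `h`: the variable `h(c)X` at `b₀(c)` does not enter `(LQ̃B′)(c′)`, `c′ ≠ c` —
on the cell's tori this is the separation `B12SmallFieldDomain259.eq_of_b0_mem_nbhd` with the locality of `LQ̃`. [cite: Balaban1987RG1, p.267] -/
theorem apply_single_h_of_ne [DecidableEq β] [DecidableEq C] {b₀ : C → β} (hb : Function.Injective b₀)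
    {Λ : (β → F) →ₗ[ℝ] (C → F)} {h : C → (F →ₗ[ℝ] F)} (hI : ∀ w, Λ (hOp b₀ (fun c => ⇑(h c)) w) = w) {c c' : C}
    (hc : c' ≠ c) (X : F) : Λ (Pi.single (b₀ c) (h c X)) c' = 0 := by
  have h1 := congrArg (fun w : C → F => w c') (hI (Pi.single c X))
  simp only [Pi.single_eq_of_ne hc, hOp_single hb h] at h1
  exact h1

/-- `LQ̃h = I` makes every `h(c)` INJECTIVE … [cite: Balaban1987RG1, p.267] -/
theorem injective_h [DecidableEq β] [DecidableEq C] {b₀ : C → β} (hb : Function.Injective b₀)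
    {Λ : (β → F) →ₗ[ℝ] (C → F)} {h : C → (F →ₗ[ℝ] F)} (hI : ∀ w, Λ (hOp b₀ (fun c => ⇑(h c)) w) = w) (c : C) :
    Function.Injective (h c) := by
  intro X Y hXY
  have h1 := congrArg (fun w : C → F => w c) (hI (Pi.single c X))
  have h2 := congrArg (fun w : C → F => w c) (hI (Pi.single c Y))
  simp only [Pi.single_eq_same, hOp_single hb h] at h1 h2
  rw [← h1, ← h2, hXY]

/-- … hence BIJECTIVE, `𝐠` being finite-dimensional (print: `h(c)` IS the inverse of the coefficient). [cite: Balaban1987RG1, p.267] -/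
theorem bijective_h [DecidableEq β] [DecidableEq C] [FiniteDimensional ℝ F] {b₀ : C → β} (hb : Function.Injective b₀)
    {Λ : (β → F) →ₗ[ℝ] (C → F)} {h : C → (F →ₗ[ℝ] F)} (hI : ∀ w, Λ (hOp b₀ (fun c => ⇑(h c)) w) = w) (c : C) :
    Function.Bijective (h c) :=
  ⟨injective_h hb hI c, LinearMap.injective_iff_surjective.mp (injective_h hb hI c)⟩

/-- A field vanishing at the retained bonds is `h` of a coarse field (every non-retained bond is a `b₀(c)`, and `h(c)` is onto).
[cite: Balaban1987RG1, p.267, (2.11) p.267] -/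
theorem exists_eq_hOp_of_apply_val_eq_zero [DecidableEq β] [DecidableEq C] [FiniteDimensional ℝ F] {b₀ : C → β}
    (hb : Function.Injective b₀) (hp : ∀ b, ¬ p b → ∃ c, b₀ c = b) {Λ : (β → F) →ₗ[ℝ] (C → F)} {h : C → (F →ₗ[ℝ] F)}
    (hI : ∀ w, Λ (hOp b₀ (fun c => ⇑(h c)) w) = w) {w : β → F} (h0 : ∀ s : {b // p b}, w s = 0) :
    ∃ y : C → F, w = hOp b₀ (fun c => ⇑(h c)) y := by
  choose y hy using fun c => (bijective_h hb hI c).2 (w (b₀ c))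
  refine ⟨y, funext fun b => ?_⟩
  by_cases hbb : ∃ c, b₀ c = b
  · obtain ⟨c, rfl⟩ := hbb
    rw [hOp_apply_b₀ hb, hy]
  · rw [hOp_eq_zero_off_range _ _ hbb]
    by_cases hpb : p b
    · exact h0 ⟨b, hpb⟩
    · exact absurd (hp b hpb) hbb

/-- **THE CONSTRAINT DETERMINES THE ELIMINATED VARIABLES** (print: `δ(Q̃B′)` eliminates exactly the `B′(b₀(c))`): `LQ̃w = 0` and
`w↾retained = 0` force `w = 0` — the hypothesis `huniq` of `intertwine_of_elimination` ∕ `newTerm_onBondsGaussPush_eq_of_elimination`;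
from `LQ̃h = I` alone (write `w = hy`, then `y = LQ̃hy = LQ̃w = 0`). [cite: Balaban1987RG1, p.267, (2.11) p.267] -/
theorem eq_zero_of_constraint_of_apply_val [DecidableEq β] [DecidableEq C] [FiniteDimensional ℝ F] {b₀ : C → β}
    (hb : Function.Injective b₀) (hp : ∀ b, ¬ p b → ∃ c, b₀ c = b) {Λ : (β → F) →ₗ[ℝ] (C → F)} {h : C → (F →ₗ[ℝ] F)}
    (hI : ∀ w, Λ (hOp b₀ (fun c => ⇑(h c)) w) = w) {w : β → F} (hw : Λ w = 0) (h0 : ∀ s : {b // p b}, w s = 0) :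
    w = 0 := by
  obtain ⟨y, rfl⟩ := exists_eq_hOp_of_apply_val_eq_zero p hb hp hI h0
  rw [hI] at hw
  rw [hw]
  exact hOp_zero b₀ h

/-- **UNIQUENESS OF `C`** (print: «C is THE operator determined by the configuration»): any linear `C′` reproducing the remaining
variables and solving the constraint IS `elimLin`. [cite: Balaban1987RG1, (2.11) p.267] -/
theorem eq_elimLin_of_elimination [DecidableEq β] [DecidableEq C] [FiniteDimensional ℝ F] {b₀ : C → β}
    (hb : Function.Injective b₀) (hp : ∀ b, ¬ p b → ∃ c, b₀ c = b) (hpb : ∀ c, ¬ p (b₀ c)) {Λ : (β → F) →ₗ[ℝ] (C → F)}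
    {h : C → (F →ₗ[ℝ] F)} (hI : ∀ w, Λ (hOp b₀ (fun c => ⇑(h c)) w) = w) {C' : ({b // p b} → F) →ₗ[ℝ] (β → F)}
    (hC'Q : ∀ v, Λ (C' v) = 0) (hC'id : ∀ v (s : {b // p b}), C' v s = v s) : C' = elimLin p b₀ Λ h := by
  refine LinearMap.ext fun v => sub_eq_zero.mp (eq_zero_of_constraint_of_apply_val p hb hp hI ?_ fun s => ?_)
  · rw [map_sub, hC'Q, constraint_elimLin p b₀ hI, sub_zero]
  · rw [Pi.sub_apply, hC'id, elimLin_apply_val p hpb, sub_self]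

/-- `C` is injective (it reproduces the remaining variables). [cite: Balaban1987RG1, (2.11) p.267] -/
theorem injective_elimLin {b₀ : C → β} (hpb : ∀ c, ¬ p (b₀ c)) (Λ : (β → F) →ₗ[ℝ] (C → F)) (h : C → (F →ₗ[ℝ] F)) :
    Function.Injective (elimLin p b₀ Λ h) := fun v w hvw =>
  funext fun s => by rw [← elimLin_apply_val p hpb Λ h v s, ← elimLin_apply_val p hpb Λ h w s, hvw]

end LocalConstraintFn

section CoeffLink

open B13PkLocalTerms B12B0Restriction267

variable {β C : Type*} [DecidableEq β] [DecidableEq C] {F : Type*} [NormedAddCommGroup F] [NormedSpace ℝ F]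

/-- **«h(c) is … equal to an inverse of a coefficient at the variable B′(b₀(c)) in (Q̃B′)(c)»**: the identity `LQ̃h = I` says
exactly that `h(c)` is a right inverse of r09's corridor coefficient `B12B0Restriction267.coeff b₀ LQ̃ c` (*«a coefficient at the
variable B′(b₀(c))»*). [cite: Balaban1987RG1, p.267] -/
theorem coeff_h_apply {b₀ : C → β} (hb : Function.Injective b₀) {Λ : (β → F) →ₗ[ℝ] (C → F)} {h : C → (F →ₗ[ℝ] F)}
    (hI : ∀ w, Λ (hOp b₀ (fun c => ⇑(h c)) w) = w) (c : C) (X : F) : coeff b₀ Λ c (h c X) = X := by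
  have h1 := congrArg (fun w : C → F => w c) (hI (Pi.single c X))
  simp only [Pi.single_eq_same, hOp_single hb h] at h1
  rw [coeff_apply, h1]

end CoeffLink

section LocalConstraintChart

open B13PkLocalTerms

variable {β C : Type} [Fintype β] [DecidableEq β] [Fintype C] [DecidableEq C] {F : Type*} [NormedAddCommGroup F]
  [InnerProductSpace ℝ F] [FiniteDimensional ℝ F]

omit [Fintype C] [DecidableEq C] in
/-- The chart matrix of a composite is the product of the chart matrices (p34's `avgMatrix` is functorial). [cite: Balaban1982Higgs1, (2.11) p.609] -/
theorem avgMatrix_comp {W : Type} [Fintype W] [DecidableEq W] (q : (β → F) →ₗ[ℝ] (C → F)) (q' : (W → F) →ₗ[ℝ] (β → F)) :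
    avgMatrix (q ∘ₗ q') = avgMatrix q * avgMatrix q' := by
  refine Matrix.ext_iff_mulVec.mpr fun z => ?_
  obtain ⟨φ, rfl⟩ := (fieldCoord F W).surjective z
  rw [← Matrix.mulVec_mulVec, avgMatrix_mulVec, avgMatrix_mulVec, avgMatrix_mulVec]
  rfl

omit [Fintype C] [DecidableEq C] in
/-- The chart matrix of the zero map is zero. [cite: Balaban1982Higgs1, (2.11) p.609] -/
theorem avgMatrix_zero : avgMatrix (0 : (β → F) →ₗ[ℝ] (C → F)) = 0 := by
  refine Matrix.ext_iff_mulVec.mpr fun z => ?_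
  obtain ⟨φ, rfl⟩ := (fieldCoord F β).surjective z
  rw [avgMatrix_mulVec, Matrix.zero_mulVec, LinearMap.zero_apply, map_zero]

/-- **RECTANGULAR INTERTWINING IN THE CHART** (the shape of [13] (3.32) *«(Q′_j(U^u)R(u)λ)(y) = R(u(y))(Q′_j(U)λ)(y)»*): if a family
of linear maps from `T^{(k)}`-bond fields to `T^{(k+1)}`-bond fields satisfies `Λ(τU) ∘ R = R_C ∘ Λ(U)` for bondwise isometries `R`
(fine) and `R_C` (coarse), then `avgMatrix (Λ(τU)) · rotMatrix f = rotMatrix f_C · avgMatrix (Λ U)` — the hypothesis `hcov` of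
`intertwine_of_elimination` ∕ `newTerm_onBondsGaussPush_eq_of_elimination` at `S U = rotMatrix f_C`.
[cite: Balaban1987RG1, (2.16) p.269; Balaban1985BackgroundPropagators, (3.32) p.395] -/
theorem avgMatrix_mul_rotMatrix_of_intertwine {X : Type*} {τ : X → X} (f : β → (F ≃ₗᵢ[ℝ] F)) (fC : C → (F ≃ₗᵢ[ℝ] F))
    (Λ : X → ((β → F) →ₗ[ℝ] (C → F))) (hΛ : ∀ U A, Λ (τ U) (rotLin f A) = rotLin fC (Λ U A)) (U : X) :
    avgMatrix (Λ (τ U)) * rotMatrix f = rotMatrix fC * avgMatrix (Λ U) := by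
  refine Matrix.ext_iff_mulVec.mpr fun z => ?_
  obtain ⟨A, rfl⟩ := (fieldCoord F β).surjective z
  rw [← Matrix.mulVec_mulVec, ← Matrix.mulVec_mulVec, rotMatrix_mulVec_fieldCoord, avgMatrix_mulVec, avgMatrix_mulVec,
    rotMatrix_mulVec_fieldCoord, hΛ]

/-- The same with the intertwining stated for r07's measurable equivalence `rot f` on the fine-bond fields. [cite: Balaban1987RG1, (2.16) p.269] -/
theorem avgMatrix_mul_rotMatrix_of_intertwine_rot [MeasurableSpace F] [BorelSpace F] {X : Type*} {τ : X → X}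
    (f : β → (F ≃ₗᵢ[ℝ] F)) (fC : C → (F ≃ₗᵢ[ℝ] F)) (Λ : X → ((β → F) →ₗ[ℝ] (C → F)))
    (hΛ : ∀ U A, Λ (τ U) (rot f A) = rotLin fC (Λ U A)) (U : X) :
    avgMatrix (Λ (τ U)) * rotMatrix f = rotMatrix fC * avgMatrix (Λ U) :=
  avgMatrix_mul_rotMatrix_of_intertwine f fC Λ hΛ U

variable (p : β → Prop) [DecidablePred p]

omit [Fintype β] [DecidableEq β] [Fintype C] [DecidableEq C] [DecidablePred p] in
/-- All coordinates of a field at the retained bonds vanish iff the field vanishes there. [cite: Balaban1982Higgs1, p.605] -/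
theorem apply_val_eq_zero_of_fieldCoord (A : β → F) (h0 : ∀ s : {b // p b} × Idx F, fieldCoord F β A (remCoord p s) = 0)
    (s : {b // p b}) : A s = 0 := by
  have h1 : siteCoord F (A s) = 0 := funext fun i => h0 (s, i)
  exact (siteCoord F).map_eq_zero_iff.mp h1

omit [Fintype C] [DecidableEq C] in
/-- **`hCid` IN THE CHART**: the coordinate matrix `avgMatrix C` of the constructed elimination map reproduces the remaining
coordinates, `(avgMatrix C · v)(b, i) = v(b, i)` at retained `b`. [cite: Balaban1987RG1, (2.11) p.267] -/
theorem avgMatrix_elimLin_mulVec_remCoord {b₀ : C → β} (hpb : ∀ c, ¬ p (b₀ c)) (Λ : (β → F) →ₗ[ℝ] (C → F))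
    (h : C → (F →ₗ[ℝ] F)) (v : {b // p b} × Idx F → ℝ) (s : {b // p b} × Idx F) :
    (avgMatrix (elimLin p b₀ Λ h) *ᵥ v) (remCoord p s) = v s := by
  obtain ⟨w, rfl⟩ := (fieldCoord F {b // p b}).surjective v
  rw [avgMatrix_mulVec, remCoord_apply, fieldCoord_apply, fieldCoord_apply, elimLin_apply_val p hpb]

omit [Fintype C] [DecidableEq C] in
/-- **`hCQ` IN THE CHART**: `avgMatrix LQ̃ · avgMatrix C = 0`. [cite: Balaban1987RG1, p.267, (2.11) p.267] -/
theorem avgMatrix_mul_avgMatrix_elimLin (b₀ : C → β) {Λ : (β → F) →ₗ[ℝ] (C → F)} {h : C → (F →ₗ[ℝ] F)}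
    (hI : ∀ w, Λ (hOp b₀ (fun c => ⇑(h c)) w) = w) : avgMatrix Λ * avgMatrix (elimLin p b₀ Λ h) = 0 := by
  rw [← avgMatrix_comp, comp_elimLin p b₀ hI, avgMatrix_zero]

omit [Fintype C] in
/-- **`huniq` IN THE CHART**: `avgMatrix LQ̃ · w = 0` and `w` vanishing at the retained coordinates force `w = 0`. [cite: Balaban1987RG1, p.267, (2.11) p.267] -/
theorem eq_zero_of_avgMatrix_mulVec_of_remCoord {b₀ : C → β} (hb : Function.Injective b₀) (hp : ∀ b, ¬ p b → ∃ c, b₀ c = b)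
    {Λ : (β → F) →ₗ[ℝ] (C → F)} {h : C → (F →ₗ[ℝ] F)} (hI : ∀ w, Λ (hOp b₀ (fun c => ⇑(h c)) w) = w)
    (w : β × Idx F → ℝ) (hw : avgMatrix Λ *ᵥ w = 0) (h0 : ∀ s, w (remCoord p s) = 0) : w = 0 := by
  obtain ⟨A, rfl⟩ := (fieldCoord F β).surjective w
  rw [avgMatrix_mulVec, LinearEquiv.map_eq_zero_iff] at hw
  rw [eq_zero_of_constraint_of_apply_val p hb hp hI hw (apply_val_eq_zero_of_fieldCoord p A h0), map_zero]

omit [Fintype C] [DecidableEq C] in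
/-- The coordinate matrix of `C` is injective. [cite: Balaban1987RG1, (2.11) p.267] -/
theorem injective_avgMatrix_elimLin_mulVec {b₀ : C → β} (hpb : ∀ c, ¬ p (b₀ c)) (Λ : (β → F) →ₗ[ℝ] (C → F))
    (h : C → (F →ₗ[ℝ] F)) : Function.Injective (avgMatrix (elimLin p b₀ Λ h)).mulVec := by
  intro v w hvw
  funext s
  rw [← avgMatrix_elimLin_mulVec_remCoord p hpb Λ h v s, ← avgMatrix_elimLin_mulVec_remCoord p hpb Λ h w s]
  exact congrFun hvw _

/-- **THE INTERTWINING `C(τU)·R_rem = R·C(U)` FOR THE CONSTRUCTED `C` — no elimination hypothesis left**: from `LQ̃h = I` at `U`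
and `τU`, the bookkeeping of the retained bonds, and the covariance of the constraint in the chart. [cite: Balaban1987RG1, (2.16) p.269 with (2.11) p.267] -/
theorem elimLin_intertwine {X : Type*} {τ : X → X} {b₀ : C → β} (hb : Function.Injective b₀)
    (hp : ∀ b, ¬ p b → ∃ c, b₀ c = b) (hpb : ∀ c, ¬ p (b₀ c)) (Λ : X → ((β → F) →ₗ[ℝ] (C → F)))
    (h : X → C → (F →ₗ[ℝ] F)) (hI : ∀ U w, Λ U (hOp b₀ (fun c => ⇑(h U c)) w) = w) (f : β → (F ≃ₗᵢ[ℝ] F))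
    {S : X → Matrix (C × Idx F) (C × Idx F) ℝ} (hcov : ∀ U, avgMatrix (Λ (τ U)) * rotMatrix f = S U * avgMatrix (Λ U))
    (U : X) :
    avgMatrix (elimLin p b₀ (Λ (τ U)) (h (τ U))) * rotMatrix (fun b : {b // p b} => f b)
      = rotMatrix f * avgMatrix (elimLin p b₀ (Λ U) (h U)) :=
  intertwine_of_elimination (remCoord p) (avgMatrix_mul_avgMatrix_elimLin p b₀ (hI (τ U)))
    (eq_zero_of_avgMatrix_mulVec_of_remCoord p hb hp (hI (τ U))) (avgMatrix_elimLin_mulVec_remCoord p hpb _ _)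
    (avgMatrix_elimLin_mulVec_remCoord p hpb _ _) (avgMatrix_mul_avgMatrix_elimLin p b₀ (hI U))
    (fun w s => rotMatrix_mulVec_remCoord p f w s) (hcov U)

end LocalConstraintChart

section OnBondsLocalConstraint

open B13PkLocalTerms

variable {P : Params} {k : ℕ} [DecidableEq (PBond P k)] [DecidableEq (PBond P (k+1))] {𝔤 : Type} [NormedAddCommGroup 𝔤]
  [InnerProductSpace ℝ 𝔤] [FiniteDimensional ℝ 𝔤] [MeasurableSpace 𝔤] [BorelSpace 𝔤] {X : Type*}

omit [DecidableEq (PBond P (k+1))] in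
/-- **THE DATUM OF (2.13) WITH PRINT'S GAUSSIAN AND PRINT'S `C`**: measures `dμ_U` = the Gaussian with precision `prec U` in the
remaining variables read on the fields through `B′ = C(U)B`, `C(U) = elimLin p b₀ (LQ̃ U) (h U)` CONSTRUCTED from the constraint and
print's `h`; `χ_k := chiFluct ε₁`, `𝐏^{(k)}`, `{…}`. [cite: Balaban1987RG1, (2.11)–(2.13) pp.267–268] -/
def onBondsGaussElim (p : PBond P k → Prop) [DecidablePred p] (b₀ : PBond P (k+1) → PBond P k)
    (Λ : X → (VecField P k 𝔤 →ₗ[ℝ] VecField P (k+1) 𝔤)) (h : X → PBond P (k+1) → (𝔤 →ₗ[ℝ] 𝔤))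
    (prec : X → Matrix ({b // p b} × Idx 𝔤) ({b // p b} × Idx 𝔤) ℝ) (hpd : ∀ U, (prec U).PosDef) (ε₁ : ℝ)
    (Pk Qk : ℝ → X → VecField P k 𝔤 → ℝ) : FluctData X :=
  onBondsGaussPush (fun U => avgMatrix (elimLin p b₀ (Λ U) (h U))) prec hpd ε₁ Pk Qk

omit [DecidableEq (PBond P (k+1))] in
/-- `onBondsGaussElim` is `onBondsGaussPush` at the constructed `C` (definitional). [cite: Balaban1987RG1, (2.11)–(2.13) pp.267–268] -/
theorem onBondsGaussElim_eq (p : PBond P k → Prop) [DecidablePred p] (b₀ : PBond P (k+1) → PBond P k)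
    (Λ : X → (VecField P k 𝔤 →ₗ[ℝ] VecField P (k+1) 𝔤)) (h : X → PBond P (k+1) → (𝔤 →ₗ[ℝ] 𝔤))
    (prec : X → Matrix ({b // p b} × Idx 𝔤) ({b // p b} × Idx 𝔤) ℝ) (hpd : ∀ U, (prec U).PosDef) (ε₁ : ℝ)
    (Pk Qk : ℝ → X → VecField P k 𝔤 → ℝ) :
    onBondsGaussElim p b₀ Λ h prec hpd ε₁ Pk Qk
      = onBondsGaussPush (fun U => avgMatrix (elimLin p b₀ (Λ U) (h U))) prec hpd ε₁ Pk Qk := rfl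

/-- **(2.16) ON PRINT'S CARRIER, PRINT'S GAUSSIAN, PRINT'S `C` — EVERY ELIMINATION DATUM DERIVED.**  Binders: the retained-bond
bookkeeping (`b₀` injective — `B12SmallFieldDomain259.b0_injective` —, the retained bonds = the complement of its range), the linear
constraint family `LQ̃(U)` with print's operators `h(U)` (*«LQ̃h = I»*), the covariance of the constraint `LQ̃(τU) ∘ R(u) = R_C(u) ∘ LQ̃(U)`
([13] (3.32)), a precision on the remaining variables conjugated by `R_rem`, and the invariance of `𝐏^{(k)}`, `{…}`.  THEN
`𝐄^{(k+1)}(g, τU) = 𝐄^{(k+1)}(g, U)`.  Compared with `newTerm_onBondsGaussPush_eq_of_elimination` (v1.1) the three elimination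
hypotheses `hCQ`, `hCid`, `huniq` are theorems about the constructed `C`, and `hcov` is the chart image of the function-level covariance.
[cite: Balaban1987RG1, (2.16) p.269 with p.267 and (2.11)–(2.13) pp.267–268; Balaban1985BackgroundPropagators, (3.32) p.395] -/
theorem newTerm_onBondsGaussElim_eq_of_covariant (p : PBond P k → Prop) [DecidablePred p] {b₀ : PBond P (k+1) → PBond P k}
    (hb : Function.Injective b₀) (hp : ∀ b, ¬ p b → ∃ c, b₀ c = b) (hpb : ∀ c, ¬ p (b₀ c))
    (Λ : X → (VecField P k 𝔤 →ₗ[ℝ] VecField P (k+1) 𝔤)) (h : X → PBond P (k+1) → (𝔤 →ₗ[ℝ] 𝔤))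
    (hI : ∀ U w, Λ U (hOp b₀ (fun c => ⇑(h U c)) w) = w)
    (prec : X → Matrix ({b // p b} × Idx 𝔤) ({b // p b} × Idx 𝔤) ℝ) (hpd : ∀ U, (prec U).PosDef) (ε₁ : ℝ)
    (Pk Qk : ℝ → X → VecField P k 𝔤 → ℝ) (g : ℝ) (τ : X → X) (f : PBond P k → (𝔤 ≃ₗᵢ[ℝ] 𝔤))
    (fC : PBond P (k+1) → (𝔤 ≃ₗᵢ[ℝ] 𝔤)) (hΛ : ∀ U A, Λ (τ U) (rot f A) = rotLin fC (Λ U A))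
    (hprec : ∀ U, prec (τ U) = rotMatrix (fun b : {b // p b} => f b) * prec U * (rotMatrix (fun b : {b // p b} => f b))ᵀ)
    (hP : ∀ U B, Pk g (τ U) (rot f B) = Pk g U B) (hQ : ∀ U B, Qk g (τ U) (rot f B) = Qk g U B) (U : X) :
    (onBondsGaussElim p b₀ Λ h prec hpd ε₁ Pk Qk).newTerm g (τ U) = (onBondsGaussElim p b₀ Λ h prec hpd ε₁ Pk Qk).newTerm g U :=
  newTerm_onBondsGaussPush_eq_of_covariant _ prec hpd ε₁ Pk Qk g τ f (rotMatrix fun b : {b // p b} => f b)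
    (rotMatrix_transpose_mul_self _)
    (elimLin_intertwine p hb hp hpb Λ h hI f (fun U => avgMatrix_mul_rotMatrix_of_intertwine_rot f fC Λ hΛ U)) hprec hP hQ U

/-- **THE FULLY REDUCED (2.16) WITH PRINT'S `C` AND PRINT'S PRECISION `C*Δ^{(k)}C`.**  Binders: the retained-bond bookkeeping, the
constraint family `LQ̃(U)` with `h(U)` (*«LQ̃h = I»*) and its covariance, a family of operators `Δ^{(k)}(U)` on the fields making
`C(U)*M(U)C(U)` (`M = avgMatrix Δ^{(k)}`) positive definite and INTERTWINING the transformations (`Δ^{(k)}(τU) ∘ R = R ∘ Δ^{(k)}(U)`,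
[13] (3.30)), and the invariance of `𝐏^{(k)}`, `{…}`.  Conclusions DERIVED: `C(U)` with `LQ̃C = 0`, `C↾retained = id`, uniqueness;
`R`, `R_rem`, `R_C` orthogonal; `C(τU)R_rem = RC(U)`; the precision and the measures covariant; `χ_k` invariant; and
`𝐄^{(k+1)}(g, τU) = 𝐄^{(k+1)}(g, U)`. [cite: Balaban1987RG1, (2.16) p.269 with p.267 and (2.11)–(2.13) pp.267–268; Balaban1985BackgroundPropagators, (3.30)/(3.32) p.395] -/
theorem newTerm_onBondsGaussElim_eq_of_intertwine (p : PBond P k → Prop) [DecidablePred p] {b₀ : PBond P (k+1) → PBond P k}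
    (hb : Function.Injective b₀) (hp : ∀ b, ¬ p b → ∃ c, b₀ c = b) (hpb : ∀ c, ¬ p (b₀ c))
    (Λ : X → (VecField P k 𝔤 →ₗ[ℝ] VecField P (k+1) 𝔤)) (h : X → PBond P (k+1) → (𝔤 →ₗ[ℝ] 𝔤))
    (hI : ∀ U w, Λ U (hOp b₀ (fun c => ⇑(h U c)) w) = w) (Δ : X → (VecField P k 𝔤 →ₗ[ℝ] VecField P k 𝔤))
    (hpd : ∀ U, (prec212U (fun U => avgMatrix (elimLin p b₀ (Λ U) (h U))) (fun U => avgMatrix (Δ U)) U).PosDef) (ε₁ : ℝ)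
    (Pk Qk : ℝ → X → VecField P k 𝔤 → ℝ) (g : ℝ) (τ : X → X) (f : PBond P k → (𝔤 ≃ₗᵢ[ℝ] 𝔤))
    (fC : PBond P (k+1) → (𝔤 ≃ₗᵢ[ℝ] 𝔤)) (hΛ : ∀ U A, Λ (τ U) (rot f A) = rotLin fC (Λ U A))
    (hΔ : ∀ U A, Δ (τ U) (rot f A) = rot f (Δ U A))
    (hP : ∀ U B, Pk g (τ U) (rot f B) = Pk g U B) (hQ : ∀ U B, Qk g (τ U) (rot f B) = Qk g U B) (U : X) :
    (onBondsGaussElim p b₀ Λ h (prec212U (fun U => avgMatrix (elimLin p b₀ (Λ U) (h U))) fun U => avgMatrix (Δ U)) hpd ε₁ Pk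
        Qk).newTerm g (τ U)
      = (onBondsGaussElim p b₀ Λ h (prec212U (fun U => avgMatrix (elimLin p b₀ (Λ U) (h U))) fun U => avgMatrix (Δ U)) hpd ε₁
        Pk Qk).newTerm g U :=
  newTerm_onBondsGaussPush_eq_of_intertwine _ Δ hpd ε₁ Pk Qk g τ f (rotMatrix fun b : {b // p b} => f b)
    (rotMatrix_transpose_mul_self _)
    (elimLin_intertwine p hb hp hpb Λ h hI f (fun U => avgMatrix_mul_rotMatrix_of_intertwine_rot f fC Λ hΛ U)) hΔ hP hQ U

omit [DecidableEq (PBond P (k+1))] [MeasurableSpace 𝔤] [BorelSpace 𝔤] in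
/-- **The positive-definiteness hypothesis DISCHARGED too**: for symmetric positive `Δ^{(k)}(U)` the precision `C(U)*M(U)C(U)` of the
constructed (injective) `C(U)` is positive definite — print's Gaussian `dμ_{C^{(k)}}`, `C^{(k)} = (C*Δ^{(k)}C)⁻¹`, EXISTS as a probability
measure with no hypothesis beyond the positivity of the basic quadratic form (2.11). [cite: Balaban1987RG1, (2.11)–(2.12) pp.267–268] -/
theorem posDef_prec212U_elimLin (p : PBond P k → Prop) [DecidablePred p] {b₀ : PBond P (k+1) → PBond P k}
    (hpb : ∀ c, ¬ p (b₀ c)) (Λ : X → (VecField P k 𝔤 →ₗ[ℝ] VecField P (k+1) 𝔤)) (h : X → PBond P (k+1) → (𝔤 →ₗ[ℝ] 𝔤))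
    (Δ : X → (VecField P k 𝔤 →ₗ[ℝ] VecField P k 𝔤))
    (hsymm : ∀ U (A A' : VecField P k 𝔤), ∑ b, ⟪A b, Δ U A' b⟫_ℝ = ∑ b, ⟪Δ U A b, A' b⟫_ℝ)
    (hpos : ∀ U (A : VecField P k 𝔤), A ≠ 0 → 0 < ∑ b, ⟪A b, Δ U A b⟫_ℝ) (U : X) :
    (prec212U (fun U => avgMatrix (elimLin p b₀ (Λ U) (h U))) (fun U => avgMatrix (Δ U)) U).PosDef :=
  posDef_prec212U _ _ U (posDef_avgMatrix (Δ U) (hsymm U) (hpos U)) (injective_avgMatrix_elimLin_mulVec p hpb (Λ U) (h U))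

/-- **(2.16) verbatim — `U_{k+1} ↦ U^u_{k+1}`, `B′ ↦ R(u)B′`, `(R(u)B′)(b) = R(u(b₋))B′(b)` — with print's `C` and print's precision**,
`R` a representation of `G` on `𝐠` by isometries acting on the `T^{(k)}`-bond fields at `b₋` and on the `T^{(k+1)}`-bond fields at `c₋`
(read in `T^{(k)}` through `Setup.emb`, [13] (3.32)): the constraint family with its `h` and its covariance, the `Δ^{(k)}` intertwining
and the invariance of `𝐏^{(k)}`, `{…}` give the gauge invariance of (2.13). [cite: Balaban1987RG1, (2.16) p.269 with p.267 and (2.11)–(2.13) pp.267–268] -/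
theorem newTerm_onBondsGaussElim_gauge_invariant {G : Type*} (p : PBond P k → Prop) [DecidablePred p]
    {b₀ : PBond P (k+1) → PBond P k} (hb : Function.Injective b₀) (hp : ∀ b, ¬ p b → ∃ c, b₀ c = b) (hpb : ∀ c, ¬ p (b₀ c))
    (Λ : X → (VecField P k 𝔤 →ₗ[ℝ] VecField P (k+1) 𝔤)) (h : X → PBond P (k+1) → (𝔤 →ₗ[ℝ] 𝔤))
    (hI : ∀ U w, Λ U (hOp b₀ (fun c => ⇑(h U c)) w) = w) (Δ : X → (VecField P k 𝔤 →ₗ[ℝ] VecField P k 𝔤))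
    (hpd : ∀ U, (prec212U (fun U => avgMatrix (elimLin p b₀ (Λ U) (h U))) (fun U => avgMatrix (Δ U)) U).PosDef) (ε₁ : ℝ)
    (Pk Qk : ℝ → X → VecField P k 𝔤 → ℝ) (g : ℝ) (τ : X → X) (R : G → (𝔤 ≃ₗᵢ[ℝ] 𝔤)) (u : GaugeTransf P k G)
    (hΛ : ∀ U A, Λ (τ U) (B12ChiInvariance269.rotFluct (fun g => ⇑(R g)) u A)
      = rotLin (fun c : PBond P (k+1) => R (u (emb c.src))) (Λ U A))
    (hΔ : ∀ U A, Δ (τ U) (B12ChiInvariance269.rotFluct (fun g => ⇑(R g)) u A)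
      = B12ChiInvariance269.rotFluct (fun g => ⇑(R g)) u (Δ U A))
    (hP : ∀ U B, Pk g (τ U) (B12ChiInvariance269.rotFluct (fun g => ⇑(R g)) u B) = Pk g U B)
    (hQ : ∀ U B, Qk g (τ U) (B12ChiInvariance269.rotFluct (fun g => ⇑(R g)) u B) = Qk g U B) (U : X) :
    (onBondsGaussElim p b₀ Λ h (prec212U (fun U => avgMatrix (elimLin p b₀ (Λ U) (h U))) fun U => avgMatrix (Δ U)) hpd ε₁ Pk
        Qk).newTerm g (τ U)
      = (onBondsGaussElim p b₀ Λ h (prec212U (fun U => avgMatrix (elimLin p b₀ (Λ U) (h U))) fun U => avgMatrix (Δ U)) hpd ε₁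
        Pk Qk).newTerm g U :=
  newTerm_onBondsGaussElim_eq_of_intertwine p hb hp hpb Λ h hI Δ hpd ε₁ Pk Qk g τ (fun b => R (u b.src))
    (fun c => R (u (emb c.src))) hΛ hΔ hP hQ U

/-- **ON THE CELL'S TORI WITH PRINT'S `b₀(c)`** (`B12SmallFieldDomain259.b0`, the middle bond of the straight contour `c`; injective in
the standing range `k + 1 ≤ m + K`) and the retained bonds = *«T^{(k)} ∖ {b₀(c) : c ∈ T^{(k+1)}}»* (the index set of the printed product
(2.9)): the fully reduced (2.16) with the bookkeeping hypotheses discharged. [cite: Balaban1987RG1, (2.16) p.269 with (2.9) p.266, p.267, (2.11)–(2.13) pp.267–268] -/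
theorem newTerm_onBondsGaussElim_b0_eq_of_intertwine (hk : k + 1 ≤ P.m + P.K)
    (Λ : X → (VecField P k 𝔤 →ₗ[ℝ] VecField P (k+1) 𝔤)) (h : X → PBond P (k+1) → (𝔤 →ₗ[ℝ] 𝔤))
    (hI : ∀ U w, Λ U (hOp B12SmallFieldDomain259.b0 (fun c => ⇑(h U c)) w) = w)
    (Δ : X → (VecField P k 𝔤 →ₗ[ℝ] VecField P k 𝔤))
    (hpd : ∀ U, (prec212U (fun U => avgMatrix (elimLin (fun b : PBond P k => ¬ ∃ c : PBond P (k+1), B12SmallFieldDomain259.b0 c = b)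
      B12SmallFieldDomain259.b0 (Λ U) (h U))) (fun U => avgMatrix (Δ U)) U).PosDef) (ε₁ : ℝ)
    (Pk Qk : ℝ → X → VecField P k 𝔤 → ℝ) (g : ℝ) (τ : X → X) (f : PBond P k → (𝔤 ≃ₗᵢ[ℝ] 𝔤))
    (fC : PBond P (k+1) → (𝔤 ≃ₗᵢ[ℝ] 𝔤)) (hΛ : ∀ U A, Λ (τ U) (rot f A) = rotLin fC (Λ U A))
    (hΔ : ∀ U A, Δ (τ U) (rot f A) = rot f (Δ U A))
    (hP : ∀ U B, Pk g (τ U) (rot f B) = Pk g U B) (hQ : ∀ U B, Qk g (τ U) (rot f B) = Qk g U B) (U : X) :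
    (onBondsGaussElim (fun b : PBond P k => ¬ ∃ c : PBond P (k+1), B12SmallFieldDomain259.b0 c = b) B12SmallFieldDomain259.b0 Λ h
        (prec212U (fun U => avgMatrix (elimLin (fun b : PBond P k => ¬ ∃ c : PBond P (k+1), B12SmallFieldDomain259.b0 c = b)
          B12SmallFieldDomain259.b0 (Λ U) (h U))) fun U => avgMatrix (Δ U)) hpd ε₁ Pk Qk).newTerm g (τ U)
      = (onBondsGaussElim (fun b : PBond P k => ¬ ∃ c : PBond P (k+1), B12SmallFieldDomain259.b0 c = b) B12SmallFieldDomain259.b0 Λ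
        h (prec212U (fun U => avgMatrix (elimLin (fun b : PBond P k => ¬ ∃ c : PBond P (k+1), B12SmallFieldDomain259.b0 c = b)
          B12SmallFieldDomain259.b0 (Λ U) (h U))) fun U => avgMatrix (Δ U)) hpd ε₁ Pk Qk).newTerm g U :=
  newTerm_onBondsGaussElim_eq_of_intertwine _ (B12SmallFieldDomain259.b0_injective hk) (fun _ hb => not_not.mp hb)
    (fun c hc => hc ⟨c, rfl⟩) Λ h hI Δ hpd ε₁ Pk Qk g τ f fC hΛ hΔ hP hQ U

end OnBondsLocalConstraint

/-! ## §6. *«Of course h is uniquely defined by these conditions … h(c) … equal to an inverse of a coefficient at the variable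
## B′(b₀(c)) in (Q̃B′)(c)»* — `h` CONSTRUCTED from `LQ̃` and `LQ̃h = I` PROVED from locality + separation (v1.3) -/

section InverseCoefficient

open B13PkLocalTerms B12B0Restriction267

variable {β C : Type*} [DecidableEq β] [DecidableEq C] {F : Type*} [NormedAddCommGroup F] [NormedSpace ℝ F]

omit [DecidableEq C] [NormedSpace ℝ F] in
/-- Print's `h` as a FINITE SUM over the coarse bonds: `hw = Σ_c δ_{b₀(c)} (h(c) w(c))` (`b₀` injective).
[cite: Balaban1987RG1, p.267] -/
theorem hOp_eq_sum_single [Fintype C] {b₀ : C → β} (hb : Function.Injective b₀) (h : C → F → F) (w : C → F) :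
    hOp b₀ h w = ∑ c, (Pi.single (b₀ c) (h c (w c)) : β → F) := by
  funext b
  rw [Finset.sum_apply]
  by_cases hbb : ∃ c, b₀ c = b
  · obtain ⟨c, rfl⟩ := hbb
    rw [hOp_apply_b₀ hb, Finset.sum_eq_single c]
    · rw [Pi.single_eq_same]
    · intro c' _ hc'
      exact Pi.single_eq_of_ne (fun e => hc' (hb e.symm)) _
    · intro hc
      exact absurd (Finset.mem_univ c) hc
  · rw [hOp_eq_zero_off_range _ _ hbb, Finset.sum_eq_zero]
    intro c _
    exact Pi.single_eq_of_ne (fun e => hbb ⟨c, e.symm⟩) _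

omit [DecidableEq C] in
/-- **SEPARATION + LOCALITY ⇒ DIAGONAL CORRIDOR COUPLING**: if `(LQ̃B)(c)` depends on `B` only through the dependence set
`N(c)` and no foreign `b₀(c′)` lies in `N(c)` (on the cell's tori: `B12SmallFieldDomain259.eq_of_b0_mem_nbhd`), then the variable at
`b₀(c′)`, `c′ ≠ c`, does not enter `(LQ̃B)(c)`: `(LQ̃ δ_{b₀(c′)}X)(c) = 0`. [cite: Balaban1987RG1, p.267] -/
theorem apply_single_b0_eq_zero_of_local {b₀ : C → β} {N : C → Set β} {Λ : (β → F) →ₗ[ℝ] (C → F)}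
    (hloc : ∀ (B B' : β → F) (c : C), (∀ b ∈ N c, B b = B' b) → Λ B c = Λ B' c)
    (hsep : ∀ c c' : C, b₀ c' ∈ N c → c' = c) {c c' : C} (hc : c' ≠ c) (X : F) :
    Λ (Pi.single (b₀ c') X) c = 0 := by
  rw [hloc (Pi.single (b₀ c') X) 0 c, map_zero, Pi.zero_apply]
  intro b hb
  rw [Pi.zero_apply, Pi.single_eq_of_ne]
  rintro rfl
  exact hc (hsep c c' hb)

omit [DecidableEq C] in
/-- A corridor coefficient BOUNDED BELOW (r09's hypothesis (H) of `B12B0Restriction267.norm_apply_b0_le`: `‖X‖ ≤ H·‖coeff_c X‖`)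
is injective. [cite: Balaban1987RG1, p.267] -/
theorem injective_coeff_of_bound {b₀ : C → β} {Λ : (β → F) →ₗ[ℝ] (C → F)} {H : ℝ}
    (hH : ∀ (c : C) (X : F), ‖X‖ ≤ H * ‖coeff b₀ Λ c X‖) (c : C) : Function.Injective (coeff b₀ Λ c) := by
  refine (injective_iff_map_eq_zero _).mpr fun X hX => ?_
  have h1 := hH c X
  rw [hX, norm_zero, mul_zero] at h1
  exact norm_le_zero_iff.mp h1

variable [FiniteDimensional ℝ F]

omit [DecidableEq C] in
/-- **PRINT'S `h(c)` CONSTRUCTED — *«equal to an inverse of a coefficient at the variable B′(b₀(c)) in (Q̃B′)(c)»***: the inverse of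
r09's corridor coefficient `coeff b₀ LQ̃ c` (injective, hence invertible on the finite-dimensional `𝐠`; Mathlib's
`LinearEquiv.ofInjectiveEndo`).  (Print's extra factor `L⁻¹` belongs to his normalisation `LQ̃ = L·Q̃`; here `Λ` is the linear map
whose coefficient is inverted, whatever its normalisation.) [cite: Balaban1987RG1, p.267] -/
def invCoeff (b₀ : C → β) (Λ : (β → F) →ₗ[ℝ] (C → F)) (hinj : ∀ c, Function.Injective (coeff b₀ Λ c)) (c : C) :
    F →ₗ[ℝ] F :=
  ((LinearEquiv.ofInjectiveEndo (coeff b₀ Λ c) (hinj c)).symm : F →ₗ[ℝ] F)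

omit [DecidableEq C] in
/-- `coeff_c (h(c) X) = X`. [cite: Balaban1987RG1, p.267] -/
theorem coeff_invCoeff (b₀ : C → β) (Λ : (β → F) →ₗ[ℝ] (C → F)) (hinj : ∀ c, Function.Injective (coeff b₀ Λ c)) (c : C)
    (X : F) : coeff b₀ Λ c (invCoeff b₀ Λ hinj c X) = X := by
  rw [invCoeff, ← LinearEquiv.coe_ofInjectiveEndo (coeff b₀ Λ c) (hinj c)]
  exact (LinearEquiv.ofInjectiveEndo (coeff b₀ Λ c) (hinj c)).apply_symm_apply X

omit [DecidableEq C] in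
/-- `h(c) (coeff_c X) = X`. [cite: Balaban1987RG1, p.267] -/
theorem invCoeff_coeff (b₀ : C → β) (Λ : (β → F) →ₗ[ℝ] (C → F)) (hinj : ∀ c, Function.Injective (coeff b₀ Λ c)) (c : C)
    (X : F) : invCoeff b₀ Λ hinj c (coeff b₀ Λ c X) = X := by
  have h := (LinearEquiv.ofInjectiveEndo (coeff b₀ Λ c) (hinj c)).symm_apply_apply X
  rw [LinearEquiv.coe_ofInjectiveEndo] at h
  exact h

omit [DecidableEq C] in
/-- **«the operator h satisfies the identity LQ̃h = I on T^{(k+1)}» PROVED** for the constructed `h` from the LOCALITY of `LQ̃`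
on the dependence sets `N(c)` and the SEPARATION of the distinguished bonds — the hypothesis `hI` of §5 DISCHARGED.
[cite: Balaban1987RG1, p.267] -/
theorem apply_hOp_invCoeff [Fintype C] {b₀ : C → β} (hb : Function.Injective b₀) {N : C → Set β}
    {Λ : (β → F) →ₗ[ℝ] (C → F)} (hloc : ∀ (B B' : β → F) (c : C), (∀ b ∈ N c, B b = B' b) → Λ B c = Λ B' c)
    (hsep : ∀ c c' : C, b₀ c' ∈ N c → c' = c) (hinj : ∀ c, Function.Injective (coeff b₀ Λ c)) (w : C → F) :
    Λ (hOp b₀ (fun c => ⇑(invCoeff b₀ Λ hinj c)) w) = w := by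
  funext c
  rw [hOp_eq_sum_single hb, map_sum, Finset.sum_apply, Finset.sum_eq_single c]
  · exact coeff_invCoeff b₀ Λ hinj c (w c)
  · intro c' _ hc'
    exact apply_single_b0_eq_zero_of_local hloc hsep hc' _
  · intro hc
    exact absurd (Finset.mem_univ c) hc

omit [DecidableEq C] in
/-- The same with r09's QUANTITATIVE hypotheses (L) `‖(LQ̃B)(c)‖ ≤ K·M` whenever `‖B‖ ≤ M` on `N(c)` and (H) `‖X‖ ≤ H·‖coeff_c X‖`
(`B12B0Restriction267.norm_apply_b0_le`), and separation. [cite: Balaban1987RG1, p.267] -/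
theorem apply_hOp_invCoeff_of_bound [Fintype C] {b₀ : C → β} (hb : Function.Injective b₀) {N : C → Set β}
    {Λ : (β → F) →ₗ[ℝ] (C → F)} {K H : ℝ}
    (hK : ∀ (B : β → F) (c : C) (M : ℝ), (∀ b ∈ N c, ‖B b‖ ≤ M) → ‖Λ B c‖ ≤ K * M)
    (hH : ∀ (c : C) (X : F), ‖X‖ ≤ H * ‖coeff b₀ Λ c X‖) (hsep : ∀ c c' : C, b₀ c' ∈ N c → c' = c) (w : C → F) :
    Λ (hOp b₀ (fun c => ⇑(invCoeff b₀ Λ (injective_coeff_of_bound hH) c)) w) = w :=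
  apply_hOp_invCoeff hb (fun _ _ _ h => isLocal_of_bound hK h) hsep (injective_coeff_of_bound hH) w

/-- **«Of course h is uniquely defined by these conditions»**: ANY family `h(c)` with `LQ̃h = I` IS the inverse of the corridor
coefficient. [cite: Balaban1987RG1, p.267] -/
theorem h_eq_invCoeff {b₀ : C → β} (hb : Function.Injective b₀) {Λ : (β → F) →ₗ[ℝ] (C → F)} {h : C → (F →ₗ[ℝ] F)}
    (hI : ∀ w, Λ (hOp b₀ (fun c => ⇑(h c)) w) = w) (hinj : ∀ c, Function.Injective (coeff b₀ Λ c)) (c : C) :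
    h c = invCoeff b₀ Λ hinj c := by
  refine LinearMap.ext fun X => hinj c ?_
  rw [coeff_h_apply hb hI, coeff_invCoeff]

end InverseCoefficient

section OnBondsLocal

open B13PkLocalTerms B12B0Restriction267

variable {P : Params} {k : ℕ} [DecidableEq (PBond P k)] [DecidableEq (PBond P (k+1))] {𝔤 : Type} [NormedAddCommGroup 𝔤]
  [InnerProductSpace ℝ 𝔤] [FiniteDimensional ℝ 𝔤] [MeasurableSpace 𝔤] [BorelSpace 𝔤] {X : Type*}

/-- **THE FULLY REDUCED (2.16) ON THE CELL'S TORI WITH `h` CONSTRUCTED** — binders on the constraint family are r09's (L) and (H)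
of `B12B0Restriction267` (locality of `LQ̃(U)` on the dependence sets `B12SmallFieldDomain259.nbhd c` with a bound, corridor
coefficients bounded below), SEPARATION being the tree's `eq_of_b0_mem_nbhd`: `h(U)(c) := invCoeff` (the inverse of the
coefficient), `LQ̃(U)h(U) = I` a THEOREM (`apply_hOp_invCoeff_of_bound`), `C(U) = elimLin … (LQ̃ U) (h U)`; with the covariance of
`LQ̃`, the `Δ^{(k)}` intertwining and the invariance of `𝐏^{(k)}`, `{…}`: `𝐄^{(k+1)}(g, τU) = 𝐄^{(k+1)}(g, U)`.
[cite: Balaban1987RG1, (2.16) p.269 with (2.9) p.266, p.267, (2.11)–(2.13) pp.267–268] -/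
theorem newTerm_onBondsGaussElim_b0_eq_of_local (hk : k + 1 ≤ P.m + P.K)
    (Λ : X → (VecField P k 𝔤 →ₗ[ℝ] VecField P (k+1) 𝔤)) {K H : X → ℝ}
    (hK : ∀ U (B : VecField P k 𝔤) (c : PBond P (k+1)) (M : ℝ),
      (∀ b ∈ B12SmallFieldDomain259.nbhd c, ‖B b‖ ≤ M) → ‖Λ U B c‖ ≤ K U * M)
    (hH : ∀ U (c : PBond P (k+1)) (Y : 𝔤), ‖Y‖ ≤ H U * ‖coeff B12SmallFieldDomain259.b0 (Λ U) c Y‖)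
    (Δ : X → (VecField P k 𝔤 →ₗ[ℝ] VecField P k 𝔤))
    (hpd : ∀ U, (prec212U (fun U => avgMatrix (elimLin (fun b : PBond P k => ¬ ∃ c : PBond P (k+1), B12SmallFieldDomain259.b0 c = b)
      B12SmallFieldDomain259.b0 (Λ U) (invCoeff B12SmallFieldDomain259.b0 (Λ U) (injective_coeff_of_bound (hH U)))))
      (fun U => avgMatrix (Δ U)) U).PosDef) (ε₁ : ℝ)
    (Pk Qk : ℝ → X → VecField P k 𝔤 → ℝ) (g : ℝ) (τ : X → X) (f : PBond P k → (𝔤 ≃ₗᵢ[ℝ] 𝔤))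
    (fC : PBond P (k+1) → (𝔤 ≃ₗᵢ[ℝ] 𝔤)) (hΛ : ∀ U A, Λ (τ U) (rot f A) = rotLin fC (Λ U A))
    (hΔ : ∀ U A, Δ (τ U) (rot f A) = rot f (Δ U A))
    (hP : ∀ U B, Pk g (τ U) (rot f B) = Pk g U B) (hQ : ∀ U B, Qk g (τ U) (rot f B) = Qk g U B) (U : X) :
    (onBondsGaussElim (fun b : PBond P k => ¬ ∃ c : PBond P (k+1), B12SmallFieldDomain259.b0 c = b) B12SmallFieldDomain259.b0 Λ
        (fun U => invCoeff B12SmallFieldDomain259.b0 (Λ U) (injective_coeff_of_bound (hH U)))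
        (prec212U (fun U => avgMatrix (elimLin (fun b : PBond P k => ¬ ∃ c : PBond P (k+1), B12SmallFieldDomain259.b0 c = b)
          B12SmallFieldDomain259.b0 (Λ U) (invCoeff B12SmallFieldDomain259.b0 (Λ U) (injective_coeff_of_bound (hH U)))))
          fun U => avgMatrix (Δ U)) hpd ε₁ Pk Qk).newTerm g (τ U)
      = (onBondsGaussElim (fun b : PBond P k => ¬ ∃ c : PBond P (k+1), B12SmallFieldDomain259.b0 c = b) B12SmallFieldDomain259.b0 Λ
        (fun U => invCoeff B12SmallFieldDomain259.b0 (Λ U) (injective_coeff_of_bound (hH U)))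
        (prec212U (fun U => avgMatrix (elimLin (fun b : PBond P k => ¬ ∃ c : PBond P (k+1), B12SmallFieldDomain259.b0 c = b)
          B12SmallFieldDomain259.b0 (Λ U) (invCoeff B12SmallFieldDomain259.b0 (Λ U) (injective_coeff_of_bound (hH U)))))
          fun U => avgMatrix (Δ U)) hpd ε₁ Pk Qk).newTerm g U :=
  newTerm_onBondsGaussElim_b0_eq_of_intertwine hk Λ _
    (fun U w => apply_hOp_invCoeff_of_bound (B12SmallFieldDomain259.b0_injective hk) (hK U) (hH U)
      (fun _ _ h => B12SmallFieldDomain259.eq_of_b0_mem_nbhd hk h) w)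
    Δ hpd ε₁ Pk Qk g τ f fC hΛ hΔ hP hQ U

end OnBondsLocal

/-! ## §7 (v1.4). p. 269 «all the expressions in (2.12) … are invariant with respect to the gauge transformations (2.16)» FOR THE
## LETTER `h` OF p. 267: the corridor coefficients, print's `h = invCoeff`, «LQ̃h = I», (L)(H) and the constructed `C` are ALL
## (2.16)-COVARIANT as soon as `LQ̃` is — by «h is uniquely defined by these conditions» (uniqueness of the inverse) -/

section HCovariance

open B13PkLocalTerms B12B0Restriction267

variable {β C : Type} [DecidableEq β] {F : Type*} [NormedAddCommGroup F] [InnerProductSpace ℝ F]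

/-- `R(u)` on a fine unit vector: `R(δ_b X) = δ_b (R(u(b₋))X)` (bondwise action). [cite: Balaban1987RG1, (2.16) p.269] -/
theorem rotLin_single (f : β → (F ≃ₗᵢ[ℝ] F)) (b : β) (X : F) :
    rotLin f (Pi.single b X) = (Pi.single b (f b X) : β → F) := by
  funext b'
  rw [rotLin_apply]
  by_cases hb : b' = b
  · subst hb
    rw [Pi.single_eq_same, Pi.single_eq_same]
  · rw [Pi.single_eq_of_ne hb, Pi.single_eq_of_ne hb, map_zero]

/-- **THE CORRIDOR COEFFICIENTS ARE COVARIANT.**  If the linear constraint transforms under (2.16) as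
`LQ̃(τU)(R(u)B′) = R_C(u)(LQ̃(U)B′)` (`R` bondwise on the `T^{(k)}`-bond fields, `R_C` bondwise on the `T^{(k+1)}`-bond fields — the
[13] (3.32)-shaped covariance, binder `hΛ` of §§5–6), then r09's corridor coefficient *«at the variable B′(b₀(c)) in (Q̃B′)(c)»*
conjugates: `coeff(τU)_c ∘ R(u(b₀(c)₋)) = R_C(u)_c ∘ coeff(U)_c`. [cite: Balaban1987RG1, p.267 with (2.16) p.269] -/
theorem coeff_conj {Λ Λ' : (β → F) →ₗ[ℝ] (C → F)} {f : β → (F ≃ₗᵢ[ℝ] F)} {fC : C → (F ≃ₗᵢ[ℝ] F)}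
    (hΛ : ∀ A, Λ' (rotLin f A) = rotLin fC (Λ A)) (b₀ : C → β) (c : C) (X : F) :
    coeff b₀ Λ' c (f (b₀ c) X) = fC c (coeff b₀ Λ c X) := by
  rw [coeff_apply, coeff_apply, ← rotLin_single, hΛ, rotLin_apply]

/-- … hence an injective coefficient stays injective along the orbit (`R`, `R_C` bijective).
[cite: Balaban1987RG1, p.267 with (2.16) p.269] -/
theorem injective_coeff_conj {Λ Λ' : (β → F) →ₗ[ℝ] (C → F)} {f : β → (F ≃ₗᵢ[ℝ] F)} {fC : C → (F ≃ₗᵢ[ℝ] F)}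
    (hΛ : ∀ A, Λ' (rotLin f A) = rotLin fC (Λ A)) {b₀ : C → β}
    (hinj : ∀ c, Function.Injective (coeff b₀ Λ c)) (c : C) : Function.Injective (coeff b₀ Λ' c) := by
  intro Y Y' hYY'
  have h1 : coeff b₀ Λ c ((f (b₀ c)).symm Y) = coeff b₀ Λ c ((f (b₀ c)).symm Y') := by
    apply (fC c).injective
    rw [← coeff_conj hΛ, ← coeff_conj hΛ, LinearIsometryEquiv.apply_symm_apply, LinearIsometryEquiv.apply_symm_apply,
      hYY']
  exact (f (b₀ c)).symm.injective (hinj c h1)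

/-- **r09's (H) IS TRANSPORTED along the orbit with the SAME constant**: `‖X‖ ≤ H‖coeff(U)_c X‖` for all `X` gives
`‖Y‖ ≤ H‖coeff(τU)_c Y‖` for all `Y` (`R`, `R_C` isometries). [cite: Balaban1987RG1, p.267 with (2.16) p.269] -/
theorem bound_coeff_conj {Λ Λ' : (β → F) →ₗ[ℝ] (C → F)} {f : β → (F ≃ₗᵢ[ℝ] F)} {fC : C → (F ≃ₗᵢ[ℝ] F)}
    (hΛ : ∀ A, Λ' (rotLin f A) = rotLin fC (Λ A)) {b₀ : C → β} {H : ℝ}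
    (hH : ∀ (c : C) (X : F), ‖X‖ ≤ H * ‖coeff b₀ Λ c X‖) (c : C) (Y : F) : ‖Y‖ ≤ H * ‖coeff b₀ Λ' c Y‖ := by
  calc ‖Y‖ = ‖(f (b₀ c)).symm Y‖ := ((f (b₀ c)).symm.norm_map Y).symm
    _ ≤ H * ‖coeff b₀ Λ c ((f (b₀ c)).symm Y)‖ := hH c _
    _ = H * ‖fC c (coeff b₀ Λ c ((f (b₀ c)).symm Y))‖ := by rw [LinearIsometryEquiv.norm_map]
    _ = H * ‖coeff b₀ Λ' c Y‖ := by rw [← coeff_conj hΛ, LinearIsometryEquiv.apply_symm_apply]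

omit [DecidableEq β] in
/-- **LOCALITY IS TRANSPORTED**: if `(LQ̃(U)B)(c)` depends on `B` only through the dependence set `N(c)`, so does `(LQ̃(τU)B)(c)`
(same sets; `R(u)` acts bondwise). [cite: Balaban1987RG1, p.267 with (2.16) p.269] -/
theorem isLocal_conj {Λ Λ' : (β → F) →ₗ[ℝ] (C → F)} {f : β → (F ≃ₗᵢ[ℝ] F)} {fC : C → (F ≃ₗᵢ[ℝ] F)}
    (hΛ : ∀ A, Λ' (rotLin f A) = rotLin fC (Λ A)) {N : C → Set β}
    (hloc : ∀ (B B' : β → F) (c : C), (∀ b ∈ N c, B b = B' b) → Λ B c = Λ B' c) (B B' : β → F) (c : C)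
    (hBB' : ∀ b ∈ N c, B b = B' b) : Λ' B c = Λ' B' c := by
  have e : ∀ A, Λ' A = rotLin fC (Λ ((rotLin f).symm A)) := fun A => by
    rw [← hΛ, LinearEquiv.apply_symm_apply]
  rw [e B, e B', rotLin_apply, rotLin_apply]
  refine congrArg (fC c) (hloc _ _ c fun b hb => ?_)
  rw [rotLin_symm_apply, rotLin_symm_apply, hBB' b hb]

omit [DecidableEq β] in
/-- **r09's (L) IS TRANSPORTED along the orbit with the SAME constant**: `‖(LQ̃(U)B)(c)‖ ≤ K·M` whenever `‖B‖ ≤ M` on `N(c)` gives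
the same for `LQ̃(τU)` (`R(u)` is a bondwise isometry, `R_C(u)` an isometry). [cite: Balaban1987RG1, p.267 with (2.16) p.269] -/
theorem local_bound_conj {Λ Λ' : (β → F) →ₗ[ℝ] (C → F)} {f : β → (F ≃ₗᵢ[ℝ] F)} {fC : C → (F ≃ₗᵢ[ℝ] F)}
    (hΛ : ∀ A, Λ' (rotLin f A) = rotLin fC (Λ A)) {N : C → Set β} {K : ℝ}
    (hK : ∀ (B : β → F) (c : C) (M : ℝ), (∀ b ∈ N c, ‖B b‖ ≤ M) → ‖Λ B c‖ ≤ K * M)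
    (B : β → F) (c : C) (M : ℝ) (hB : ∀ b ∈ N c, ‖B b‖ ≤ M) : ‖Λ' B c‖ ≤ K * M := by
  have hB' : ∀ b ∈ N c, ‖(rotLin f).symm B b‖ ≤ M := fun b hb => by
    rw [rotLin_symm_apply, LinearIsometryEquiv.norm_map]
    exact hB b hb
  have e : Λ' B = rotLin fC (Λ ((rotLin f).symm B)) := by rw [← hΛ, LinearEquiv.apply_symm_apply]
  rw [e, rotLin_apply, LinearIsometryEquiv.norm_map]
  exact hK _ c M hB'

omit [DecidableEq β] in
/-- **Print's operator `h` of a COVARIANT family `h(c)` is covariant**: if `h′(c) ∘ R_C(u)_c = R(u)_{b₀(c)} ∘ h(c)` for every coarse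
bond, then `h′(R_C(u)w) = R(u)(hw)` for the field operators (`(hw)(b₀(c)) = h(c)w(c)`, zero off the distinguished bonds).
[cite: Balaban1987RG1, p.267 with (2.16) p.269] -/
theorem hOp_conj {b₀ : C → β} (hb : Function.Injective b₀) {h h' : C → (F →ₗ[ℝ] F)} {f : β → (F ≃ₗᵢ[ℝ] F)}
    {fC : C → (F ≃ₗᵢ[ℝ] F)} (hh : ∀ (c : C) (X : F), h' c (fC c X) = f (b₀ c) (h c X)) (w : C → F) :
    hOp b₀ (fun c => ⇑(h' c)) (rotLin fC w) = rotLin f (hOp b₀ (fun c => ⇑(h c)) w) := by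
  funext b
  rw [rotLin_apply]
  by_cases hbb : ∃ c, b₀ c = b
  · obtain ⟨c, rfl⟩ := hbb
    rw [hOp_apply_b₀ hb, hOp_apply_b₀ hb, rotLin_apply, hh]
  · rw [hOp_eq_zero_off_range _ _ hbb, hOp_eq_zero_off_range _ _ hbb, map_zero]

omit [DecidableEq β] in
/-- **«LQ̃h = I» IS TRANSPORTED**: for a covariant family `h` with `LQ̃(U)h = I`, the conjugated family satisfies `LQ̃(τU)h′ = I`.
[cite: Balaban1987RG1, p.267 with (2.16) p.269] -/
theorem apply_hOp_conj {b₀ : C → β} (hb : Function.Injective b₀) {Λ Λ' : (β → F) →ₗ[ℝ] (C → F)}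
    {h h' : C → (F →ₗ[ℝ] F)} {f : β → (F ≃ₗᵢ[ℝ] F)} {fC : C → (F ≃ₗᵢ[ℝ] F)}
    (hΛ : ∀ A, Λ' (rotLin f A) = rotLin fC (Λ A)) (hh : ∀ (c : C) (X : F), h' c (fC c X) = f (b₀ c) (h c X))
    (hI : ∀ w, Λ (hOp b₀ (fun c => ⇑(h c)) w) = w) (w : C → F) : Λ' (hOp b₀ (fun c => ⇑(h' c)) w) = w := by
  have key : ∀ v, Λ' (hOp b₀ (fun c => ⇑(h' c)) (rotLin fC v)) = rotLin fC v := fun v => by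
    rw [hOp_conj hb hh, hΛ, hI]
  have h1 := key ((rotLin fC).symm w)
  rwa [LinearEquiv.apply_symm_apply] at h1

omit [DecidableEq β] in
/-- The remaining variables transform by `R_rem = R↾retained` and their extension by zero follows: `(R_rem B)⁰ = R(B⁰)`.
[cite: Balaban1987RG1, (2.11) p.267, (2.12) p.268 with (2.16) p.269] -/
theorem extendLin_rot (p : β → Prop) [DecidablePred p] (f : β → (F ≃ₗᵢ[ℝ] F)) (v : {b // p b} → F) :
    extendLin p (fun s => f s.1 (v s)) = rotLin f (extendLin p v) := by
  funext b
  rw [rotLin_apply]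
  by_cases hb : p b
  · rw [extendLin_apply_of_pos p _ hb, extendLin_apply_of_pos p _ hb]
  · rw [extendLin_apply_of_neg p _ hb, extendLin_apply_of_neg p _ hb, map_zero]

omit [DecidableEq β] in
/-- **THE CONSTRUCTED `C` IS COVARIANT AS A MAP** — `C(τU)(R_rem B) = R(u)(C(U)B)` — for ANY covariant family `h` with the constraint
covariant (function-level companion of the chart identity `elimLin_intertwine` of §5, which went through the uniqueness of `C`;
here through the covariance of `h`). [cite: Balaban1987RG1, (2.11) p.267 with (2.16) p.269] -/
theorem elimLin_conj (p : β → Prop) [DecidablePred p] {b₀ : C → β} (hb : Function.Injective b₀)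
    {Λ Λ' : (β → F) →ₗ[ℝ] (C → F)} {h h' : C → (F →ₗ[ℝ] F)} {f : β → (F ≃ₗᵢ[ℝ] F)} {fC : C → (F ≃ₗᵢ[ℝ] F)}
    (hΛ : ∀ A, Λ' (rotLin f A) = rotLin fC (Λ A)) (hh : ∀ (c : C) (X : F), h' c (fC c X) = f (b₀ c) (h c X))
    (v : {b // p b} → F) :
    elimLin p b₀ Λ' h' (fun s => f s.1 (v s)) = rotLin f (elimLin p b₀ Λ h v) := by
  rw [elimLin_apply, elimLin_apply, extendLin_rot, hΛ, hOp_conj hb hh, ← map_sub]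

variable [FiniteDimensional ℝ F]

/-- **PRINT'S `h = invCoeff` IS (2.16)-COVARIANT — «Of course h is uniquely defined by these conditions».**  Since the corridor
coefficient conjugates (`coeff_conj`) and `h(c)` is ITS INVERSE (unique), `h(τU)(c) ∘ R_C(u)_c = R(u)_{b₀(c)} ∘ h(U)(c)`: NO hypothesis
on `h`, only the covariance of `LQ̃` (and the injectivity of the coefficients at both backgrounds, the second being
`injective_coeff_conj` of the first). [cite: Balaban1987RG1, p.267 with (2.16) p.269] -/
theorem invCoeff_conj {Λ Λ' : (β → F) →ₗ[ℝ] (C → F)} {f : β → (F ≃ₗᵢ[ℝ] F)} {fC : C → (F ≃ₗᵢ[ℝ] F)}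
    (hΛ : ∀ A, Λ' (rotLin f A) = rotLin fC (Λ A)) (b₀ : C → β) (hinj : ∀ c, Function.Injective (coeff b₀ Λ c))
    (hinj' : ∀ c, Function.Injective (coeff b₀ Λ' c)) (c : C) (Y : F) :
    invCoeff b₀ Λ' hinj' c (fC c Y) = f (b₀ c) (invCoeff b₀ Λ hinj c Y) := by
  apply hinj' c
  rw [coeff_invCoeff, coeff_conj hΛ, coeff_invCoeff]

/-- The same as an identity of operators on `𝐠`: `h(τU)(c) = R(u)_{b₀(c)} ∘ h(U)(c) ∘ R_C(u)_c⁻¹`.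
[cite: Balaban1987RG1, p.267 with (2.16) p.269] -/
theorem invCoeff_conj_eq {Λ Λ' : (β → F) →ₗ[ℝ] (C → F)} {f : β → (F ≃ₗᵢ[ℝ] F)} {fC : C → (F ≃ₗᵢ[ℝ] F)}
    (hΛ : ∀ A, Λ' (rotLin f A) = rotLin fC (Λ A)) (b₀ : C → β) (hinj : ∀ c, Function.Injective (coeff b₀ Λ c))
    (hinj' : ∀ c, Function.Injective (coeff b₀ Λ' c)) (c : C) :
    invCoeff b₀ Λ' hinj' c
      = ((f (b₀ c)).toLinearEquiv : F →ₗ[ℝ] F) ∘ₗ invCoeff b₀ Λ hinj c ∘ₗ ((fC c).symm.toLinearEquiv : F →ₗ[ℝ] F) := by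
  refine LinearMap.ext fun Y => ?_
  have h1 := invCoeff_conj hΛ b₀ hinj hinj' c ((fC c).symm Y)
  rw [LinearIsometryEquiv.apply_symm_apply] at h1
  rw [h1]
  rfl

/-- **THE OPERATOR `h` OF (2.12) IS COVARIANT**: `h(τU)(R_C(u)w) = R(u)(h(U)w)` for print's constructed `h` — the letter `h` of
«hD̃(g_kCB)», «h((δ∕δB)D̃)» in (2.12) obeys (2.16) with no hypothesis on it. [cite: Balaban1987RG1, (2.12) p.268, (2.16) p.269 with p.267] -/
theorem hOp_invCoeff_conj {b₀ : C → β} (hb : Function.Injective b₀) {Λ Λ' : (β → F) →ₗ[ℝ] (C → F)}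
    {f : β → (F ≃ₗᵢ[ℝ] F)} {fC : C → (F ≃ₗᵢ[ℝ] F)} (hΛ : ∀ A, Λ' (rotLin f A) = rotLin fC (Λ A))
    (hinj : ∀ c, Function.Injective (coeff b₀ Λ c)) (hinj' : ∀ c, Function.Injective (coeff b₀ Λ' c)) (w : C → F) :
    hOp b₀ (fun c => ⇑(invCoeff b₀ Λ' hinj' c)) (rotLin fC w) = rotLin f (hOp b₀ (fun c => ⇑(invCoeff b₀ Λ hinj c)) w) :=
  hOp_conj hb (fun c X => invCoeff_conj hΛ b₀ hinj hinj' c X) w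

/-- «LQ̃h = I» at `τU` for print's `h`, from the same identity at `U` (for instance §6's `apply_hOp_invCoeff`) and the covariance of
`LQ̃` — the off-diagonal vanishing is transported with it. [cite: Balaban1987RG1, p.267 with (2.16) p.269] -/
theorem apply_hOp_invCoeff_conj {b₀ : C → β} (hb : Function.Injective b₀) {Λ Λ' : (β → F) →ₗ[ℝ] (C → F)}
    {f : β → (F ≃ₗᵢ[ℝ] F)} {fC : C → (F ≃ₗᵢ[ℝ] F)} (hΛ : ∀ A, Λ' (rotLin f A) = rotLin fC (Λ A))
    (hinj : ∀ c, Function.Injective (coeff b₀ Λ c)) (hinj' : ∀ c, Function.Injective (coeff b₀ Λ' c))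
    (hI : ∀ w, Λ (hOp b₀ (fun c => ⇑(invCoeff b₀ Λ hinj c)) w) = w) (w : C → F) :
    Λ' (hOp b₀ (fun c => ⇑(invCoeff b₀ Λ' hinj' c)) w) = w :=
  apply_hOp_conj hb hΛ (fun c X => invCoeff_conj hΛ b₀ hinj hinj' c X) hI w

/-- … in particular for print's `h = invCoeff`: `C(τU)(R_rem B) = R(u)(C(U)B)` with `C(U) = elimLin … (LQ̃ U) (invCoeff …)`, from the
covariance of `LQ̃` alone. [cite: Balaban1987RG1, (2.11) p.267 with (2.16) p.269, p.267] -/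
theorem elimLin_invCoeff_conj (p : β → Prop) [DecidablePred p] {b₀ : C → β} (hb : Function.Injective b₀)
    {Λ Λ' : (β → F) →ₗ[ℝ] (C → F)} {f : β → (F ≃ₗᵢ[ℝ] F)} {fC : C → (F ≃ₗᵢ[ℝ] F)}
    (hΛ : ∀ A, Λ' (rotLin f A) = rotLin fC (Λ A)) (hinj : ∀ c, Function.Injective (coeff b₀ Λ c))
    (hinj' : ∀ c, Function.Injective (coeff b₀ Λ' c)) (v : {b // p b} → F) :
    elimLin p b₀ Λ' (invCoeff b₀ Λ' hinj') (fun s => f s.1 (v s)) = rotLin f (elimLin p b₀ Λ (invCoeff b₀ Λ hinj) v) :=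
  elimLin_conj p hb hΛ (fun c X => invCoeff_conj hΛ b₀ hinj hinj' c X) v

end HCovariance

section HCovarianceFamily

open B13PkLocalTerms B12B0Restriction267

variable {β C : Type} [DecidableEq β] {F : Type*} [NormedAddCommGroup F] [InnerProductSpace ℝ F] [FiniteDimensional ℝ F]
  {X : Type*}

/-- **ALONG A BACKGROUND FAMILY.**  For a constraint family `LQ̃(U)` covariant under `U ↦ τU` (binder `hΛ` of the (2.16) theorems of
§§5–6) whose corridor coefficients are injective at every background (e.g. bounded below, r09's (H), any constants `H(U)`),
print's `h(U) = invCoeff` satisfies `h(τU)(c) ∘ R_C(u)_c = R(u)_{b₀(c)} ∘ h(U)(c)` — whatever proofs of injectivity are supplied at `U`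
and at `τU`. [cite: Balaban1987RG1, p.267 with (2.16) p.269] -/
theorem invCoeff_covariant {τ : X → X} (Λ : X → ((β → F) →ₗ[ℝ] (C → F))) {f : β → (F ≃ₗᵢ[ℝ] F)}
    {fC : C → (F ≃ₗᵢ[ℝ] F)} (hΛ : ∀ U A, Λ (τ U) (rotLin f A) = rotLin fC (Λ U A)) (b₀ : C → β)
    (hinj : ∀ U c, Function.Injective (coeff b₀ (Λ U) c)) (U : X) (c : C) (Y : F) :
    invCoeff b₀ (Λ (τ U)) (hinj (τ U)) c (fC c Y) = f (b₀ c) (invCoeff b₀ (Λ U) (hinj U) c Y) :=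
  invCoeff_conj (hΛ U) b₀ (hinj U) (hinj (τ U)) c Y

/-- … and the field operator: `h(τU) ∘ R_C(u) = R(u) ∘ h(U)`. [cite: Balaban1987RG1, (2.12) p.268, (2.16) p.269 with p.267] -/
theorem hOp_invCoeff_covariant {τ : X → X} {b₀ : C → β} (hb : Function.Injective b₀)
    (Λ : X → ((β → F) →ₗ[ℝ] (C → F))) {f : β → (F ≃ₗᵢ[ℝ] F)} {fC : C → (F ≃ₗᵢ[ℝ] F)}
    (hΛ : ∀ U A, Λ (τ U) (rotLin f A) = rotLin fC (Λ U A)) (hinj : ∀ U c, Function.Injective (coeff b₀ (Λ U) c))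
    (U : X) (w : C → F) :
    hOp b₀ (fun c => ⇑(invCoeff b₀ (Λ (τ U)) (hinj (τ U)) c)) (rotLin fC w)
      = rotLin f (hOp b₀ (fun c => ⇑(invCoeff b₀ (Λ U) (hinj U) c)) w) :=
  hOp_invCoeff_conj hb (hΛ U) (hinj U) (hinj (τ U)) w

end HCovarianceFamily

section HCovarianceTorus

open B13PkLocalTerms B12B0Restriction267

variable {P : Params} {k : ℕ} [DecidableEq (PBond P k)] {𝔤 : Type} [NormedAddCommGroup 𝔤] [InnerProductSpace ℝ 𝔤]
  [MeasurableSpace 𝔤] [BorelSpace 𝔤] {X : Type*}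

/-- **ON THE CELL'S TORI, IN THE LETTERS OF `newTerm_onBondsGaussElim_b0_eq_of_local` (§6).**  With print's `b₀(c)` =
`B12SmallFieldDomain259.b0`, a constraint family `LQ̃(U)` with r09's (H) at every background and the covariance
`LQ̃(τU)(R(u)A) = R_C(u)(LQ̃(U)A)` (`R(u)` = r07's `B10Eq26MeasureInv.rot f`), the operator `h(U)` that §6 CONSTRUCTS and feeds into
(2.16) is itself (2.16)-covariant: `h(τU)(R_C(u)w) = R(u)(h(U)w)`.  The letter `h` of (2.12) thus needs no covariance hypothesis of
its own in the (2.16) ledger (cf. the binders `hh'` of `B12JacobianGauge269` on the p. 267 Banach carrier; r09's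
`B12Def267Covariance` proves the `ℤᵈ` instance for [I]'s genuine average directly). [cite: Balaban1987RG1, (2.16) p.269 with p.267, (2.12) p.268] -/
theorem hOp_invCoeff_b0_covariant [FiniteDimensional ℝ 𝔤] (Λ : X → (VecField P k 𝔤 →ₗ[ℝ] VecField P (k+1) 𝔤)) {H : X → ℝ}
    (hH : ∀ U (c : PBond P (k+1)) (Y : 𝔤), ‖Y‖ ≤ H U * ‖coeff B12SmallFieldDomain259.b0 (Λ U) c Y‖)
    (hk : k + 1 ≤ P.m + P.K) (τ : X → X) (f : PBond P k → (𝔤 ≃ₗᵢ[ℝ] 𝔤)) (fC : PBond P (k+1) → (𝔤 ≃ₗᵢ[ℝ] 𝔤))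
    (hΛ : ∀ U A, Λ (τ U) (rot f A) = rotLin fC (Λ U A)) (U : X) (w : VecField P (k+1) 𝔤) :
    hOp B12SmallFieldDomain259.b0 (fun c => ⇑(invCoeff B12SmallFieldDomain259.b0 (Λ (τ U)) (injective_coeff_of_bound (hH (τ U))) c))
        (rotLin fC w)
      = rot f (hOp B12SmallFieldDomain259.b0 (fun c => ⇑(invCoeff B12SmallFieldDomain259.b0 (Λ U) (injective_coeff_of_bound (hH U)) c))
        w) := by
  have hΛ' : ∀ A, Λ (τ U) (rotLin f A) = rotLin fC (Λ U A) := fun A => by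
    rw [coe_rotLin f]
    exact hΛ U A
  rw [← coe_rotLin f]
  exact hOp_invCoeff_conj (B12SmallFieldDomain259.b0_injective hk) hΛ' _ _ w

/-- … and r09's (L), (H) hold at `τU` with the constants of `U` (so along a gauge orbit ONE pair of constants serves):
(H). [cite: Balaban1987RG1, p.267 with (2.16) p.269] -/
theorem bound_coeff_b0_covariant (Λ : X → (VecField P k 𝔤 →ₗ[ℝ] VecField P (k+1) 𝔤)) {H : X → ℝ}
    (hH : ∀ U (c : PBond P (k+1)) (Y : 𝔤), ‖Y‖ ≤ H U * ‖coeff B12SmallFieldDomain259.b0 (Λ U) c Y‖)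
    (τ : X → X) (f : PBond P k → (𝔤 ≃ₗᵢ[ℝ] 𝔤)) (fC : PBond P (k+1) → (𝔤 ≃ₗᵢ[ℝ] 𝔤))
    (hΛ : ∀ U A, Λ (τ U) (rot f A) = rotLin fC (Λ U A)) (U : X) (c : PBond P (k+1)) (Y : 𝔤) :
    ‖Y‖ ≤ H U * ‖coeff B12SmallFieldDomain259.b0 (Λ (τ U)) c Y‖ := by
  have hΛ' : ∀ A, Λ (τ U) (rotLin f A) = rotLin fC (Λ U A) := fun A => by
    rw [coe_rotLin f]
    exact hΛ U A
  exact bound_coeff_conj hΛ' (hH U) c Y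

omit [DecidableEq (PBond P k)] in
/-- (L). [cite: Balaban1987RG1, p.267 with (2.16) p.269] -/
theorem local_bound_b0_covariant (Λ : X → (VecField P k 𝔤 →ₗ[ℝ] VecField P (k+1) 𝔤)) {K : X → ℝ}
    (hK : ∀ U (B : VecField P k 𝔤) (c : PBond P (k+1)) (M : ℝ),
      (∀ b ∈ B12SmallFieldDomain259.nbhd c, ‖B b‖ ≤ M) → ‖Λ U B c‖ ≤ K U * M)
    (τ : X → X) (f : PBond P k → (𝔤 ≃ₗᵢ[ℝ] 𝔤)) (fC : PBond P (k+1) → (𝔤 ≃ₗᵢ[ℝ] 𝔤))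
    (hΛ : ∀ U A, Λ (τ U) (rot f A) = rotLin fC (Λ U A)) (U : X) (B : VecField P k 𝔤) (c : PBond P (k+1)) (M : ℝ)
    (hB : ∀ b ∈ B12SmallFieldDomain259.nbhd c, ‖B b‖ ≤ M) : ‖Λ (τ U) B c‖ ≤ K U * M := by
  have hΛ' : ∀ A, Λ (τ U) (rotLin f A) = rotLin fC (Λ U A) := fun A => by
    rw [coe_rotLin f]
    exact hΛ U A
  exact local_bound_conj hΛ' (hK U) B c M hB

end HCovarianceTorus

/-! ## §8 (v1.4). THE `Δ^{(k)}` INTERTWINING OF (2.16) FROM THE INVARIANCE OF THE GENERATING FUNCTION — print's own reason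
## «all the expressions in (2.12), together with the measure, are invariant»: `Δ^{(k)}(U)` REPRESENTS the second-order term (2.11)
## of an expansion whose generating function is jointly invariant, hence it is symmetric and `Δ^{(k)}(U^u) ∘ R(u) = R(u) ∘ Δ^{(k)}(U)` -/

section HessianForm

variable {E E' : Type*} [NormedAddCommGroup E] [NormedSpace ℝ E] [NormedAddCommGroup E'] [NormedSpace ℝ E']

/-- Two-function form of the cell's `B12Covariance54.iteratedFDeriv_two_invariant` (Mathlib's
`ContinuousLinearMap.iteratedFDeriv_comp_right`): if `q ∘ L = g` for a continuous linear `L`, then `D²g(0)(m) = D²q(0)(L ∘ m)`.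
[cite: Balaban1987RG1, (2.16) p.269 with (2.11) p.267] -/
private theorem iteratedFDeriv_two_conj {g q : E → E'} (hq : ContDiff ℝ 2 q) (L : E →L[ℝ] E)
    (hinv : ∀ x, q (L x) = g x) (m : Fin 2 → E) :
    iteratedFDeriv ℝ 2 g 0 m = iteratedFDeriv ℝ 2 q 0 (fun i => L (m i)) := by
  have hg : g = q ∘ L := funext fun x => (hinv x).symm
  rw [hg, L.iteratedFDeriv_comp_right hq 0 le_rfl]
  simp only [ContinuousMultilinearMap.compContinuousLinearMap_apply, map_zero]

/-- … in the `fderiv ∘ fderiv` spelling: `D²q(0)(Lv, Lw) = D²g(0)(v, w)`. [cite: Balaban1987RG1, (2.16) p.269 with (2.11) p.267] -/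
private theorem hessian_conj {g q : E → E'} (hq : ContDiff ℝ 2 q) (L : E →L[ℝ] E) (hinv : ∀ x, q (L x) = g x)
    (v w : E) : fderiv ℝ (fderiv ℝ q) 0 (L v) (L w) = fderiv ℝ (fderiv ℝ g) 0 v w := by
  have h := iteratedFDeriv_two_conj hq L hinv ![v, w]
  rw [iteratedFDeriv_two_apply, iteratedFDeriv_two_apply] at h
  simpa using h.symm

end HessianForm

section HessianOperator

variable {B : Type} [Fintype B] {F : Type*} [NormedAddCommGroup F] [InnerProductSpace ℝ F]

/-- Nondegeneracy of the bond inner product `Σ_b ⟪A(b), ·(b)⟫` of (2.11) ∕ [13] (3.156): a field is determined by its pairings.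
[cite: Balaban1987RG1, (2.11) p.267] -/
private theorem eq_of_forall_sum_inner_eq {Y Y' : B → F}
    (h : ∀ A : B → F, ∑ b, ⟪A b, Y b⟫_ℝ = ∑ b, ⟪A b, Y' b⟫_ℝ) : Y = Y' := by
  have key : ∀ Z : B → F, (∀ A : B → F, ∑ b, ⟪A b, Z b⟫_ℝ = 0) → Z = 0 := fun Z hZ => by
    funext b
    have hb := (Finset.sum_eq_zero_iff_of_nonneg fun b _ => real_inner_self_nonneg).mp (hZ Z) b (Finset.mem_univ b)
    exact inner_self_eq_zero.mp hb
  refine sub_eq_zero.mp (key (Y - Y') fun A => ?_)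
  have hA := h A
  simp only [Pi.sub_apply, inner_sub_right, Finset.sum_sub_distrib, hA, sub_self]

/-- **AN OPERATOR REPRESENTING A HESSIAN IN THE BOND INNER PRODUCT IS SYMMETRIC.**  Print's `Δ^{(k)}(U)` is DEFINED by (2.11) as the
operator of the second-order term `½⟨B′, Δ^{(k)}B′⟩` of the expansion of `−(1/g_k²)A(U_k(·))` in `B′` around `B′ = 0`; for a `C²`
generating function this makes `Δ^{(k)}(U)` symmetric (Schwarz, Mathlib's `ContDiffAt.isSymmSndFDerivAt`) — the hypothesis `hsymm` of
`posDef_avgMatrix` ∕ `posDef_prec212U_elimLin`. [cite: Balaban1987RG1, (2.11) p.267] -/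
theorem symmetric_of_hessian (Q : (B → F) → ℝ) (hQ : ContDiff ℝ 2 Q) (Δ : (B → F) →ₗ[ℝ] (B → F))
    (hΔ : ∀ A A' : B → F, ∑ b, ⟪A b, Δ A' b⟫_ℝ = fderiv ℝ (fderiv ℝ Q) 0 A A') (A A' : B → F) :
    ∑ b, ⟪A b, Δ A' b⟫_ℝ = ∑ b, ⟪Δ A b, A' b⟫_ℝ := by
  have hs : IsSymmSndFDerivAt ℝ Q 0 := hQ.contDiffAt.isSymmSndFDerivAt (by simp)
  rw [hΔ, hs.eq A A', ← hΔ]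
  exact Finset.sum_congr rfl fun b _ => real_inner_comm _ _

variable [FiniteDimensional ℝ F]

/-- **THE `Δ^{(k)}` INTERTWINING `Δ^{(k)}(τU) ∘ R(u) = R(u) ∘ Δ^{(k)}(U)` — the binder `hΔ` of every (2.16) theorem of §§3–6 — DERIVED
FROM THE JOINT INVARIANCE OF THE GENERATING FUNCTION.**  If `Q_U(B′)` (the function whose second-order term at `B′ = 0` is
`½⟨B′, Δ^{(k)}(U)B′⟩`, (2.11)) is `C²` and satisfies `Q_{τU}(R(u)B′) = Q_U(B′)` — print: *«all the expressions in (2.12) … are invariant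
with respect to the gauge transformations (2.16)»*, which for the expansion of the action is the gauge invariance of `A(U_k(·))`
composed with the covariance of `V^{(k)}`, `exp`, `M` (p. 266) — and `Δ^{(k)}(U)` represents its Hessian in the bond inner product,
then `Δ^{(k)}(τU)(R(u)A) = R(u)(Δ^{(k)}(U)A)`: second derivatives of intertwined functions are intertwined (`hessian_conj`), `R(u)` is
a bondwise isometry, and the pairing is nondegenerate. [cite: Balaban1987RG1, (2.16) p.269 with (2.11) p.267, p.266] -/
theorem intertwine_of_hessian {X : Type*} {τ : X → X} (f : B → (F ≃ₗᵢ[ℝ] F)) (Q : X → (B → F) → ℝ)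
    (hQ : ∀ U, ContDiff ℝ 2 (Q U)) (hinv : ∀ U A, Q (τ U) (rotLin f A) = Q U A)
    (Δ : X → ((B → F) →ₗ[ℝ] (B → F)))
    (hΔ : ∀ U (A A' : B → F), ∑ b, ⟪A b, Δ U A' b⟫_ℝ = fderiv ℝ (fderiv ℝ (Q U)) 0 A A') (U : X) (A' : B → F) :
    Δ (τ U) (rotLin f A') = rotLin f (Δ U A') := by
  have hL : ∀ A, LinearMap.toContinuousLinearMap (rotLin f : (B → F) →ₗ[ℝ] (B → F)) A = rotLin f A := fun A => rfl
  refine eq_of_forall_sum_inner_eq fun A => ?_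
  have hform := hessian_conj (g := Q U) (hQ (τ U)) (LinearMap.toContinuousLinearMap (rotLin f : (B → F) →ₗ[ℝ] (B → F)))
    (fun x => by rw [hL]; exact hinv U x) ((rotLin f).symm A) A'
  rw [hL, hL, LinearEquiv.apply_symm_apply] at hform
  rw [hΔ, hform, ← hΔ]
  refine Finset.sum_congr rfl fun b _ => ?_
  rw [rotLin_symm_apply, rotLin_apply, ← (f b).inner_map_map ((f b).symm (A b)), LinearIsometryEquiv.apply_symm_apply]

/-- The same with r07's measurable equivalence `B10Eq26MeasureInv.rot f` — EXACTLY the binder `hΔ` of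
`newTerm_onBondsGauss_eq_of_intertwine` ∕ `…GaussPush…` ∕ `…GaussElim…` ∕ `newTerm_onBondsGaussElim_b0_eq_of_local`.
[cite: Balaban1987RG1, (2.16) p.269 with (2.11) p.267] -/
theorem intertwine_rot_of_hessian [MeasurableSpace F] [BorelSpace F] {X : Type*} {τ : X → X} (f : B → (F ≃ₗᵢ[ℝ] F))
    (Q : X → (B → F) → ℝ) (hQ : ∀ U, ContDiff ℝ 2 (Q U)) (hinv : ∀ U A, Q (τ U) (rot f A) = Q U A)
    (Δ : X → ((B → F) →ₗ[ℝ] (B → F)))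
    (hΔ : ∀ U (A A' : B → F), ∑ b, ⟪A b, Δ U A' b⟫_ℝ = fderiv ℝ (fderiv ℝ (Q U)) 0 A A') (U : X) (A' : B → F) :
    Δ (τ U) (rot f A') = rot f (Δ U A') := by
  rw [← coe_rotLin f]
  exact intertwine_of_hessian f Q hQ (fun U A => by rw [coe_rotLin f]; exact hinv U A) Δ hΔ U A'

/-- **THE SAME MECHANISM FOR ANY ORTHOGONAL TRANSFORMATION OF THE FLUCTUATION FIELD** — print, (2.17)–(2.18) p. 269: *«The
transformation (2.18) generates an orthogonal transformation of the fluctuation field B′, hence all the remaining operations preserve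
the invariance for the same reasons as for the gauge invariance.»*  For ANY linear automorphism `L` of the field space preserving the
bond inner product (a bondwise isometry `R(u)` as in (2.16); a bondwise isometry composed with a permutation of the bonds as generated
by a Euclidean `r` in (2.18)) under which the `C²` generating function is jointly invariant, `Q_{τU}(LB′) = Q_U(B′)`, the representing
operator intertwines: `Δ^{(k)}(τU) ∘ L = L ∘ Δ^{(k)}(U)`.  (Which `L` (2.18) generates is row B12.Eq2.17-2.18, r09's `B12EuclTransf218`,
not this file.) [cite: Balaban1987RG1, (2.16)–(2.18) p.269 with (2.11) p.267] -/
theorem intertwine_of_hessian_of_orthogonal {X : Type*} {τ : X → X} (L : (B → F) ≃ₗ[ℝ] (B → F))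
    (hL : ∀ A A' : B → F, ∑ b, ⟪L A b, L A' b⟫_ℝ = ∑ b, ⟪A b, A' b⟫_ℝ) (Q : X → (B → F) → ℝ)
    (hQ : ∀ U, ContDiff ℝ 2 (Q U)) (hinv : ∀ U A, Q (τ U) (L A) = Q U A) (Δ : X → ((B → F) →ₗ[ℝ] (B → F)))
    (hΔ : ∀ U (A A' : B → F), ∑ b, ⟪A b, Δ U A' b⟫_ℝ = fderiv ℝ (fderiv ℝ (Q U)) 0 A A') (U : X) (A' : B → F) :
    Δ (τ U) (L A') = L (Δ U A') := by
  have hL' : ∀ A, LinearMap.toContinuousLinearMap (L : (B → F) →ₗ[ℝ] (B → F)) A = L A := fun A => rfl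
  refine eq_of_forall_sum_inner_eq fun A => ?_
  have hform := hessian_conj (g := Q U) (hQ (τ U)) (LinearMap.toContinuousLinearMap (L : (B → F) →ₗ[ℝ] (B → F)))
    (fun x => by rw [hL']; exact hinv U x) (L.symm A) A'
  rw [hL', hL', LinearEquiv.apply_symm_apply] at hform
  rw [hΔ, hform, ← hΔ]
  have h1 := hL (L.symm A) (Δ U A')
  rw [LinearEquiv.apply_symm_apply] at h1
  exact h1.symm

omit [FiniteDimensional ℝ F] in
/-- `R(u)` of (2.16) preserves the bond inner product (bondwise isometries) — the hypothesis `hL` of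
`intertwine_of_hessian_of_orthogonal` in the gauge case. [cite: Balaban1987RG1, (2.16) p.269] -/
theorem sum_inner_rotLin (f : B → (F ≃ₗᵢ[ℝ] F)) (A A' : B → F) :
    ∑ b, ⟪rotLin f A b, rotLin f A' b⟫_ℝ = ∑ b, ⟪A b, A' b⟫_ℝ :=
  Finset.sum_congr rfl fun b _ => by rw [rotLin_apply, rotLin_apply, (f b).inner_map_map]

end HessianOperator

section OnBondsHessian

open B13PkLocalTerms B12B0Restriction267

variable {P : Params} {k : ℕ} [DecidableEq (PBond P k)] [DecidableEq (PBond P (k+1))] {𝔤 : Type} [NormedAddCommGroup 𝔤]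
  [InnerProductSpace ℝ 𝔤] [FiniteDimensional ℝ 𝔤] [MeasurableSpace 𝔤] [BorelSpace 𝔤] {X : Type*}

/-- **THE FULLY REDUCED (2.16) ON THE CELL'S TORI WITH THE `Δ^{(k)}` CLAUSE READ AS IN PRINT** (v1.4 form of §6's
`newTerm_onBondsGaussElim_b0_eq_of_local`): the operator binder `hΔ` is REPLACED by the (2.11) reading of `Δ^{(k)}(U)` — it represents,
in the bond inner product, the Hessian at `B′ = 0` of a `C²` generating function `Q_U` with the JOINT INVARIANCE `Q_{τU}(R(u)B′) = Q_U(B′)`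
(*«all the expressions in (2.12) … are invariant»*, p. 269; for the expansion (2.11) this is the gauge invariance of the action read
through (2.2)–(2.4)) — and the intertwining is the THEOREM `intertwine_rot_of_hessian`.  Remaining binders: the constraint family's
(L)(H) and covariance (their transport along the orbit is §7), the positive definiteness of the precision (for which `hsymm` is now
`symmetric_of_hessian`, cf. `posDef_prec212U_elimLin`), and the invariance of `𝐏^{(k)}`, `{…}`.
[cite: Balaban1987RG1, (2.16) p.269 with (2.9) p.266, (2.11) p.267, (2.12)–(2.13) p.268] -/
theorem newTerm_onBondsGaussElim_b0_eq_of_hessian (hk : k + 1 ≤ P.m + P.K)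
    (Λ : X → (VecField P k 𝔤 →ₗ[ℝ] VecField P (k+1) 𝔤)) {K H : X → ℝ}
    (hK : ∀ U (B : VecField P k 𝔤) (c : PBond P (k+1)) (M : ℝ),
      (∀ b ∈ B12SmallFieldDomain259.nbhd c, ‖B b‖ ≤ M) → ‖Λ U B c‖ ≤ K U * M)
    (hH : ∀ U (c : PBond P (k+1)) (Y : 𝔤), ‖Y‖ ≤ H U * ‖coeff B12SmallFieldDomain259.b0 (Λ U) c Y‖)
    (Δ : X → (VecField P k 𝔤 →ₗ[ℝ] VecField P k 𝔤))
    (hpd : ∀ U, (prec212U (fun U => avgMatrix (elimLin (fun b : PBond P k => ¬ ∃ c : PBond P (k+1), B12SmallFieldDomain259.b0 c = b)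
      B12SmallFieldDomain259.b0 (Λ U) (invCoeff B12SmallFieldDomain259.b0 (Λ U) (injective_coeff_of_bound (hH U)))))
      (fun U => avgMatrix (Δ U)) U).PosDef) (ε₁ : ℝ)
    (Pk Qk : ℝ → X → VecField P k 𝔤 → ℝ) (g : ℝ) (τ : X → X) (f : PBond P k → (𝔤 ≃ₗᵢ[ℝ] 𝔤))
    (fC : PBond P (k+1) → (𝔤 ≃ₗᵢ[ℝ] 𝔤)) (hΛ : ∀ U A, Λ (τ U) (rot f A) = rotLin fC (Λ U A))
    (Q : X → VecField P k 𝔤 → ℝ) (hQ2 : ∀ U, ContDiff ℝ 2 (Q U)) (hQinv : ∀ U A, Q (τ U) (rot f A) = Q U A)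
    (hΔQ : ∀ U (A A' : VecField P k 𝔤), ∑ b, ⟪A b, Δ U A' b⟫_ℝ = fderiv ℝ (fderiv ℝ (Q U)) 0 A A')
    (hP : ∀ U B, Pk g (τ U) (rot f B) = Pk g U B) (hQ : ∀ U B, Qk g (τ U) (rot f B) = Qk g U B) (U : X) :
    (onBondsGaussElim (fun b : PBond P k => ¬ ∃ c : PBond P (k+1), B12SmallFieldDomain259.b0 c = b) B12SmallFieldDomain259.b0 Λ
        (fun U => invCoeff B12SmallFieldDomain259.b0 (Λ U) (injective_coeff_of_bound (hH U)))
        (prec212U (fun U => avgMatrix (elimLin (fun b : PBond P k => ¬ ∃ c : PBond P (k+1), B12SmallFieldDomain259.b0 c = b)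
          B12SmallFieldDomain259.b0 (Λ U) (invCoeff B12SmallFieldDomain259.b0 (Λ U) (injective_coeff_of_bound (hH U)))))
          fun U => avgMatrix (Δ U)) hpd ε₁ Pk Qk).newTerm g (τ U)
      = (onBondsGaussElim (fun b : PBond P k => ¬ ∃ c : PBond P (k+1), B12SmallFieldDomain259.b0 c = b) B12SmallFieldDomain259.b0 Λ
        (fun U => invCoeff B12SmallFieldDomain259.b0 (Λ U) (injective_coeff_of_bound (hH U)))
        (prec212U (fun U => avgMatrix (elimLin (fun b : PBond P k => ¬ ∃ c : PBond P (k+1), B12SmallFieldDomain259.b0 c = b)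
          B12SmallFieldDomain259.b0 (Λ U) (invCoeff B12SmallFieldDomain259.b0 (Λ U) (injective_coeff_of_bound (hH U)))))
          fun U => avgMatrix (Δ U)) hpd ε₁ Pk Qk).newTerm g U :=
  newTerm_onBondsGaussElim_b0_eq_of_local hk Λ hK hH Δ hpd ε₁ Pk Qk g τ f fC hΛ
    (intertwine_rot_of_hessian f Q hQ2 hQinv Δ hΔQ) hP hQ U

omit [DecidableEq (PBond P (k+1))] [MeasurableSpace 𝔤] [BorelSpace 𝔤] in
/-- **… and its positive-definiteness clause from the (2.11) POSITIVITY alone**: with `Δ^{(k)}(U)` representing the Hessian of a `C²`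
generating function (hence symmetric, `symmetric_of_hessian`) and the basic quadratic form positive (*[13] (3.156)*, the hypothesis
under which print's Gaussian exists), the precision `C(U)*Δ^{(k)}(U)C(U)` of the constructed `C(U)` is positive definite — the `hpd` fed
to `newTerm_onBondsGaussElim_b0_eq_of_hessian`. [cite: Balaban1987RG1, (2.11) p.267, (2.12) p.268] -/
theorem posDef_prec212U_elimLin_of_hessian (Λ : X → (VecField P k 𝔤 →ₗ[ℝ] VecField P (k+1) 𝔤)) {H : X → ℝ}
    (hH : ∀ U (c : PBond P (k+1)) (Y : 𝔤), ‖Y‖ ≤ H U * ‖coeff B12SmallFieldDomain259.b0 (Λ U) c Y‖)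
    (Δ : X → (VecField P k 𝔤 →ₗ[ℝ] VecField P k 𝔤)) (Q : X → VecField P k 𝔤 → ℝ) (hQ2 : ∀ U, ContDiff ℝ 2 (Q U))
    (hΔQ : ∀ U (A A' : VecField P k 𝔤), ∑ b, ⟪A b, Δ U A' b⟫_ℝ = fderiv ℝ (fderiv ℝ (Q U)) 0 A A')
    (hpos : ∀ U (A : VecField P k 𝔤), A ≠ 0 → 0 < ∑ b, ⟪A b, Δ U A b⟫_ℝ) (U : X) :
    (prec212U (fun U => avgMatrix (elimLin (fun b : PBond P k => ¬ ∃ c : PBond P (k+1), B12SmallFieldDomain259.b0 c = b)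
      B12SmallFieldDomain259.b0 (Λ U) (invCoeff B12SmallFieldDomain259.b0 (Λ U) (injective_coeff_of_bound (hH U)))))
      (fun U => avgMatrix (Δ U)) U).PosDef :=
  posDef_prec212U_elimLin _ (fun c hc => hc ⟨c, rfl⟩) Λ _ Δ (fun U => symmetric_of_hessian (Q U) (hQ2 U) (Δ U) (hΔQ U))
    hpos U

end OnBondsHessian

/-! ## §9 (v1.4). THE CONSTRAINT'S COVARIANCE `hΛ` FROM THE COVARIANCE OF THE AVERAGING MAP — (2.4) p. 266
## «M(V′V^{(k)})M(V^{(k)})⁻¹ = exp iQ̃(B′)», p. 267 «LQ̃B′ + C̃(B′)» (`LQ̃` = the linear part of `Q̃` at `B′ = 0`): a covariant map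
## has a covariant linearisation, so with §8 EVERY operator identity of the (2.16) ledger comes from a function-level statement -/

section Linearisation

variable {E E' : Type*} [NormedAddCommGroup E] [NormedSpace ℝ E] [NormedAddCommGroup E'] [NormedSpace ℝ E']

/-- First derivatives of intertwined maps are intertwined: `q ∘ L = M ∘ g` with `L`, `M` continuous linear and `q`, `g` differentiable
at `0` gives `Dq(0) ∘ L = M ∘ Dg(0)` (chain rule). [cite: Balaban1987RG1, (2.16) p.269 with (2.4) p.266, p.267] -/
private theorem fderiv_conj {q g : E → E'} (L : E →L[ℝ] E) (M : E' →L[ℝ] E') (hq : DifferentiableAt ℝ q 0)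
    (hg : DifferentiableAt ℝ g 0) (hinv : ∀ x, q (L x) = M (g x)) (A : E) :
    fderiv ℝ q 0 (L A) = M (fderiv ℝ g 0 A) := by
  have hcomp : q ∘ ⇑L = ⇑M ∘ g := funext fun x => hinv x
  have hq0 : DifferentiableAt ℝ q (L 0) := by
    rw [map_zero]
    exact hq
  have h1 := fderiv_comp (0 : E) hq0 L.differentiableAt
  rw [hcomp, fderiv_comp (0 : E) M.differentiableAt hg, ContinuousLinearMap.fderiv, ContinuousLinearMap.fderiv,
    map_zero] at h1
  have h2 := congrArg (fun T : E →L[ℝ] E' => T A) h1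
  simpa using h2.symm

end Linearisation

section ConstraintCovariance

variable {B C : Type} [Fintype B] [Fintype C] {F : Type*} [NormedAddCommGroup F] [InnerProductSpace ℝ F]
  [FiniteDimensional ℝ F]

/-- **THE COVARIANCE OF `LQ̃` — binder `hΛ` of §§5–8 — FROM THE COVARIANCE OF `Q̃`.**  Print's constraint map `Q̃_U(B′)` of (2.4)
(`M(exp(iB′)V^{(k)}(U)) M(V^{(k)}(U))⁻¹ = exp iQ̃_U(B′)`, a `T^{(k+1)}`-bond field) transforms under (2.16) as
`Q̃_{τU}(R(u)B′) = R_C(u) Q̃_U(B′)` (the covariance of the averaging, [13] (3.32); *«all the expressions in (2.12) … are invariant»*);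
its LINEAR PART at `B′ = 0`, print's `LQ̃` (p. 267 «LQ̃B′ + C̃(B′)»), read as the Fréchet derivative `Λ(U) = DQ̃_U(0)`, therefore
satisfies `LQ̃(τU)(R(u)A) = R_C(u)(LQ̃(U)A)` — the operator binder `hΛ` is a consequence of a function-level covariance of print's kind
(r09's `B12Average012QtildeCovariance` is the instance for [I]'s genuine average on its carrier). [cite: Balaban1987RG1, (2.16) p.269 with (2.4) p.266, p.267] -/
theorem constraint_conj_of_covariant {X : Type*} {τ : X → X} (f : B → (F ≃ₗᵢ[ℝ] F)) (fC : C → (F ≃ₗᵢ[ℝ] F))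
    (Qt : X → (B → F) → (C → F)) (hQt : ∀ U, DifferentiableAt ℝ (Qt U) 0)
    (hcov : ∀ U A, Qt (τ U) (rotLin f A) = rotLin fC (Qt U A)) (Λ : X → ((B → F) →ₗ[ℝ] (C → F)))
    (hΛ : ∀ U A, Λ U A = fderiv ℝ (Qt U) 0 A) (U : X) (A : B → F) :
    Λ (τ U) (rotLin f A) = rotLin fC (Λ U A) := by
  have hL : ∀ A, LinearMap.toContinuousLinearMap (rotLin f : (B → F) →ₗ[ℝ] (B → F)) A = rotLin f A := fun A => rfl
  have hM : ∀ w, LinearMap.toContinuousLinearMap (rotLin fC : (C → F) →ₗ[ℝ] (C → F)) w = rotLin fC w := fun w => rfl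
  rw [hΛ, hΛ, ← hL A, ← hM]
  exact fderiv_conj _ _ (hQt (τ U)) (hQt U) (fun x => by rw [hL, hM]; exact hcov U x) A

/-- The same with r07's measurable equivalence on the fine fields — EXACTLY the binder `hΛ` of `newTerm_onBondsGaussElim_b0_eq_of_local`
∕ `…_of_hessian`. [cite: Balaban1987RG1, (2.16) p.269 with (2.4) p.266, p.267] -/
theorem constraint_rot_conj_of_covariant [MeasurableSpace F] [BorelSpace F] {X : Type*} {τ : X → X}
    (f : B → (F ≃ₗᵢ[ℝ] F)) (fC : C → (F ≃ₗᵢ[ℝ] F)) (Qt : X → (B → F) → (C → F))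
    (hQt : ∀ U, DifferentiableAt ℝ (Qt U) 0) (hcov : ∀ U A, Qt (τ U) (rot f A) = rotLin fC (Qt U A))
    (Λ : X → ((B → F) →ₗ[ℝ] (C → F))) (hΛ : ∀ U A, Λ U A = fderiv ℝ (Qt U) 0 A) (U : X) (A : B → F) :
    Λ (τ U) (rot f A) = rotLin fC (Λ U A) := by
  rw [← coe_rotLin f]
  exact constraint_conj_of_covariant f fC Qt hQt (fun U A => by rw [coe_rotLin f]; exact hcov U A) Λ hΛ U A

end ConstraintCovariance

section OnBondsFunctions

open B13PkLocalTerms B12B0Restriction267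

variable {P : Params} {k : ℕ} [DecidableEq (PBond P k)] [DecidableEq (PBond P (k+1))] {𝔤 : Type} [NormedAddCommGroup 𝔤]
  [InnerProductSpace ℝ 𝔤] [FiniteDimensional ℝ 𝔤] [MeasurableSpace 𝔤] [BorelSpace 𝔤] {X : Type*}

/-- **THE FULLY REDUCED (2.16) ON THE CELL'S TORI WITH EVERY OPERATOR BINDER REPLACED BY A FUNCTION-LEVEL STATEMENT OF PRINT'S KIND**
(v1.4 form of §6's `newTerm_onBondsGaussElim_b0_eq_of_local`): the constraint family is the linearisation `LQ̃(U) = DQ̃_U(0)` of a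
differentiable COVARIANT map `Q̃_U` ((2.4); `Q̃_{τU}(R(u)B′) = R_C(u)Q̃_U(B′)`) — `hΛ` by `constraint_rot_conj_of_covariant` —, `Δ^{(k)}(U)`
represents the Hessian of a `C²` JOINTLY INVARIANT generating function `Q_U` ((2.11); `Q_{τU}(R(u)B′) = Q_U(B′)`) — `hΔ` by
`intertwine_rot_of_hessian` —; what remains are r09's (L)(H) per background, the positive definiteness of the precision
(`posDef_prec212U_elimLin_of_hessian` from the positivity of (2.11)), and the invariance of the scalar functions `𝐏^{(k)}`, `{…}`, `Q_U`
and the covariance of `Q̃_U` — print's sentence *«all the expressions in (2.12), together with the measure, are invariant with respect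
to the gauge transformations (2.16)»* taken LITERALLY as the list of hypotheses. [cite: Balaban1987RG1, (2.16) p.269 with (2.4) p.266, p.267, (2.9) p.266, (2.11) p.267, (2.12)–(2.13) p.268] -/
theorem newTerm_onBondsGaussElim_b0_eq_of_functions (hk : k + 1 ≤ P.m + P.K)
    (Λ : X → (VecField P k 𝔤 →ₗ[ℝ] VecField P (k+1) 𝔤)) {K H : X → ℝ}
    (hK : ∀ U (B : VecField P k 𝔤) (c : PBond P (k+1)) (M : ℝ),
      (∀ b ∈ B12SmallFieldDomain259.nbhd c, ‖B b‖ ≤ M) → ‖Λ U B c‖ ≤ K U * M)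
    (hH : ∀ U (c : PBond P (k+1)) (Y : 𝔤), ‖Y‖ ≤ H U * ‖coeff B12SmallFieldDomain259.b0 (Λ U) c Y‖)
    (Δ : X → (VecField P k 𝔤 →ₗ[ℝ] VecField P k 𝔤))
    (hpd : ∀ U, (prec212U (fun U => avgMatrix (elimLin (fun b : PBond P k => ¬ ∃ c : PBond P (k+1), B12SmallFieldDomain259.b0 c = b)
      B12SmallFieldDomain259.b0 (Λ U) (invCoeff B12SmallFieldDomain259.b0 (Λ U) (injective_coeff_of_bound (hH U)))))
      (fun U => avgMatrix (Δ U)) U).PosDef) (ε₁ : ℝ)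
    (Pk Qk : ℝ → X → VecField P k 𝔤 → ℝ) (g : ℝ) (τ : X → X) (f : PBond P k → (𝔤 ≃ₗᵢ[ℝ] 𝔤))
    (fC : PBond P (k+1) → (𝔤 ≃ₗᵢ[ℝ] 𝔤))
    (Qt : X → VecField P k 𝔤 → VecField P (k+1) 𝔤) (hQt : ∀ U, DifferentiableAt ℝ (Qt U) 0)
    (hQtcov : ∀ U A, Qt (τ U) (rot f A) = rotLin fC (Qt U A)) (hΛQt : ∀ U A, Λ U A = fderiv ℝ (Qt U) 0 A)
    (Q : X → VecField P k 𝔤 → ℝ) (hQ2 : ∀ U, ContDiff ℝ 2 (Q U)) (hQinv : ∀ U A, Q (τ U) (rot f A) = Q U A)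
    (hΔQ : ∀ U (A A' : VecField P k 𝔤), ∑ b, ⟪A b, Δ U A' b⟫_ℝ = fderiv ℝ (fderiv ℝ (Q U)) 0 A A')
    (hP : ∀ U B, Pk g (τ U) (rot f B) = Pk g U B) (hQ : ∀ U B, Qk g (τ U) (rot f B) = Qk g U B) (U : X) :
    (onBondsGaussElim (fun b : PBond P k => ¬ ∃ c : PBond P (k+1), B12SmallFieldDomain259.b0 c = b) B12SmallFieldDomain259.b0 Λ
        (fun U => invCoeff B12SmallFieldDomain259.b0 (Λ U) (injective_coeff_of_bound (hH U)))
        (prec212U (fun U => avgMatrix (elimLin (fun b : PBond P k => ¬ ∃ c : PBond P (k+1), B12SmallFieldDomain259.b0 c = b)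
          B12SmallFieldDomain259.b0 (Λ U) (invCoeff B12SmallFieldDomain259.b0 (Λ U) (injective_coeff_of_bound (hH U)))))
          fun U => avgMatrix (Δ U)) hpd ε₁ Pk Qk).newTerm g (τ U)
      = (onBondsGaussElim (fun b : PBond P k => ¬ ∃ c : PBond P (k+1), B12SmallFieldDomain259.b0 c = b) B12SmallFieldDomain259.b0 Λ
        (fun U => invCoeff B12SmallFieldDomain259.b0 (Λ U) (injective_coeff_of_bound (hH U)))
        (prec212U (fun U => avgMatrix (elimLin (fun b : PBond P k => ¬ ∃ c : PBond P (k+1), B12SmallFieldDomain259.b0 c = b)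
          B12SmallFieldDomain259.b0 (Λ U) (invCoeff B12SmallFieldDomain259.b0 (Λ U) (injective_coeff_of_bound (hH U)))))
          fun U => avgMatrix (Δ U)) hpd ε₁ Pk Qk).newTerm g U :=
  newTerm_onBondsGaussElim_b0_eq_of_hessian hk Λ hK hH Δ hpd ε₁ Pk Qk g τ f fC
    (constraint_rot_conj_of_covariant f fC Qt hQt hQtcov Λ hΛQt) Q hQ2 hQinv hΔQ hP hQ U

end OnBondsFunctions

/-! ## §10 (v1.4). (2.17)–(2.18) p. 269 FOR PRINT'S GAUSSIAN ON THE FIELDS — «The transformation (2.18) generates an orthogonal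
## transformation of the fluctuation field B′, hence all the remaining operations preserve the invariance for the same reasons as for
## the gauge invariance»: ANY linear automorphism of the field space preserving the bond inner product transports `gaussField M` to
## `gaussField (A M Aᵀ)`, `A` its (orthogonal) chart matrix; with §8 the measure clause follows from the invariance sentence alone.
## (Reading of record, as in §2 ∕ §3: `gaussField (avgMatrix Δ^{(k)}(U))` is the PRE-ELIMINATION Gaussian in `B′` with precision
## `Δ^{(k)}(U)`; print's `C^{(k)} = (C*Δ^{(k)}C)⁻¹` (p. 268) is its covariance in the REMAINING variables after `δ(Q̃B′)`, §§3–6 —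
## referee-5 g92 D-g92-1.) -/

section Orthogonal

variable {B : Type} [Fintype B] [DecidableEq B] {F : Type*} [NormedAddCommGroup F] [InnerProductSpace ℝ F]
  [FiniteDimensional ℝ F]

/-- A linear map of the fields preserving the bond inner product preserves dot products in the chart.
[cite: Balaban1987RG1, (2.16)–(2.18) p.269] -/
theorem dotProduct_avgMatrix_mulVec_of_orthogonal (L : (B → F) →ₗ[ℝ] (B → F))
    (hL : ∀ A A' : B → F, ∑ b, ⟪L A b, L A' b⟫_ℝ = ∑ b, ⟪A b, A' b⟫_ℝ) (z w : B × Idx F → ℝ) :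
    (avgMatrix L *ᵥ z) ⬝ᵥ (avgMatrix L *ᵥ w) = z ⬝ᵥ w := by
  obtain ⟨A, rfl⟩ := (fieldCoord F B).surjective z
  obtain ⟨A', rfl⟩ := (fieldCoord F B).surjective w
  rw [avgMatrix_mulVec, avgMatrix_mulVec, ← sum_inner_eq_dotProduct F (L A) (L A'), ← sum_inner_eq_dotProduct F A A', hL]

/-- **«an orthogonal transformation of the fluctuation field B′»**: its chart matrix `A = avgMatrix L` is ORTHOGONAL, `AᵀA = 1`.
[cite: Balaban1987RG1, (2.16)–(2.18) p.269] -/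
theorem avgMatrix_transpose_mul_self_of_orthogonal (L : (B → F) →ₗ[ℝ] (B → F))
    (hL : ∀ A A' : B → F, ∑ b, ⟪L A b, L A' b⟫_ℝ = ∑ b, ⟪A b, A' b⟫_ℝ) : (avgMatrix L)ᵀ * avgMatrix L = 1 := by
  ext i j
  have h := dotProduct_avgMatrix_mulVec_of_orthogonal L hL (Pi.single i 1) (Pi.single j 1)
  rw [Matrix.mulVec_single_one, Matrix.mulVec_single_one, single_one_dotProduct, Pi.single_apply] at h
  rw [Matrix.mul_apply, Matrix.one_apply, ← h]
  rfl

/-- … and `AAᵀ = 1` (square matrices). [cite: Balaban1987RG1, (2.16)–(2.18) p.269] -/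
theorem avgMatrix_mul_transpose_self_of_orthogonal (L : (B → F) →ₗ[ℝ] (B → F))
    (hL : ∀ A A' : B → F, ∑ b, ⟪L A b, L A' b⟫_ℝ = ∑ b, ⟪A b, A' b⟫_ℝ) : avgMatrix L * (avgMatrix L)ᵀ = 1 :=
  mul_eq_one_comm.mp (avgMatrix_transpose_mul_self_of_orthogonal L hL)

/-- A linear map of the fields read through the inverse chart: `L(fieldCoord⁻¹ z) = fieldCoord⁻¹(A z)`. [cite: Balaban1987RG1, (2.16)–(2.18) p.269] -/
theorem apply_fieldCoord_symm (L : (B → F) →ₗ[ℝ] (B → F)) (z : B × Idx F → ℝ) :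
    L ((fieldCoord F B).symm z) = (fieldCoord F B).symm (avgMatrix L *ᵥ z) := by
  apply (fieldCoord F B).injective
  rw [LinearEquiv.apply_symm_apply, ← avgMatrix_mulVec, LinearEquiv.apply_symm_apply]

/-- **INTERTWINED OPERATORS HAVE CONJUGATED MATRICES for any orthogonal `L`**: `Δ′ ∘ L = L ∘ Δ` gives `M′ = A M Aᵀ` for the chart
matrices `M = avgMatrix Δ`, `M′ = avgMatrix Δ′`, `A = avgMatrix L` (the `rotLin` case is `avgMatrix_conj_of_intertwineLin`).
[cite: Balaban1987RG1, (2.16)–(2.18) p.269 with (2.11) p.267] -/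
theorem avgMatrix_conj_of_intertwine_of_orthogonal (L : (B → F) →ₗ[ℝ] (B → F))
    (hL : ∀ A A' : B → F, ∑ b, ⟪L A b, L A' b⟫_ℝ = ∑ b, ⟪A b, A' b⟫_ℝ) {Δ Δ' : (B → F) →ₗ[ℝ] (B → F)}
    (hΔ : ∀ A, Δ' (L A) = L (Δ A)) : avgMatrix Δ' = avgMatrix L * avgMatrix Δ * (avgMatrix L)ᵀ := by
  have hcomp : Δ' ∘ₗ L = L ∘ₗ Δ := LinearMap.ext hΔ
  have h1 : avgMatrix Δ' * avgMatrix L = avgMatrix L * avgMatrix Δ := by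
    rw [← avgMatrix_comp, ← avgMatrix_comp, hcomp]
  rw [← h1, Matrix.mul_assoc, avgMatrix_mul_transpose_self_of_orthogonal L hL, Matrix.mul_one]

variable [MeasurableSpace F] [BorelSpace F]

/-- **(2.18) ∕ (2.16) FOR PRINT'S GAUSSIAN, MEASURE LEVEL, ANY ORTHOGONAL TRANSFORMATION OF `B′`**: for a linear automorphism `L` of
the fields preserving the bond inner product, `(gaussField M).map L = gaussField (A M Aᵀ)`, `A = avgMatrix L` — r09's
`map_rotEquiv_gaussProb` (any orthogonal matrix) transported through the chart; the gauge case `L = R(u)` is `gaussField_map_rot`.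
[cite: Balaban1987RG1, (2.16)–(2.18) p.269] -/
theorem gaussField_map_of_orthogonal (L : (B → F) ≃ₗ[ℝ] (B → F))
    (hL : ∀ A A' : B → F, ∑ b, ⟪L A b, L A' b⟫_ℝ = ∑ b, ⟪A b, A' b⟫_ℝ) (M : Matrix (B × Idx F) (B × Idx F) ℝ) :
    (gaussField M).map ⇑L
      = gaussField (avgMatrix (L : (B → F) →ₗ[ℝ] (B → F)) * M * (avgMatrix (L : (B → F) →ₗ[ℝ] (B → F)))ᵀ) := by
  have hO := avgMatrix_transpose_mul_self_of_orthogonal (L : (B → F) →ₗ[ℝ] (B → F)) hL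
  have hmeas : Measurable ⇑L :=
    (LinearMap.continuous_of_finiteDimensional (L : (B → F) →ₗ[ℝ] (B → F))).measurable
  rw [gaussField, gaussField, Measure.map_map hmeas (fieldCoordM F B).symm.measurable]
  have hfun : ⇑L ∘ ⇑(fieldCoordM F B).symm
      = ⇑(fieldCoordM F B).symm ∘ ⇑(rotEquiv (avgMatrix (L : (B → F) →ₗ[ℝ] (B → F))) hO) := by
    funext z
    simp only [Function.comp_apply, fieldCoordM_symm_apply, rotEquiv_apply]
    exact apply_fieldCoord_symm (L : (B → F) →ₗ[ℝ] (B → F)) z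
  rw [hfun, ← Measure.map_map (fieldCoordM F B).symm.measurable (MeasurableEquiv.measurable _), map_rotEquiv_gaussProb]

/-- **COVARIANT PRECISIONS ⇒ COVARIANT MEASURES, any orthogonal `L`** (the hypothesis `hcov`∕`hμ` of `B12Eq213Body268` §3 for the
(2.17)–(2.18) pair `(τ, e) = (U ↦ rU, B′ ↦ the orthogonal map generated by r)`). [cite: Balaban1987RG1, (2.16)–(2.18) p.269] -/
theorem gaussField_map_of_orthogonal_of_conj {X : Type*} {τ : X → X} (L : (B → F) ≃ₗ[ℝ] (B → F))
    (hL : ∀ A A' : B → F, ∑ b, ⟪L A b, L A' b⟫_ℝ = ∑ b, ⟪A b, A' b⟫_ℝ) {prec : X → Matrix (B × Idx F) (B × Idx F) ℝ}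
    (hprec : ∀ U, prec (τ U) = avgMatrix (L : (B → F) →ₗ[ℝ] (B → F)) * prec U * (avgMatrix (L : (B → F) →ₗ[ℝ] (B → F)))ᵀ)
    (U : X) : (gaussField (prec U)).map ⇑L = gaussField (prec (τ U)) := by
  rw [gaussField_map_of_orthogonal L hL, hprec]

/-- **INTERTWINED OPERATORS ⇒ COVARIANT MEASURES, any orthogonal `L`**: `Δ(τU) ∘ L = L ∘ Δ(U)` gives `(dμ_U).map L = dμ_{τU}` for
`dμ_U = gaussField (avgMatrix (Δ U))`. [cite: Balaban1987RG1, (2.16)–(2.18) p.269 with (2.11) p.267] -/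
theorem gaussField_map_of_orthogonal_of_intertwine {X : Type*} {τ : X → X} (L : (B → F) ≃ₗ[ℝ] (B → F))
    (hL : ∀ A A' : B → F, ∑ b, ⟪L A b, L A' b⟫_ℝ = ∑ b, ⟪A b, A' b⟫_ℝ) (Δ : X → ((B → F) →ₗ[ℝ] (B → F)))
    (hΔ : ∀ U A, Δ (τ U) (L A) = L (Δ U A)) (U : X) :
    (gaussField (avgMatrix (Δ U))).map ⇑L = gaussField (avgMatrix (Δ (τ U))) :=
  gaussField_map_of_orthogonal_of_conj (τ := τ) (prec := fun U => avgMatrix (Δ U)) L hL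
    (fun U => avgMatrix_conj_of_intertwine_of_orthogonal (L : (B → F) →ₗ[ℝ] (B → F)) hL (hΔ U)) U

/-- **THE MEASURE CLAUSE OF (2.16)–(2.18) FROM THE INVARIANCE SENTENCE ALONE**: for ANY orthogonal `L` of the fluctuation field under
which the `C²` generating function of (2.11) is jointly invariant, `Q_{τU}(LB′) = Q_U(B′)`, print's Gaussian in `B′` with
precision `Δ^{(k)}(U)` = the operator representing `D²Q_U(0)` (pre-elimination, cf. §2 ∕ §3; print's `C^{(k)}(U)` is its covariance in
the remaining variables) is COVARIANT: `(dμ_U).map L = dμ_{τU}` — §8's `intertwine_of_hessian_of_orthogonal`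
fed to `gaussField_map_of_orthogonal_of_intertwine`; *«all the remaining operations preserve the invariance for the same reasons»*.
[cite: Balaban1987RG1, (2.16)–(2.18) p.269 with (2.11) p.267] -/
theorem gaussField_map_of_orthogonal_of_hessian {X : Type*} {τ : X → X} (L : (B → F) ≃ₗ[ℝ] (B → F))
    (hL : ∀ A A' : B → F, ∑ b, ⟪L A b, L A' b⟫_ℝ = ∑ b, ⟪A b, A' b⟫_ℝ) (Q : X → (B → F) → ℝ)
    (hQ : ∀ U, ContDiff ℝ 2 (Q U)) (hinv : ∀ U A, Q (τ U) (L A) = Q U A) (Δ : X → ((B → F) →ₗ[ℝ] (B → F)))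
    (hΔ : ∀ U (A A' : B → F), ∑ b, ⟪A b, Δ U A' b⟫_ℝ = fderiv ℝ (fderiv ℝ (Q U)) 0 A A') (U : X) :
    (gaussField (avgMatrix (Δ U))).map ⇑L = gaussField (avgMatrix (Δ (τ U))) :=
  gaussField_map_of_orthogonal_of_intertwine L hL Δ (fun U A => intertwine_of_hessian_of_orthogonal L hL Q hQ hinv Δ hΔ U A) U

end Orthogonal

end

end Literature.MathematicalPhysics.QuantumFieldTheory.Balaban1983to89.B12Eq216GaussianCarrier
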